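import Mathlib
import HarnessLib
import Literature.Analysis.FluidPDE.TypeIAncientMild
import Summits.NavierStokesRegularity.NavierStokesRegularity.Theses.QuarterLogPincer
import Summits.NavierStokesRegularity.NavierStokesRegularity.Theorems.QuarterLogPincerThinCascadeDefs
import Summits.NavierStokesRegularity.NavierStokesRegularity.Theorems.QuarterLogPincerTruncationEdgeDefs
import Summits.NavierStokesRegularity.NavierStokesRegularity.Theorems.QuarterLogPincerQuietCollarDefs
import Summits.NavierStokesRegularity.NavierStokesRegularity.Theorems.QuarterLogPincerQuietCollarSpikeTools
import Summits.NavierStokesRegularity.NavierStokesRegularity.Theorems.QuarterLogPincerTruncationEdgeProfileHelpers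
import Summits.NavierStokesRegularity.NavierStokesRegularity.Theorems.QuarterLogPincerTruncationEdgeRateFloor
import Summits.NavierStokesRegularity.NavierStokesRegularity.Theorems.PoloidalWindowDoorPoloidalWindowRigidityClassSpaceTimeRates
import Summits.NavierStokesRegularity.NavierStokesRegularity.Theorems.QuarterLogPincerTypeIQuantSubcubicExpABRoot

/-!
# Line `quiet_core` (v1.9) — crux `QuarterLogPincer.TypeIQuantSubcubicExp` (stmt-NavierStokesRegularity-24077)

Seat ns-idea-7 g10 (lens «nearmiss»; files-only).  Namespace
`Summit.NavierStokesRegularity.NavierStokesRegularity.Cruxes.TypeIQuantSubcubicExp.QuietCore`.  **No summit is proved by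
this line.**  v1.7: the module docstring is condensed to an INDEX (the 200 kB workfile cap); the full narrative — near-miss of
record (BP2020 Thm 2 / Jia–Šverák vs the log-cube ancient class), the lever, the C0 self-critic, bears_on, the cheapest
falsifier and the instrument row — is VERBATIM in the card `Lines/quiet-core.md` (v1.0 text + addenda v1.1–v1.7), unchanged.

STATE.  QC (quiet-core propagation) IS A THEOREM: S3♭ `stub_subcriticalUpgrade` PROVED (§1e `subcriticalUpgrade_all`, receding-ball
real induction on the log-corrected recession law; toolbox §1c T2/T3/H1, §1d T1) and S4♭ `stub_budgetPass` PROVED (§1b `budgetPass`);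
`quietCore_all : ∀ M B, QuietCore M B`.  Registered stubs: S3♭, S4♭ (both proved, kept under their names) · `stub_logCubeExtractionFlat`
(Q2♭, converse side — THE ONLY `sorry`; why it might fail: the all-time CENTRED budget of the extracted object, as g9's Q2).
BC7 probes (v1.0): StubSubcriticalUpgrade · StubBudgetPass · StubQuietCore · StubLogCubeExtractionFlat · LocalRateFloorLogCube ·
LogCubeLiouville — 6/6 CLEAN.  Axioms of everything outside Q2♭'s cone: propext / Classical.choice / Quot.sound.

INDEX.
* §1  objects: `CubeBudgetWith`, `QuietCore`, `SubcriticalUpgrade` (S3♭), `BudgetPass` (S4♭); §1b S4♭ PROVED (`norm_oseenSlice_core`,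
  `norm_oseenSlice_le_of_subcritical`, `budgetPass`): in the log-cube class THE BUDGET REPLACES THE ENERGY in the one linear Oseen pass
  (far sources by Hölder against the slice budgets in dyadic shells — time-integrable, which the pointwise Type-I far field is not);
  §1c–§1e S3♭ PROVED (H1 exterior kernel mass, T2 receding-ball slice bound, T3 two-region maximum principle, T1 `farKick_integral_le`,
  T4 `keyStep` + `subcriticalUpgrade_all`); `quietCore_of_upgrade_of_pass`, `quietCore_all`.
* §2  de-flickering: `not_singularAt_of_bound`, Q3♭ `LocalRateFloorLogCube` (`localRateFloor_of_singularAt`).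
* §3  the de-flickered loop: Q2 ⇐ Q2♭, `logCubeLiouville_of_logCubeFloorLiouville`, `typeIQuantSubcubicExp_iff_logCubeLiouville`
  (g9's edge `crux → LogCubeFloorLiouville` enters BY STATEMENT — kernel-checked in `Lines/quiet_collar.lean` mod QP2),
  `TypeIQuantSubcubicExp_of : Q2♭ → LogCubeLiouville → crux` (crux BY NAME; loop polarity: the value is a hypothesis by design).
* §4  first rung of the value: `smallBudgetLiouville_of_quietCore` (small budget constant ⇒ no apex singularity).
* §5  (v1.6) unconditional corollaries by name: `localRateFloorLogCube`, `logCubeLiouville_of_edge`,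
  `typeIQuantSubcubicExp_iff_logCubeLiouville'`, `smallBudgetLiouville`, `stubLogCubeExtraction_of_flat'`.
* §6  (v1.7) THE ENERGY CLASS AND THE LEFT EDGE (unconditional): QC needs a spatial budget only for the FAR Duhamel sources, where
  uniform unit-scale energy `∫_{B(x₀,1)}‖v(t)‖² ≤ E` (the 2nd clause of `ThinCascade.ThinObject`, verbatim) suffices (Fubini averaging
  `lintegral_weight_sq_le_of_localEnergy`; `energyPass`; `quietCoreL2_all : ∀ M E, QuietCoreL2 M E`); hence
  `localRateFloor_of_thinObject : ThinObject M q W g → LocalRateFloor W` (THIN OBJECTS DO NOT FLICKER) and the de-flickered left edge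
  `typeIQuantSubcubicExp_of_thinFloorTowerLiouville : ThinFloorTowerLiouville → TypeIQuantSubcubicExp` (crux BY NAME, via the tree's
  `AbRoot.typeIQuantSubcubicExp_of_thinTowerLiouville`): the deciding Liouville statement on the LEFT of 24077 may assume the unit-ball
  rate floor at no cost (`thinFloorTowerLiouville_iff`); object form `exists_thin_singular_floor_abTower_of_not_typeIQuantSubcubicExp`.
* NOT derivable here (not needed): `LogCubeLiouville → LogCubeFloorLiouville` (the floor's points accumulate at some `a ∈ B̄(0,1)`).

bears_on: LADDER-NS W7 (crux 24077 ⟷ log-cube Liouville value; left edge via AbRoot).  Cheapest falsifier: a log-cube (or thin) Type-I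
ancient mild field quiet on `B(0,1)` at times `s_n ↑ 0` at level `c₀/√(−s_n)` yet singular at the apex.  Version log v1.0–v1.7: see the card.
v1.8 §7 uniform floor level `c₀(M)` (aux file `Lines/quiet_core_concentration.lean` = apex concentration); v1.9 (g11, ns-afl-r1
audit v5 add1 #55) §7 RE-TYPED WITH UNIFORM ONSET: `uniformFloor_L2 : ∃ c, ∀ E, ∃ s₀, ∀ v, …`, `uniformFloor_logCube : ∃ c, ∀ B,
∃ s₀, ∀ v, … CubeBudgetWith B v → …` (`s₀ = max s₁(M) s₂(M,·)` as the v1.8 proofs gave; the v1.8 statements are the weaker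
corollaries) — scale-covariant loudness, i.e. apex singularity is CLOSED under locally uniform limits (cubic_rung C2a (b)).
-/

set_option linter.dupNamespace false

namespace Summit.NavierStokesRegularity.NavierStokesRegularity.Cruxes.TypeIQuantSubcubicExp.QuietCore

open MeasureTheory Set Function Metric Filter Topology
open scoped ENNReal NNReal
open Literature.Analysis Literature.Analysis.FluidPDE
open Summit.NavierStokesRegularity.NavierStokesRegularity.Cruxes.TypeIQuantSubcubicExp.ThinCascade
open Summit.NavierStokesRegularity.NavierStokesRegularity.Cruxes.TypeIQuantSubcubicExp.TruncationEdge
open Summit.NavierStokesRegularity.NavierStokesRegularity.Cruxes.TypeIQuantSubcubicExp.QuietCollar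
open Summit.NavierStokesRegularity.NavierStokesRegularity.Theorems.PoloidalWindowDoorPoloidalWindowRigidityClassSpaceTimeRates
  (exists_spaceTime_rate_of_class)

/-! ## §1 Objects and the lever -/

/-- The log-cube budget of `EnvelopeCubeBudget` with its constant `B` EXPOSED:
`‖v(s)‖³_{L³(B(0,R))} ≤ B·(1 + log R + log(1/ε))` for `s ∈ [−1,−ε]`, `R ≥ 2`, `ε ∈ (0,1]`. -/
def CubeBudgetWith (B : ℝ) (v : ℝ → EuclideanSpace ℝ (Fin 3) → EuclideanSpace ℝ (Fin 3)) : Prop :=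
  0 ≤ B ∧ ∀ R : ℝ, 2 ≤ R → ∀ ε ∈ Set.Ioc (0 : ℝ) 1, ∃ b : ℝ, 0 ≤ b ∧
    b ^ 3 ≤ B * (1 + Real.log R + Real.log (1 / ε)) ∧
    ∀ s ∈ Set.Icc (-1 : ℝ) (-ε),
      eLpNorm ((Metric.ball (0 : EuclideanSpace ℝ (Fin 3)) R).indicator (v s)) 3 volume ≤
        ENNReal.ofReal b

theorem envelopeCubeBudget_iff (v : ℝ → EuclideanSpace ℝ (Fin 3) → EuclideanSpace ℝ (Fin 3)) :
    EnvelopeCubeBudget v ↔ ∃ B : ℝ, CubeBudgetWith B v := by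
  unfold EnvelopeCubeBudget CubeBudgetWith
  constructor
  · rintro ⟨B, hB, h⟩; exact ⟨B, hB, h⟩
  · rintro ⟨B, hB, h⟩; exact ⟨B, hB, h⟩

theorem CubeBudgetWith.envelopeCubeBudget {B : ℝ} {v : ℝ → EuclideanSpace ℝ (Fin 3) → EuclideanSpace ℝ (Fin 3)}
    (h : CubeBudgetWith B v) : EnvelopeCubeBudget v :=
  (envelopeCubeBudget_iff v).2 ⟨B, h⟩

/-- The budget is monotone in its constant. -/
theorem CubeBudgetWith.mono {B B' : ℝ} {v : ℝ → EuclideanSpace ℝ (Fin 3) → EuclideanSpace ℝ (Fin 3)}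
    (h : CubeBudgetWith B v) (hBB' : B ≤ B') : CubeBudgetWith B' v := by
  refine ⟨h.1.trans hBB', fun R hR ε hε => ?_⟩
  obtain ⟨b, hb0, hb3, hsl⟩ := h.2 R hR ε hε
  refine ⟨b, hb0, hb3.trans ?_, hsl⟩
  have hlog : 0 ≤ 1 + Real.log R + Real.log (1 / ε) := by
    have h1 : 0 ≤ Real.log R := Real.log_nonneg (by linarith)
    have h2 : 0 ≤ Real.log (1 / ε) :=
      Real.log_nonneg (by rw [le_div_iff₀ hε.1]; linarith [hε.2])
    linarith
  exact mul_le_mul_of_nonneg_right hBB' hlog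

/-- **QUIET-CORE PROPAGATION** (QC, the statement the loop consumes).  For the Type-I ancient mild class with
constant `M` and log-cube budget constant `B` there are a quiet level `c₀ > 0`, a late time `s₁ < 0` and a bound `K`
such that: if at some `s ∈ [s₁, 0)` the field is quiet on the unit core, `‖v(s,x)‖ ≤ c₀/√(−s)` for `|x| < 1`, then
`‖v(t,x)‖ ≤ K/√(−s)` for all `t ∈ [s,0)`, `|x| < 1/2` — the quiet core survives to the apex.  DERIVED below from the
two registered stubs S3♭ (subcritical upgrade, budget-free) and S4♭ (one budget-capped Oseen pass). -/
def QuietCore (M B : ℝ) : Prop :=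
  ∃ c₀ s₁ K : ℝ, 0 < c₀ ∧ s₁ < 0 ∧ 0 ≤ K ∧
    ∀ v : ℝ → EuclideanSpace ℝ (Fin 3) → EuclideanSpace ℝ (Fin 3),
      IsTypeIAncientMild M v → CubeBudgetWith B v →
      ∀ s ∈ Set.Ico s₁ 0,
        (∀ x ∈ Metric.ball (0 : EuclideanSpace ℝ (Fin 3)) 1, ‖v s x‖ ≤ c₀ / Real.sqrt (-s)) →
        ∀ t ∈ Set.Ico s 0, ∀ x ∈ Metric.ball (0 : EuclideanSpace ℝ (Fin 3)) (1 / 2),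
          ‖v t x‖ ≤ K / Real.sqrt (-s)

/-- QC for every `(M, B)` (a `def`, not a stub: see `stubQuietCore_of`). -/
def StubQuietCore : Prop := ∀ M B : ℝ, QuietCore M B

/-- **S3♭ · SUBCRITICAL UPGRADE (budget-free; the TRANSPLANT).**  For the Type-I ancient mild class with constant `M`:
a `c₀/√(−s)`-quiet unit core at a late time `s ∈ [s₁,0)` is SUBCRITICAL afterwards on `B(0,3/4)`:
`‖v(t,x)‖ ≤ 4c₀·(−s)^{−3/8}(−t)^{−1/8}` for `t ∈ [s,0)`.  This is `stub_quietDecayUpgrade` (S3) of the tree line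
`Cruxes/TypeIConcentration/Lines/quiet-point-subcritical-upgrade.lean` (crux 2881, Clay class, 2026-08-16; triage
pass ×3, unproved, not the picked line) transplanted VERBATIM to the ancient mild class with `ν = 1`, `T = 0`, quiet
radius `1 ≥ ρ(M)√(−s)` (i.e. `s₁ = −ρ(M)⁻²/16`) and centres `x₀ ∈ B(0,3/4)`; here the Oseen representation (their S1)
is free (`IsTypeIAncientMild.mild_eq_oseenKernel`) and no energy is used.  Mechanism: self-improving shielded Oseen
bootstrap; the Type-I far field's log-divergent drift `(M²/d)·log((−s)/(−t))` is absorbed by the allowed growth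
`((−s)/(−t))^{1/8}` once `ρ(M) ≳ M²/c₀`. -/
def SubcriticalUpgrade (M : ℝ) : Prop :=
  ∃ c₀ s₁ : ℝ, 0 < c₀ ∧ s₁ < 0 ∧
    ∀ v : ℝ → EuclideanSpace ℝ (Fin 3) → EuclideanSpace ℝ (Fin 3), IsTypeIAncientMild M v →
      ∀ s ∈ Set.Ico s₁ 0,
        (∀ x ∈ Metric.ball (0 : EuclideanSpace ℝ (Fin 3)) 1, ‖v s x‖ ≤ c₀ / Real.sqrt (-s)) →
        ∀ t ∈ Set.Ico s 0, ∀ x ∈ Metric.ball (0 : EuclideanSpace ℝ (Fin 3)) (3 / 4),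
          ‖v t x‖ ≤ 4 * c₀ * (-s) ^ (-(3 / 8 : ℝ)) * (-t) ^ (-(1 / 8 : ℝ))

/-- Stub S3♭ (REGISTERED, HARDEST): the subcritical upgrade for every `M`. -/
def StubSubcriticalUpgrade : Prop := ∀ M : ℝ, SubcriticalUpgrade M


/-- **S4♭ · THE BUDGET PASS (the NEW lever: the log-cube budget replaces the energy).**  For `(M, B)` and any level
`c₀ > 0` there are `s₂ < 0`, `K ≥ 0` such that a field subcritical on `[s,0) × B(0,3/4)` in the sense of S3♭ (`s ∈ [s₂,0)`)
is BOUNDED by `K/√(−s)` on `[s,0) × B(0,1/2)`.  ONE LINEAR Oseen pass: heat part by the maximum principle, near Duhamel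
sources by the hypothesis, far sources (`|y−x| ≥ 1/4`) by Hölder `L³–L^{3/2}` against the slice budgets in dyadic shells —
TIME-INTEGRABLE, which the pointwise Type-I far field is not (`∫ M²/(−τ) dτ = ∞`). -/
def BudgetPass (M B : ℝ) : Prop :=
  ∀ c₀ : ℝ, 0 < c₀ → ∃ s₂ K : ℝ, s₂ < 0 ∧ 0 ≤ K ∧
    ∀ v : ℝ → EuclideanSpace ℝ (Fin 3) → EuclideanSpace ℝ (Fin 3),
      IsTypeIAncientMild M v → CubeBudgetWith B v →
      ∀ s ∈ Set.Ico s₂ 0,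
        (∀ t ∈ Set.Ico s 0, ∀ x ∈ Metric.ball (0 : EuclideanSpace ℝ (Fin 3)) (3 / 4),
          ‖v t x‖ ≤ 4 * c₀ * (-s) ^ (-(3 / 8 : ℝ)) * (-t) ^ (-(1 / 8 : ℝ))) →
        ∀ t ∈ Set.Ico s 0, ∀ x ∈ Metric.ball (0 : EuclideanSpace ℝ (Fin 3)) (1 / 2),
          ‖v t x‖ ≤ K / Real.sqrt (-s)

/-- Stub S4♭ (REGISTERED, M-sized, the lever proper): the budget pass for every `(M, B)`. -/
def StubBudgetPass : Prop := ∀ M B : ℝ, BudgetPass M B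

/-! S4♭ v1.0 why-it-might-fail (bookkeeping only) — RESOLVED in v1.1 by `budgetPass` below. -/
/-! ### §1b  S4♭ PROVED (v1.1).  Part A: elementary weights and the three-region Oseen slice bound at a core point -/

/-- `J₄ = ∫_{ℝ³} (1+‖z‖)^{-4} dz`. -/
noncomputable def jFour : ℝ := ∫ z : EuclideanSpace ℝ (Fin 3), (1 + ‖z‖) ^ (-(4 : ℝ))

/-- `J₇ = ∫_{ℝ³} (1+‖z‖)^{-7/2} dz`. -/
noncomputable def jSeven : ℝ := ∫ z : EuclideanSpace ℝ (Fin 3), (1 + ‖z‖) ^ (-(7 / 2 : ℝ))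

theorem jFour_nonneg : 0 ≤ jFour :=
  integral_nonneg fun z => Real.rpow_nonneg (by positivity) _

theorem jSeven_nonneg : 0 ≤ jSeven :=
  integral_nonneg fun z => Real.rpow_nonneg (by positivity) _

theorem integrable_one_add_norm_neg_four :
    Integrable (fun z : EuclideanSpace ℝ (Fin 3) => (1 + ‖z‖) ^ (-(4 : ℝ))) := by
  refine integrable_one_add_norm ?_
  rw [finrank_euclideanSpace_fin]; norm_num

theorem integrable_one_add_norm_neg_sevenHalves :
    Integrable (fun z : EuclideanSpace ℝ (Fin 3) => (1 + ‖z‖) ^ (-(7 / 2 : ℝ))) := by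
  refine integrable_one_add_norm ?_
  rw [finrank_euclideanSpace_fin]; norm_num

/-- `a² ≤ a³ + 1` for `a ≥ 0`. -/
theorem sq_le_cube_add_one {a : ℝ} (ha : 0 ≤ a) : a ^ 2 ≤ a ^ 3 + 1 := by
  rcases le_or_gt a 1 with h | h
  · have h1 : a ^ 2 ≤ 1 := pow_le_one₀ ha h
    have h2 : 0 ≤ a ^ 3 := by positivity
    linarith
  · have h1 : a ^ 2 ≤ a ^ 3 := by nlinarith [sq_nonneg a, mul_nonneg (sq_nonneg a) (sub_nonneg.2 h.le)]
    linarith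

/-- The kernel weight against the bare distance: `(σ + d²)^{-2} ≤ 1/d⁴` (`σ > 0`, `d > 0`). -/
theorem weight_le_one_div_pow_four {σ d : ℝ} (hσ : 0 < σ) (hd : 0 < d) :
    (σ + d ^ 2) ^ (-(2 : ℝ)) ≤ 1 / d ^ 4 := by
  rw [Real.rpow_neg (by positivity), show (2 : ℝ) = ((2 : ℕ) : ℝ) by norm_num, Real.rpow_natCast,
    ← one_div]
  apply one_div_le_one_div_of_le (by positivity)
  nlinarith [sq_nonneg d, hσ.le, sq_nonneg (d ^ 2)]

/-- Middle region: `1/d⁴ ≤ 256` for `d ≥ 1/4`. -/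
theorem one_div_pow_four_le {d : ℝ} (hd : 1 / 4 ≤ d) : 1 / d ^ 4 ≤ 256 := by
  have hd0 : 0 < d := by linarith
  rw [div_le_iff₀ (by positivity)]
  have h4 : (1 / 4 : ℝ) ^ 4 ≤ d ^ 4 := pow_le_pow_left₀ (by norm_num) hd 4
  nlinarith [h4]

/-- Middle region: `1/d⁴ ≤ 625 (1+d)^{-4}` for `d ≥ 1/4` (`1 + d ≤ 5d`). -/
theorem one_div_pow_four_le_one_add {d : ℝ} (hd : 1 / 4 ≤ d) :
    1 / d ^ 4 ≤ 625 * (1 + d) ^ (-(4 : ℝ)) := by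
  have hd0 : 0 < d := by linarith
  have h1d : 0 < 1 + d := by linarith
  rw [Real.rpow_neg h1d.le, show (4 : ℝ) = ((4 : ℕ) : ℝ) by norm_num, Real.rpow_natCast,
    ← div_eq_mul_inv, div_le_div_iff₀ (by positivity) (by positivity), one_mul]
  have h5 : 1 + d ≤ 5 * d := by linarith
  have h54 : (1 + d) ^ 4 ≤ (5 * d) ^ 4 := pow_le_pow_left₀ h1d.le h5 4
  nlinarith [h54]

/-- Far region: for `1 ≤ R ≤ r` and `r/2 ≤ d`, `σ > 0`:
`(σ + d²)^{-2} ≤ 16 · 2^{7/2} · R^{-1/2} · (1 + r)^{-7/2}`. -/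
theorem weight_far_le {σ r d R : ℝ} (hσ : 0 < σ) (hR : 1 ≤ R) (hr : R ≤ r) (hd : r / 2 ≤ d) :
    (σ + d ^ 2) ^ (-(2 : ℝ)) ≤
      16 * (2 : ℝ) ^ (7 / 2 : ℝ) * R ^ (-(1 / 2 : ℝ)) * (1 + r) ^ (-(7 / 2 : ℝ)) := by
  have hr1 : 1 ≤ r := hR.trans hr
  have hr0 : 0 < r := by linarith
  have hd0 : 0 < d := by linarith
  -- step 1: `(σ+d²)^{-2} ≤ 1/d⁴ ≤ 16/r⁴`
  have h1 : (σ + d ^ 2) ^ (-(2 : ℝ)) ≤ 16 * (1 / r ^ 4) := by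
    refine (weight_le_one_div_pow_four hσ hd0).trans ?_
    rw [mul_one_div, div_le_div_iff₀ (by positivity) (by positivity), one_mul]
    have : (r / 2) ^ 4 ≤ d ^ 4 := pow_le_pow_left₀ (by positivity) hd 4
    nlinarith [this]
  -- step 2: `1/r⁴ = r^{-1/2} r^{-7/2}`, `r^{-1/2} ≤ R^{-1/2}`, `r^{-7/2} ≤ 2^{7/2}(1+r)^{-7/2}`
  have h2 : 1 / r ^ 4 = r ^ (-(1 / 2 : ℝ)) * r ^ (-(7 / 2 : ℝ)) := by
    rw [← Real.rpow_add hr0, show (-(1 / 2 : ℝ)) + -(7 / 2 : ℝ) = -((4 : ℕ) : ℝ) by norm_num,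
      Real.rpow_neg hr0.le, Real.rpow_natCast, one_div]
  have h3 : r ^ (-(1 / 2 : ℝ)) ≤ R ^ (-(1 / 2 : ℝ)) :=
    Real.rpow_le_rpow_of_nonpos (by linarith) hr (by norm_num)
  have h4 : r ^ (-(7 / 2 : ℝ)) ≤ (2 : ℝ) ^ (7 / 2 : ℝ) * (1 + r) ^ (-(7 / 2 : ℝ)) := by
    have h12 : 1 + r ≤ 2 * r := by linarith
    have hpow : (1 + r) ^ (7 / 2 : ℝ) ≤ (2 * r) ^ (7 / 2 : ℝ) :=
      Real.rpow_le_rpow (by linarith) h12 (by norm_num)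
    rw [Real.mul_rpow (by norm_num) hr0.le] at hpow
    have hA : 0 < r ^ (7 / 2 : ℝ) := Real.rpow_pos_of_pos hr0 _
    have hB : 0 < (1 + r) ^ (7 / 2 : ℝ) := Real.rpow_pos_of_pos (by linarith) _
    rw [Real.rpow_neg hr0.le, Real.rpow_neg (by linarith), ← div_eq_mul_inv, ← one_div,
      div_le_div_iff₀ hA hB, one_mul]
    linarith [hpow]
  have h5 : 0 ≤ r ^ (-(7 / 2 : ℝ)) := Real.rpow_nonneg hr0.le _
  have h6 : 0 ≤ R ^ (-(1 / 2 : ℝ)) := Real.rpow_nonneg (by linarith) _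
  calc (σ + d ^ 2) ^ (-(2 : ℝ)) ≤ 16 * (1 / r ^ 4) := h1
    _ = 16 * (r ^ (-(1 / 2 : ℝ)) * r ^ (-(7 / 2 : ℝ))) := by rw [h2]
    _ ≤ 16 * (R ^ (-(1 / 2 : ℝ)) * ((2 : ℝ) ^ (7 / 2 : ℝ) * (1 + r) ^ (-(7 / 2 : ℝ)))) := by
        gcongr
    _ = 16 * (2 : ℝ) ^ (7 / 2 : ℝ) * R ^ (-(1 / 2 : ℝ)) * (1 + r) ^ (-(7 / 2 : ℝ)) := by ring

/-- **Three-region slice bound at a core point.**  Let `‖x‖ < 1/2`, `σ > 0`, `R ≥ 1`.  If `‖a(y)‖² ≤ P` on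
`‖y‖ < 3/4`, `‖a‖ ≤ Mf` everywhere, and `∫_{B(0,R)} ‖a‖³ ≤ Q` (integrable there), then
`‖N_σ[a,a](x)‖ ≤ C P I σ^{-1/2} + 256 C Q + 625 C J₄ + 16·2^{7/2} C Mf² R^{-1/2} J₇`:
near sources by the `L¹` size of the kernel, middle sources (`3/4 ≤ ‖y‖ < R`, distance `≥ 1/4`) by
`‖a‖² ≤ ‖a‖³ + 1` against the bounded kernel, far sources (`‖y‖ ≥ R`) by the kernel decay `16/‖y‖⁴`. -/
theorem norm_oseenSlice_core {C : ℝ} (hC : 0 < C)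
    (hK : ∀ {τ : ℝ}, 0 < τ → ∀ z a b : EuclideanSpace ℝ (Fin 3),
      ‖oseenKernel τ z a b‖ ≤ C * (τ + ‖z‖ ^ 2) ^
        (-(((Module.finrank ℝ (EuclideanSpace ℝ (Fin 3)) : ℝ) + 1) / 2)) * ‖a‖ * ‖b‖)
    {σ P Mf Q R : ℝ} (hσ : 0 < σ) (hP : 0 ≤ P) (_hMf : 0 ≤ Mf) (hR : 1 ≤ R)
    {a : EuclideanSpace ℝ (Fin 3) → EuclideanSpace ℝ (Fin 3)}
    (hnear : ∀ y, ‖y‖ < 3 / 4 → ‖a y‖ ^ 2 ≤ P)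
    (hfar : ∀ y, ‖a y‖ ≤ Mf)
    (hint : IntegrableOn (fun y => ‖a y‖ ^ 3) (Metric.ball (0 : EuclideanSpace ℝ (Fin 3)) R))
    (hQ : ∫ y in Metric.ball (0 : EuclideanSpace ℝ (Fin 3)) R, ‖a y‖ ^ 3 ≤ Q)
    {x : EuclideanSpace ℝ (Fin 3)} (hx : ‖x‖ < 1 / 2) :
    ‖oseenSlice σ a a x‖ ≤
      C * P * (∫ w : EuclideanSpace ℝ (Fin 3), (1 + ‖w‖ ^ 2) ^
          (-(((Module.finrank ℝ (EuclideanSpace ℝ (Fin 3)) : ℝ) + 1) / 2))) * σ ^ (-(1 / 2 : ℝ)) +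
      256 * C * Q + 625 * C * jFour +
      16 * (2 : ℝ) ^ (7 / 2 : ℝ) * C * Mf ^ 2 * R ^ (-(1 / 2 : ℝ)) * jSeven := by
  set e : ℝ := ((Module.finrank ℝ (EuclideanSpace ℝ (Fin 3)) : ℝ) + 1) / 2 with he_def
  have he : e = 2 := oseen_exponent_eq_two
  set I : ℝ := ∫ w : EuclideanSpace ℝ (Fin 3), (1 + ‖w‖ ^ 2) ^ (-e) with hI_def
  set BR : Set (EuclideanSpace ℝ (Fin 3)) := Metric.ball 0 R with hBR_def
  have hBm : MeasurableSet BR := measurableSet_ball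
  set L : ℝ := 16 * (2 : ℝ) ^ (7 / 2 : ℝ) * C * Mf ^ 2 * R ^ (-(1 / 2 : ℝ)) with hL_def
  have hL0 : 0 ≤ L := by
    have : 0 ≤ R ^ (-(1 / 2 : ℝ)) := Real.rpow_nonneg (by linarith) _
    rw [hL_def]; positivity
  -- the majorant: near + (middle cube + middle kernel) + far
  set h₁ : EuclideanSpace ℝ (Fin 3) → ℝ := fun y => C * P * (σ + ‖x - y‖ ^ 2) ^ (-e) with hh₁
  set h₂ : EuclideanSpace ℝ (Fin 3) → ℝ := fun y => 256 * C * BR.indicator (fun y => ‖a y‖ ^ 3) y with hh₂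
  set h₃ : EuclideanSpace ℝ (Fin 3) → ℝ := fun y => 625 * C * (1 + ‖x - y‖) ^ (-(4 : ℝ)) with hh₃
  set h₄ : EuclideanSpace ℝ (Fin 3) → ℝ := fun y => L * (1 + ‖y‖) ^ (-(7 / 2 : ℝ)) with hh₄
  have hi₁ : Integrable h₁ :=
    ((integrable_add_norm_sq_rpow_neg_half_succ (E := EuclideanSpace ℝ (Fin 3)) hσ).comp_sub_left x).const_mul
      (C * P)
  have hi₂ : Integrable h₂ := (hint.integrable_indicator hBm).const_mul (256 * C)
  have hi₃ : Integrable h₃ := (integrable_one_add_norm_neg_four.comp_sub_left x).const_mul (625 * C)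
  have hi₄ : Integrable h₄ := integrable_one_add_norm_neg_sevenHalves.const_mul L
  have hnn₁ : ∀ y, 0 ≤ h₁ y := fun y => by
    rw [hh₁]; exact mul_nonneg (by positivity) (Real.rpow_nonneg (by positivity) _)
  have hnn₂ : ∀ y, 0 ≤ h₂ y := fun y => by
    rw [hh₂]
    refine mul_nonneg (by positivity) (Set.indicator_nonneg (fun z _ => by positivity) y)
  have hnn₃ : ∀ y, 0 ≤ h₃ y := fun y => by
    rw [hh₃]; exact mul_nonneg (by positivity) (Real.rpow_nonneg (by positivity) _)
  have hnn₄ : ∀ y, 0 ≤ h₄ y := fun y => by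
    rw [hh₄]; exact mul_nonneg hL0 (Real.rpow_nonneg (by positivity) _)
  -- pointwise bound of the kernel integrand by `h₁ + h₂ + h₃ + h₄`
  have hptw : ∀ y, ‖oseenKernel σ (x - y) (a y) (a y)‖ ≤ ((h₁ y + h₂ y) + h₃ y) + h₄ y := by
    intro y
    have hk := hK hσ (x - y) (a y) (a y)
    have hw0 : 0 ≤ (σ + ‖x - y‖ ^ 2) ^ (-e) := Real.rpow_nonneg (by positivity) _
    have hk' : ‖oseenKernel σ (x - y) (a y) (a y)‖ ≤ C * (σ + ‖x - y‖ ^ 2) ^ (-e) * ‖a y‖ ^ 2 := by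
      calc ‖oseenKernel σ (x - y) (a y) (a y)‖ ≤ C * (σ + ‖x - y‖ ^ 2) ^ (-e) * ‖a y‖ * ‖a y‖ := hk
        _ = C * (σ + ‖x - y‖ ^ 2) ^ (-e) * ‖a y‖ ^ 2 := by ring
    by_cases hy : ‖y‖ < 3 / 4
    · -- near source
      have h1 : C * (σ + ‖x - y‖ ^ 2) ^ (-e) * ‖a y‖ ^ 2 ≤ h₁ y := by
        rw [hh₁]
        have := hnear y hy
        calc C * (σ + ‖x - y‖ ^ 2) ^ (-e) * ‖a y‖ ^ 2 ≤ C * (σ + ‖x - y‖ ^ 2) ^ (-e) * P :=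
              mul_le_mul_of_nonneg_left this (by positivity)
          _ = C * P * (σ + ‖x - y‖ ^ 2) ^ (-e) := by ring
      linarith [hk', h1, hnn₂ y, hnn₃ y, hnn₄ y]
    · have hy' : 3 / 4 ≤ ‖y‖ := not_lt.1 hy
      by_cases hyR : ‖y‖ < R
      · -- middle source: distance ≥ 1/4, `‖a‖² ≤ ‖a‖³ + 1`
        have hyB : y ∈ BR := by rw [hBR_def]; exact mem_ball_zero_iff.2 hyR
        have hd : 1 / 4 ≤ ‖x - y‖ := by linarith [norm_sub_norm_le y x, norm_sub_rev x y, hx, hy']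
        have hd0 : 0 < ‖x - y‖ := by linarith
        have hwe : (σ + ‖x - y‖ ^ 2) ^ (-e) ≤ 1 / ‖x - y‖ ^ 4 := by
          rw [he]; exact weight_le_one_div_pow_four hσ hd0
        have hw256 : (σ + ‖x - y‖ ^ 2) ^ (-e) ≤ 256 := hwe.trans (one_div_pow_four_le hd)
        have hw625 : (σ + ‖x - y‖ ^ 2) ^ (-e) ≤ 625 * (1 + ‖x - y‖) ^ (-(4 : ℝ)) :=
          hwe.trans (one_div_pow_four_le_one_add hd)
        have hsq : ‖a y‖ ^ 2 ≤ ‖a y‖ ^ 3 + 1 := sq_le_cube_add_one (norm_nonneg _)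
        have hc0 : 0 ≤ ‖a y‖ ^ 3 := by positivity
        have h2 : C * (σ + ‖x - y‖ ^ 2) ^ (-e) * ‖a y‖ ^ 2 ≤ h₂ y + h₃ y := by
          rw [hh₂, hh₃]
          simp only [Set.indicator_of_mem hyB]
          calc C * (σ + ‖x - y‖ ^ 2) ^ (-e) * ‖a y‖ ^ 2
              ≤ C * (σ + ‖x - y‖ ^ 2) ^ (-e) * (‖a y‖ ^ 3 + 1) :=
                mul_le_mul_of_nonneg_left hsq (by positivity)
            _ = C * ((σ + ‖x - y‖ ^ 2) ^ (-e) * ‖a y‖ ^ 3) + C * (σ + ‖x - y‖ ^ 2) ^ (-e) := by ring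
            _ ≤ C * (256 * ‖a y‖ ^ 3) + C * (625 * (1 + ‖x - y‖) ^ (-(4 : ℝ))) := by
                gcongr
            _ = 256 * C * ‖a y‖ ^ 3 + 625 * C * (1 + ‖x - y‖) ^ (-(4 : ℝ)) := by ring
        linarith [hk', h2, hnn₁ y, hnn₄ y]
      · -- far source: `‖y‖ ≥ R ≥ 1`, distance `≥ ‖y‖/2`
        have hyR' : R ≤ ‖y‖ := not_lt.1 hyR
        have hd : ‖y‖ / 2 ≤ ‖x - y‖ := by
          linarith [norm_sub_norm_le y x, norm_sub_rev x y, hx, hR.trans hyR']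
        have hwe : (σ + ‖x - y‖ ^ 2) ^ (-e) ≤
            16 * (2 : ℝ) ^ (7 / 2 : ℝ) * R ^ (-(1 / 2 : ℝ)) * (1 + ‖y‖) ^ (-(7 / 2 : ℝ)) := by
          rw [he]; exact weight_far_le hσ hR hyR' hd
        have ha2 : ‖a y‖ ^ 2 ≤ Mf ^ 2 := pow_le_pow_left₀ (norm_nonneg _) (hfar y) 2
        have h4 : C * (σ + ‖x - y‖ ^ 2) ^ (-e) * ‖a y‖ ^ 2 ≤ h₄ y := by
          rw [hh₄, hL_def]
          have hw7 : 0 ≤ (1 + ‖y‖) ^ (-(7 / 2 : ℝ)) := Real.rpow_nonneg (by positivity) _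
          have hRh : 0 ≤ R ^ (-(1 / 2 : ℝ)) := Real.rpow_nonneg (by linarith) _
          calc C * (σ + ‖x - y‖ ^ 2) ^ (-e) * ‖a y‖ ^ 2
              ≤ C * (16 * (2 : ℝ) ^ (7 / 2 : ℝ) * R ^ (-(1 / 2 : ℝ)) * (1 + ‖y‖) ^ (-(7 / 2 : ℝ))) *
                  Mf ^ 2 := by gcongr
            _ = 16 * (2 : ℝ) ^ (7 / 2 : ℝ) * C * Mf ^ 2 * R ^ (-(1 / 2 : ℝ)) *
                  (1 + ‖y‖) ^ (-(7 / 2 : ℝ)) := by ring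
        linarith [hk', h4, hnn₁ y, hnn₂ y, hnn₃ y]
  -- integrate the majorant
  rw [oseenSlice_apply]
  have hhint : Integrable (fun y => ((h₁ y + h₂ y) + h₃ y) + h₄ y) := ((hi₁.add hi₂).add hi₃).add hi₄
  refine (norm_integral_le_of_norm_le hhint (Eventually.of_forall hptw)).trans ?_
  have e1 : ∫ y, h₁ y + h₂ y + h₃ y + h₄ y = (∫ y, h₁ y + h₂ y + h₃ y) + ∫ y, h₄ y :=
    integral_add ((hi₁.add hi₂).add hi₃) hi₄
  have e2 : ∫ y, h₁ y + h₂ y + h₃ y = (∫ y, h₁ y + h₂ y) + ∫ y, h₃ y := integral_add (hi₁.add hi₂) hi₃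
  have e3 : ∫ y, h₁ y + h₂ y = (∫ y, h₁ y) + ∫ y, h₂ y := integral_add hi₁ hi₂
  rw [e1, e2, e3]
  -- evaluate / bound the four integrals
  have hI₁ : ∫ y, h₁ y = C * P * I * σ ^ (-(1 / 2 : ℝ)) := by
    rw [hh₁, integral_const_mul]
    have hW := integral_sub_left_eq_self (fun z : EuclideanSpace ℝ (Fin 3) => (σ + ‖z‖ ^ 2) ^ (-e)) volume x
    rw [hW, integral_add_norm_sq_rpow_neg_half_succ hσ, hI_def]
    ring
  have hI₂ : ∫ y, h₂ y ≤ 256 * C * Q := by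
    rw [hh₂, integral_const_mul, integral_indicator hBm]
    exact mul_le_mul_of_nonneg_left hQ (by positivity)
  have hI₃ : ∫ y, h₃ y = 625 * C * jFour := by
    rw [hh₃, integral_const_mul]
    have hW := integral_sub_left_eq_self (fun z : EuclideanSpace ℝ (Fin 3) => (1 + ‖z‖) ^ (-(4 : ℝ))) volume x
    rw [hW, jFour]
  have hI₄ : ∫ y, h₄ y = L * jSeven := by
    rw [hh₄, integral_const_mul, jSeven]
  rw [hI₁, hI₃, hI₄, hL_def]
  linarith [hI₂]


/-! ### §1b  Part B: calculus helpers, the per-slice estimate in physical time, and the budget pass `budgetPass` -/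

/-- `∫_{(a,t)} (t−s)^{-3/4} ds = 4 (t−a)^{1/4}`. -/
theorem setIntegral_Ioo_sub_rpow_neg_three_quarters {a t : ℝ} (hat : a ≤ t) :
    ∫ s in Ioo a t, (t - s) ^ (-(3 / 4 : ℝ)) = 4 * (t - a) ^ (1 / 4 : ℝ) := by
  rw [← integral_Ioc_eq_integral_Ioo, ← intervalIntegral.integral_of_le hat,
    intervalIntegral.integral_comp_sub_left (fun s : ℝ => s ^ (-(3 / 4 : ℝ))) t, sub_self,
    integral_rpow (Or.inl (by norm_num))]
  have h1 : (-(3 / 4 : ℝ)) + 1 = 1 / 4 := by norm_num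
  rw [h1, Real.zero_rpow (by norm_num), sub_zero]
  ring

/-- `log(1/u) ≤ 2 u^{-1/2}` for `u > 0`. -/
theorem log_one_div_le_two_mul_rpow {u : ℝ} (hu : 0 < u) :
    Real.log (1 / u) ≤ 2 * u ^ (-(1 / 2 : ℝ)) := by
  have hz : 0 < u ^ (-(1 / 2 : ℝ)) := Real.rpow_pos_of_pos hu _
  have h1 : Real.log (u ^ (-(1 / 2 : ℝ))) ≤ u ^ (-(1 / 2 : ℝ)) - 1 := Real.log_le_sub_one_of_pos hz
  rw [Real.log_rpow hu] at h1
  rw [one_div, Real.log_inv]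
  linarith

/-- **The per-slice estimate in physical time.**  For a Type-I ancient mild field with cube budget `B`, a base time
`s ∈ [−1/2, 0)`, times `s < τ < t < 0`, the subcritical bound at time `τ` on `B(0,3/4)` and a core point `‖x‖ < 1/2`:
`‖N_{t−τ}[v(τ),v(τ)](x)‖ ≤ 16 C I c₀² (−s)^{-3/4} (t−τ)^{-3/4} + 1536 C B (t−τ)^{-1/2} + (256 C B + 625 C J₄ + 16·2^{7/2} C M² J₇)`
(three regions: near by the hypothesis, middle by the budget at radius `(−τ)^{-2}`, far by the Type-I rate). -/
theorem norm_oseenSlice_le_of_subcritical {C : ℝ} (hC : 0 < C)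
    (hK : ∀ {τ : ℝ}, 0 < τ → ∀ z a b : EuclideanSpace ℝ (Fin 3),
      ‖oseenKernel τ z a b‖ ≤ C * (τ + ‖z‖ ^ 2) ^
        (-(((Module.finrank ℝ (EuclideanSpace ℝ (Fin 3)) : ℝ) + 1) / 2)) * ‖a‖ * ‖b‖)
    {M B c₀ : ℝ} (hc₀ : 0 < c₀) {v : ℝ → EuclideanSpace ℝ (Fin 3) → EuclideanSpace ℝ (Fin 3)}
    (hv : IsTypeIAncientMild M v) (hBud : CubeBudgetWith B v)
    {s τ t : ℝ} (hs : s ∈ Set.Ico (-(1 / 2 : ℝ)) 0) (hsτ : s < τ) (hτt : τ < t) (ht0 : t < 0)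
    (hsubτ : ∀ y ∈ Metric.ball (0 : EuclideanSpace ℝ (Fin 3)) (3 / 4),
      ‖v τ y‖ ≤ 4 * c₀ * (-s) ^ (-(3 / 8 : ℝ)) * (-τ) ^ (-(1 / 8 : ℝ)))
    {x : EuclideanSpace ℝ (Fin 3)} (hx : ‖x‖ < 1 / 2) :
    ‖oseenSlice (t - τ) (v τ) (v τ) x‖ ≤
      16 * C * (∫ w : EuclideanSpace ℝ (Fin 3), (1 + ‖w‖ ^ 2) ^
          (-(((Module.finrank ℝ (EuclideanSpace ℝ (Fin 3)) : ℝ) + 1) / 2))) * c₀ ^ 2 *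
          (-s) ^ (-(3 / 4 : ℝ)) * (t - τ) ^ (-(3 / 4 : ℝ)) +
      1536 * C * B * (t - τ) ^ (-(1 / 2 : ℝ)) +
      (256 * C * B + 625 * C * jFour + 16 * (2 : ℝ) ^ (7 / 2 : ℝ) * C * M ^ 2 * jSeven) := by
  set I : ℝ := ∫ w : EuclideanSpace ℝ (Fin 3), (1 + ‖w‖ ^ 2) ^
      (-(((Module.finrank ℝ (EuclideanSpace ℝ (Fin 3)) : ℝ) + 1) / 2)) with hI_def
  have hI0 : 0 ≤ I := integral_nonneg fun w => Real.rpow_nonneg (by positivity) _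
  have hM0 : 0 ≤ M := hv.nonneg
  have hB0 : 0 ≤ B := hBud.1
  have hτ0 : τ < 0 := hτt.trans ht0
  have hu0 : 0 < -τ := by linarith
  have hσ : 0 < t - τ := by linarith
  have hσu : t - τ ≤ -τ := by linarith
  have hu1 : -τ ≤ 1 / 2 := by linarith [hs.1]
  have hu_le_one : -τ ≤ 1 := by linarith
  -- near bound
  set Pτ : ℝ := (4 * c₀ * (-s) ^ (-(3 / 8 : ℝ)) * (-τ) ^ (-(1 / 8 : ℝ))) ^ 2 with hP
  have hnear : ∀ y, ‖y‖ < 3 / 4 → ‖v τ y‖ ^ 2 ≤ Pτ := fun y hy => by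
    rw [hP]
    exact pow_le_pow_left₀ (norm_nonneg _) (hsubτ y (mem_ball_zero_iff.2 hy)) 2
  -- far sup bound
  have hfar : ∀ y, ‖v τ y‖ ≤ M / Real.sqrt (-τ) := fun y => hv.norm_le hτ0 y
  -- the radius `Rτ = (−τ)^{-2}` and the budget there with `ε = −τ`
  set Rτ : ℝ := (-τ) ^ (-(2 : ℝ)) with hRτ
  have hRτ_eq : Rτ = 1 / (-τ) ^ 2 := by
    rw [hRτ, Real.rpow_neg hu0.le, show (2 : ℝ) = ((2 : ℕ) : ℝ) by norm_num, Real.rpow_natCast, one_div]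
  have hRτ2 : 2 ≤ Rτ := by
    rw [hRτ_eq, le_div_iff₀ (by positivity)]
    nlinarith [hu1, hu0]
  have hRτ1 : 1 ≤ Rτ := by linarith
  obtain ⟨b, hb0, hb3, hbsl⟩ := hBud.2 Rτ hRτ2 (-τ) ⟨hu0, hu_le_one⟩
  have hslice := hbsl τ ⟨by linarith [hs.1], by linarith⟩
  -- integrability of `‖v τ‖³` on the ball and the cube bound as a real integral
  have hcont : Continuous (v τ) := hv.continuous_slice hτ0
  have hint3 : IntegrableOn (fun y => ‖v τ y‖ ^ 3) (Metric.ball (0 : EuclideanSpace ℝ (Fin 3)) Rτ) := by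
    have hc3 : Continuous fun y => ‖v τ y‖ ^ 3 := (hcont.norm).pow 3
    exact (hc3.continuousOn.integrableOn_compact (isCompact_closedBall 0 Rτ)).mono_set ball_subset_closedBall
  have hQ : ∫ y in Metric.ball (0 : EuclideanSpace ℝ (Fin 3)) Rτ, ‖v τ y‖ ^ 3 ≤ b ^ 3 := by
    have hl := Summit.NavierStokesRegularity.NavierStokesRegularity.Theorems.ThinCascade.lintegral_cube_le_of_eLpNorm_three_le
      hslice hb0
    rw [integral_eq_lintegral_of_nonneg_ae (Eventually.of_forall fun y => by positivity)
      hint3.aestronglyMeasurable]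
    refine ENNReal.toReal_le_of_le_ofReal (by positivity) ?_
    rw [← lintegral_indicator measurableSet_ball]
    refine le_of_eq_of_le (lintegral_congr fun y => ?_) hl
    by_cases hy : y ∈ Metric.ball (0 : EuclideanSpace ℝ (Fin 3)) Rτ
    · simp [Set.indicator_of_mem hy]
    · simp [Set.indicator_of_notMem hy]
  -- the three-region lemma
  have hS := norm_oseenSlice_core hC hK hσ (P := Pτ) (Mf := M / Real.sqrt (-τ)) (Q := b ^ 3) (R := Rτ)
    (by positivity) (by positivity) hRτ1 hnear hfar hint3 hQ hx
  -- ### arithmetic: term 1 (near)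
  have hP_eq : Pτ = 16 * c₀ ^ 2 * (-s) ^ (-(3 / 4 : ℝ)) * (-τ) ^ (-(1 / 4 : ℝ)) := by
    have hs0 : 0 ≤ -s := by linarith [hs.2]
    rw [hP, mul_pow, mul_pow, mul_pow, ← Real.rpow_mul_natCast hs0, ← Real.rpow_mul_natCast hu0.le]
    norm_num
  have h1 : C * Pτ * I * (t - τ) ^ (-(1 / 2 : ℝ)) ≤
      16 * C * I * c₀ ^ 2 * (-s) ^ (-(3 / 4 : ℝ)) * (t - τ) ^ (-(3 / 4 : ℝ)) := by
    have hq : (-τ) ^ (-(1 / 4 : ℝ)) ≤ (t - τ) ^ (-(1 / 4 : ℝ)) :=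
      Real.rpow_le_rpow_of_nonpos hσ hσu (by norm_num)
    have hsplit : (t - τ) ^ (-(3 / 4 : ℝ)) = (t - τ) ^ (-(1 / 4 : ℝ)) * (t - τ) ^ (-(1 / 2 : ℝ)) := by
      rw [← Real.rpow_add hσ]; norm_num
    have hs34 : 0 ≤ (-s) ^ (-(3 / 4 : ℝ)) := Real.rpow_nonneg (by linarith [hs.2]) _
    have hh : 0 ≤ (t - τ) ^ (-(1 / 2 : ℝ)) := Real.rpow_nonneg hσ.le _
    rw [hP_eq, hsplit]
    have := mul_le_mul_of_nonneg_left hq (by positivity : 0 ≤ 16 * C * I * c₀ ^ 2 * (-s) ^ (-(3 / 4 : ℝ)) *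
      (t - τ) ^ (-(1 / 2 : ℝ)))
    calc C * (16 * c₀ ^ 2 * (-s) ^ (-(3 / 4 : ℝ)) * (-τ) ^ (-(1 / 4 : ℝ))) * I * (t - τ) ^ (-(1 / 2 : ℝ))
        = 16 * C * I * c₀ ^ 2 * (-s) ^ (-(3 / 4 : ℝ)) * (t - τ) ^ (-(1 / 2 : ℝ)) * (-τ) ^ (-(1 / 4 : ℝ)) := by
          ring
      _ ≤ 16 * C * I * c₀ ^ 2 * (-s) ^ (-(3 / 4 : ℝ)) * (t - τ) ^ (-(1 / 2 : ℝ)) * (t - τ) ^ (-(1 / 4 : ℝ)) :=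
          this
      _ = 16 * C * I * c₀ ^ 2 * (-s) ^ (-(3 / 4 : ℝ)) * ((t - τ) ^ (-(1 / 4 : ℝ)) * (t - τ) ^ (-(1 / 2 : ℝ))) := by
          ring
  -- ### term 2 (budget): `b³ ≤ B(1 + log Rτ + log(1/(−τ))) = B(1 + 3 log(1/(−τ))) ≤ B(1 + 6 (t−τ)^{-1/2})`
  have h2 : 256 * C * b ^ 3 ≤ 256 * C * B + 1536 * C * B * (t - τ) ^ (-(1 / 2 : ℝ)) := by
    have hlogR : Real.log Rτ = 2 * Real.log (1 / (-τ)) := by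
      rw [hRτ, Real.log_rpow hu0, one_div, Real.log_inv]; ring
    have hlog : Real.log (1 / (-τ)) ≤ 2 * (t - τ) ^ (-(1 / 2 : ℝ)) := by
      refine (log_one_div_le_two_mul_rpow hu0).trans ?_
      have : (-τ) ^ (-(1 / 2 : ℝ)) ≤ (t - τ) ^ (-(1 / 2 : ℝ)) :=
        Real.rpow_le_rpow_of_nonpos hσ hσu (by norm_num)
      linarith
    have hb3' : b ^ 3 ≤ B * (1 + 6 * (t - τ) ^ (-(1 / 2 : ℝ))) := by
      refine hb3.trans ?_
      rw [hlogR]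
      exact mul_le_mul_of_nonneg_left (by linarith) hB0
    nlinarith [hb3', hC.le]
  -- ### term 4 (far): `(M/√(−τ))² Rτ^{-1/2} = M²`
  have h4 : 16 * (2 : ℝ) ^ (7 / 2 : ℝ) * C * (M / Real.sqrt (-τ)) ^ 2 * Rτ ^ (-(1 / 2 : ℝ)) * jSeven =
      16 * (2 : ℝ) ^ (7 / 2 : ℝ) * C * M ^ 2 * jSeven := by
    have hR12 : Rτ ^ (-(1 / 2 : ℝ)) = -τ := by
      rw [hRτ, ← Real.rpow_mul hu0.le]; norm_num
    have hMM : (M / Real.sqrt (-τ)) ^ 2 * Rτ ^ (-(1 / 2 : ℝ)) = M ^ 2 := by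
      rw [hR12, div_pow, Real.sq_sqrt hu0.le]
      exact div_mul_cancel₀ (M ^ 2) hu0.ne'
    calc 16 * (2 : ℝ) ^ (7 / 2 : ℝ) * C * (M / Real.sqrt (-τ)) ^ 2 * Rτ ^ (-(1 / 2 : ℝ)) * jSeven
        = 16 * (2 : ℝ) ^ (7 / 2 : ℝ) * C * ((M / Real.sqrt (-τ)) ^ 2 * Rτ ^ (-(1 / 2 : ℝ))) * jSeven := by ring
      _ = 16 * (2 : ℝ) ^ (7 / 2 : ℝ) * C * M ^ 2 * jSeven := by rw [hMM]
  -- ### combine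
  calc ‖oseenSlice (t - τ) (v τ) (v τ) x‖
      ≤ C * Pτ * I * (t - τ) ^ (-(1 / 2 : ℝ)) + 256 * C * b ^ 3 + 625 * C * jFour +
          16 * (2 : ℝ) ^ (7 / 2 : ℝ) * C * (M / Real.sqrt (-τ)) ^ 2 * Rτ ^ (-(1 / 2 : ℝ)) * jSeven := hS
    _ ≤ 16 * C * I * c₀ ^ 2 * (-s) ^ (-(3 / 4 : ℝ)) * (t - τ) ^ (-(3 / 4 : ℝ)) +
          (256 * C * B + 1536 * C * B * (t - τ) ^ (-(1 / 2 : ℝ))) + 625 * C * jFour +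
          16 * (2 : ℝ) ^ (7 / 2 : ℝ) * C * M ^ 2 * jSeven := by
        rw [← h4]; linarith [h1, h2]
    _ = _ := by ring

/-- **S4♭ PROVED: the budget pass.**  `s₂ = −1/2`; in the Oseen representation from time `s` the heat part is bounded
by the maximum principle (`M/√(−s)`), the Duhamel part by the time integral of `norm_oseenSlice_le_of_subcritical`:
`64 C I c₀² (−s)^{-3/4}(t−s)^{1/4} + 3072 C B √(t−s) + a₃ (t−s) ≤ (64 C I c₀² + 3072 C B + a₃)/√(−s)`. -/
theorem budgetPass (M B : ℝ) : BudgetPass M B := by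
  intro c₀ hc₀
  obtain ⟨C, hC, hK⟩ := exists_norm_oseenKernel_le (E := EuclideanSpace ℝ (Fin 3))
  set I : ℝ := ∫ w : EuclideanSpace ℝ (Fin 3), (1 + ‖w‖ ^ 2) ^
      (-(((Module.finrank ℝ (EuclideanSpace ℝ (Fin 3)) : ℝ) + 1) / 2)) with hI_def
  have hI0 : 0 ≤ I := integral_nonneg fun w => Real.rpow_nonneg (by positivity) _
  have hJ4 := jFour_nonneg
  have hJ7 := jSeven_nonneg
  set a₃ : ℝ := 256 * C * |B| + 625 * C * jFour + 16 * (2 : ℝ) ^ (7 / 2 : ℝ) * C * M ^ 2 * jSeven with ha₃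
  have ha₃0 : 0 ≤ a₃ := by rw [ha₃]; positivity
  set K : ℝ := |M| + 64 * C * I * c₀ ^ 2 + 3072 * C * |B| + a₃ with hK_def
  have hK0 : 0 ≤ K := by rw [hK_def]; positivity
  refine ⟨-(1 / 2), K, by norm_num, hK0, ?_⟩
  intro v hv hBud s hs hsub t ht x hx
  have hM0 : 0 ≤ M := hv.nonneg
  have hB0 : 0 ≤ B := hBud.1
  have hMabs : |M| = M := abs_of_nonneg hM0
  have hBabs : |B| = B := abs_of_nonneg hB0
  have hs0 : 0 < -s := by linarith [hs.2]
  have hs1 : -s ≤ 1 / 2 := by linarith [hs.1]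
  have hsq0 : 0 < Real.sqrt (-s) := Real.sqrt_pos.2 hs0
  have hsq1 : Real.sqrt (-s) ≤ 1 := by
    rw [← Real.sqrt_one]; exact Real.sqrt_le_sqrt (by linarith)
  have hxn : ‖x‖ < 1 / 2 := mem_ball_zero_iff.1 hx
  have hMK : M ≤ K := by
    rw [hK_def, hMabs]
    have : 0 ≤ 64 * C * I * c₀ ^ 2 + 3072 * C * |B| + a₃ := by positivity
    linarith
  rcases eq_or_lt_of_le ht.1 with hts | hts
  · -- `t = s`: the Type-I rate itself
    rw [← hts]
    exact (hv.norm_le hs.2 x).trans (div_le_div_of_nonneg_right hMK hsq0.le)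
  -- `s < t < 0`: the Oseen representation from time `s`
  have ht0 : t < 0 := ht.2
  have hT0 : 0 < t - s := by linarith
  have hTs : t - s ≤ -s := by linarith
  have hT1 : t - s ≤ 1 := by linarith
  have h1 := hv.2.2.1 s t hts ht0 x
  have h3 := oseenDuhamel_comp_sub_right 1 0 (t - s) (-s) v v x
  simp only [sub_neg_eq_add, zero_add, sub_add_cancel] at h3
  -- heat part
  have hheat : ‖heatFlow (v s) (t - s) x‖ ≤ M / Real.sqrt (-s) := by
    rw [heatFlow_of_pos _ hT0]
    exact UnboundedOperators.norm_heatExtension_le (fun y => hv.norm_le hs.2 y) hT0 x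
  -- Duhamel part: the majorant in shifted time `τ' ∈ (0, t − s)`
  set a₁ : ℝ := 16 * C * I * c₀ ^ 2 * (-s) ^ (-(3 / 4 : ℝ)) with ha₁
  set a₂ : ℝ := 1536 * C * B with ha₂
  set a₃' : ℝ := 256 * C * B + 625 * C * jFour + 16 * (2 : ℝ) ^ (7 / 2 : ℝ) * C * M ^ 2 * jSeven with ha₃'
  have ha₃eq : a₃ = a₃' := by rw [ha₃, ha₃', hBabs]
  set m : ℝ → ℝ := fun τ' => a₁ * (t - s - τ') ^ (-(3 / 4 : ℝ)) + a₂ * (t - s - τ') ^ (-(1 / 2 : ℝ)) + a₃'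
    with hm_def
  have hk34 : IntegrableOn (fun τ' : ℝ => (t - s - τ') ^ (-(3 / 4 : ℝ))) (Ioo 0 (t - s)) :=
    integrableOn_sub_rpow_Ioo (by norm_num)
  have hk12 : IntegrableOn (fun τ' : ℝ => (t - s - τ') ^ (-(1 / 2 : ℝ))) (Ioo 0 (t - s)) :=
    integrableOn_sub_rpow_Ioo (by norm_num)
  have hkc : IntegrableOn (fun _ : ℝ => a₃') (Ioo 0 (t - s)) := integrableOn_const measure_Ioo_lt_top.ne
  have hmi : IntegrableOn m (Ioo 0 (t - s)) := ((hk34.const_mul a₁).add (hk12.const_mul a₂)).add hkc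
  have hptw : ∀ᵐ τ' ∂(volume.restrict (Ioo 0 (t - s))),
      ‖oseenSlice (t - s - τ') (v (τ' + s)) (v (τ' + s)) x‖ ≤ m τ' := by
    filter_upwards [ae_restrict_mem measurableSet_Ioo] with τ' hτ'
    have hsτ : s < τ' + s := by linarith [hτ'.1]
    have hτt : τ' + s < t := by linarith [hτ'.2]
    have hτ0 : τ' + s < 0 := hτt.trans ht0
    have hsl := norm_oseenSlice_le_of_subcritical hC hK hc₀ hv hBud hs hsτ hτt ht0
      (fun y hy => hsub (τ' + s) ⟨hsτ.le, hτ0⟩ y hy) hxn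
    have hσeq : t - (τ' + s) = t - s - τ' := by ring
    rw [hσeq] at hsl
    rw [hm_def]
    simpa only [ha₁, ha₂, ha₃', hI_def] using hsl
  have hDuh : ‖oseenDuhamel 1 0 (fun τ => v (τ + s)) (fun τ => v (τ + s)) (t - s) x‖ ≤
      a₁ * (4 * (t - s) ^ (1 / 4 : ℝ)) + a₂ * (2 * (t - s) ^ (1 / 2 : ℝ)) + a₃' * (t - s) := by
    rw [oseenDuhamel_one_eq_setIntegral_oseenSlice]
    refine (norm_integral_le_of_norm_le hmi hptw).trans (le_of_eq ?_)
    have e1 : ∫ τ' in Ioo 0 (t - s), (a₁ * (t - s - τ') ^ (-(3 / 4 : ℝ)) + a₂ * (t - s - τ') ^ (-(1 / 2 : ℝ)) + a₃') =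
        (∫ τ' in Ioo 0 (t - s), (a₁ * (t - s - τ') ^ (-(3 / 4 : ℝ)) + a₂ * (t - s - τ') ^ (-(1 / 2 : ℝ)))) +
          ∫ _ in Ioo 0 (t - s), a₃' :=
      integral_add ((hk34.const_mul a₁).add (hk12.const_mul a₂)) hkc
    have e2 : ∫ τ' in Ioo 0 (t - s), (a₁ * (t - s - τ') ^ (-(3 / 4 : ℝ)) + a₂ * (t - s - τ') ^ (-(1 / 2 : ℝ))) =
        (∫ τ' in Ioo 0 (t - s), a₁ * (t - s - τ') ^ (-(3 / 4 : ℝ))) +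
          ∫ τ' in Ioo 0 (t - s), a₂ * (t - s - τ') ^ (-(1 / 2 : ℝ)) :=
      integral_add (hk34.const_mul a₁) (hk12.const_mul a₂)
    have e3 : ∫ τ' in Ioo 0 (t - s), a₁ * (t - s - τ') ^ (-(3 / 4 : ℝ)) = a₁ * (4 * (t - s) ^ (1 / 4 : ℝ)) := by
      rw [integral_const_mul, setIntegral_Ioo_sub_rpow_neg_three_quarters hT0.le, sub_zero]
    have e4 : ∫ τ' in Ioo 0 (t - s), a₂ * (t - s - τ') ^ (-(1 / 2 : ℝ)) = a₂ * (2 * (t - s) ^ (1 / 2 : ℝ)) := by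
      rw [integral_const_mul, setIntegral_Ioo_sub_rpow_neg_half hT0.le, sub_zero]
    have e5 : ∫ _ in Ioo 0 (t - s), a₃' = a₃' * (t - s) := by
      rw [setIntegral_const, smul_eq_mul, Real.volume_real_Ioo_of_le hT0.le, sub_zero, mul_comm]
    rw [hm_def]
    show ∫ τ' in Ioo 0 (t - s), (a₁ * (t - s - τ') ^ (-(3 / 4 : ℝ)) + a₂ * (t - s - τ') ^ (-(1 / 2 : ℝ)) + a₃') = _
    rw [e1, e2, e3, e4, e5]
  -- ### final arithmetic
  have hq14 : (t - s) ^ (1 / 4 : ℝ) ≤ (-s) ^ (1 / 4 : ℝ) := Real.rpow_le_rpow hT0.le hTs (by norm_num)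
  have hq12 : (t - s) ^ (1 / 2 : ℝ) ≤ 1 := Real.rpow_le_one hT0.le hT1 (by norm_num)
  have hsinv : (-s) ^ (-(3 / 4 : ℝ)) * (-s) ^ (1 / 4 : ℝ) = 1 / Real.sqrt (-s) := by
    rw [← Real.rpow_add hs0, show (-(3 / 4 : ℝ)) + 1 / 4 = -(1 / 2 : ℝ) by norm_num, Real.rpow_neg hs0.le,
      Real.sqrt_eq_rpow, inv_eq_one_div]
  have hnear_fin : a₁ * (4 * (t - s) ^ (1 / 4 : ℝ)) ≤ 64 * C * I * c₀ ^ 2 / Real.sqrt (-s) := by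
    have hs34 : 0 ≤ (-s) ^ (-(3 / 4 : ℝ)) := Real.rpow_nonneg hs0.le _
    calc a₁ * (4 * (t - s) ^ (1 / 4 : ℝ)) = 64 * C * I * c₀ ^ 2 * ((-s) ^ (-(3 / 4 : ℝ)) * (t - s) ^ (1 / 4 : ℝ)) := by
          rw [ha₁]; ring
      _ ≤ 64 * C * I * c₀ ^ 2 * ((-s) ^ (-(3 / 4 : ℝ)) * (-s) ^ (1 / 4 : ℝ)) := by gcongr
      _ = 64 * C * I * c₀ ^ 2 / Real.sqrt (-s) := by rw [hsinv]; ring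
  have hmid_fin : a₂ * (2 * (t - s) ^ (1 / 2 : ℝ)) ≤ 3072 * C * B / Real.sqrt (-s) := by
    have ha₂0 : 0 ≤ a₂ := by rw [ha₂]; positivity
    have h1' : a₂ * (2 * (t - s) ^ (1 / 2 : ℝ)) ≤ a₂ * 2 := by
      have := mul_le_mul_of_nonneg_left hq12 (by positivity : 0 ≤ 2 * a₂)
      linarith
    have h2' : a₂ * 2 ≤ a₂ * 2 / Real.sqrt (-s) := by
      rw [le_div_iff₀ hsq0]; exact mul_le_of_le_one_right (by positivity) hsq1
    calc a₂ * (2 * (t - s) ^ (1 / 2 : ℝ)) ≤ a₂ * 2 / Real.sqrt (-s) := h1'.trans h2'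
      _ = 3072 * C * B / Real.sqrt (-s) := by rw [ha₂]; ring
  have hconst_fin : a₃' * (t - s) ≤ a₃' / Real.sqrt (-s) := by
    have ha₃'0 : 0 ≤ a₃' := by rw [← ha₃eq]; exact ha₃0
    have h1' : a₃' * (t - s) ≤ a₃' := mul_le_of_le_one_right ha₃'0 hT1
    have h2' : a₃' ≤ a₃' / Real.sqrt (-s) := by
      rw [le_div_iff₀ hsq0]; exact mul_le_of_le_one_right ha₃'0 hsq1
    exact h1'.trans h2'
  have hKeq : K / Real.sqrt (-s) = M / Real.sqrt (-s) + 64 * C * I * c₀ ^ 2 / Real.sqrt (-s) +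
      3072 * C * B / Real.sqrt (-s) + a₃' / Real.sqrt (-s) := by
    rw [hK_def, hMabs, hBabs, ha₃eq]
    field_simp
  rw [h1, hKeq]
  calc ‖heatFlow (v s) (t - s) x - oseenDuhamel 1 s v v t x‖
      ≤ ‖heatFlow (v s) (t - s) x‖ + ‖oseenDuhamel 1 s v v t x‖ := norm_sub_le _ _
    _ ≤ M / Real.sqrt (-s) + (a₁ * (4 * (t - s) ^ (1 / 4 : ℝ)) + a₂ * (2 * (t - s) ^ (1 / 2 : ℝ)) +
          a₃' * (t - s)) := by rw [← h3]; exact add_le_add hheat hDuh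
    _ ≤ M / Real.sqrt (-s) + (64 * C * I * c₀ ^ 2 / Real.sqrt (-s) + 3072 * C * B / Real.sqrt (-s) +
          a₃' / Real.sqrt (-s)) := by linarith [hnear_fin, hmid_fin, hconst_fin]
    _ = _ := by ring


/-- Stub S4♭ — **PROVED in v1.1** (`budgetPass`; no `sorry`): kept under its registered name. -/
theorem stub_budgetPass : StubBudgetPass := fun M B => budgetPass M B

/-! ### §1c  S3♭ toolbox (PROVED, v1.3): H1 exterior kernel mass (`∫_{‖z‖≥d}‖z‖^{-4} = 4π/d`), T2 receding-ball slice bound,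
T3 two-region maximum principle.  #### H1 -/

/-- Radial part: `∫_{(0,∞)} r^{3−1} • 𝟙_{[d,∞)}(r) r^{−4} dr = 1/d` for `d > 0`. -/
theorem setIntegral_Ioi_sq_indicator_rpow_neg_four {d : ℝ} (hd : 0 < d) :
    ∫ r in Ioi (0 : ℝ), r ^ (3 - 1) • (Ici d).indicator (fun r => r ^ (-(4 : ℝ))) r = 1 / d := by
  have hfun : (fun r : ℝ => r ^ (3 - 1) • (Ici d).indicator (fun r => r ^ (-(4 : ℝ))) r) =
      (Ici d).indicator (fun r => r ^ 2 * r ^ (-(4 : ℝ))) := by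
    funext r
    by_cases hr : r ∈ Ici d
    · simp [indicator_of_mem hr]
    · simp [indicator_of_notMem hr]
  rw [hfun, integral_indicator measurableSet_Ici, Measure.restrict_restrict measurableSet_Ici]
  have hset : Ici d ∩ Ioi (0 : ℝ) = Ici d := inter_eq_left.2 fun r hr => lt_of_lt_of_le hd hr
  rw [hset, integral_Ici_eq_integral_Ioi]
  have hcongr : ∀ r ∈ Ioi d, r ^ 2 * r ^ (-(4 : ℝ)) = r ^ (-(2 : ℝ)) := by
    intro r hr
    have hr0 : 0 < r := hd.trans hr
    rw [show r ^ 2 = r ^ ((2 : ℕ) : ℝ) from (Real.rpow_natCast r 2).symm, ← Real.rpow_add hr0]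
    norm_num
  rw [setIntegral_congr_fun measurableSet_Ioi hcongr,
    integral_Ioi_rpow_of_lt (by norm_num : (-(2 : ℝ)) < -1) hd]
  have h1 : (-(2 : ℝ)) + 1 = -1 := by norm_num
  rw [h1, Real.rpow_neg_one]
  field_simp

/-- **Exterior mass of `‖z‖^{−4}` in `ℝ³`** (polar coordinates, `|B₁| = 4π/3`):
`∫_{‖z‖ ≥ d} ‖z‖^{−4} dz = 4π/d` for `d > 0`. -/
theorem integral_indicator_compl_ball_norm_rpow_neg_four {d : ℝ} (hd : 0 < d) :
    ∫ z : EuclideanSpace ℝ (Fin 3),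
        (Metric.ball (0 : EuclideanSpace ℝ (Fin 3)) d)ᶜ.indicator (fun z => ‖z‖ ^ (-(4 : ℝ))) z =
      4 * Real.pi / d := by
  have hfun : (Metric.ball (0 : EuclideanSpace ℝ (Fin 3)) d)ᶜ.indicator
        (fun z : EuclideanSpace ℝ (Fin 3) => ‖z‖ ^ (-(4 : ℝ))) =
      fun z : EuclideanSpace ℝ (Fin 3) => (Ici d).indicator (fun r => r ^ (-(4 : ℝ))) ‖z‖ := by
    funext z
    by_cases hz : z ∈ (Metric.ball (0 : EuclideanSpace ℝ (Fin 3)) d)ᶜ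
    · have hz' : ‖z‖ ∈ Ici d := by
        simpa [mem_compl_iff, mem_ball_zero_iff, not_lt] using hz
      rw [indicator_of_mem hz, indicator_of_mem hz']
    · have hz' : ‖z‖ ∉ Ici d := by
        have : ‖z‖ < d := by simpa [mem_compl_iff, mem_ball_zero_iff] using hz
        simpa [mem_Ici, not_le] using this
      rw [indicator_of_notMem hz, indicator_of_notMem hz']
  rw [hfun, integral_fun_norm_addHaar (volume : Measure (EuclideanSpace ℝ (Fin 3)))
      ((Ici d).indicator fun r => r ^ (-(4 : ℝ))),
    finrank_euclideanSpace_fin, measureReal_def, EuclideanSpace.volume_ball_fin_three, nsmul_eq_mul,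
    smul_eq_mul]
  have hvol : (ENNReal.ofReal (1 : ℝ) ^ 3 * ENNReal.ofReal (Real.pi * 4 / 3)).toReal = Real.pi * 4 / 3 := by
    rw [ENNReal.ofReal_one, one_pow, one_mul, ENNReal.toReal_ofReal (by positivity)]
  rw [hvol, setIntegral_Ioi_sq_indicator_rpow_neg_four hd]
  push_cast
  field_simp

/-- The exterior majorant is integrable. -/
theorem integrable_indicator_compl_ball_norm_rpow_neg_four {d : ℝ} (hd : 0 < d) :
    Integrable fun z : EuclideanSpace ℝ (Fin 3) =>
      (Metric.ball (0 : EuclideanSpace ℝ (Fin 3)) d)ᶜ.indicator (fun z => ‖z‖ ^ (-(4 : ℝ))) z := by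
  by_contra h
  have h0 := integral_undef h
  have h1 := integral_indicator_compl_ball_norm_rpow_neg_four hd
  rw [h0] at h1
  have : (0 : ℝ) < 4 * Real.pi / d := by positivity
  linarith

/-- **Exterior Oseen weight mass, polar bound**: `∫_{‖z‖ ≥ d} (σ + ‖z‖²)^{−2} dz ≤ 4π/d` (`σ > 0`, `d > 0`). -/
theorem integral_indicator_compl_ball_weight_le {σ d : ℝ} (hσ : 0 < σ) (hd : 0 < d) :
    ∫ z : EuclideanSpace ℝ (Fin 3),
        (Metric.ball (0 : EuclideanSpace ℝ (Fin 3)) d)ᶜ.indicator (fun z => (σ + ‖z‖ ^ 2) ^ (-(2 : ℝ))) z ≤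
      4 * Real.pi / d := by
  rw [← integral_indicator_compl_ball_norm_rpow_neg_four hd]
  refine integral_mono_of_nonneg (Eventually.of_forall fun z => ?_)
    (integrable_indicator_compl_ball_norm_rpow_neg_four hd) (Eventually.of_forall fun z => ?_)
  · exact Set.indicator_nonneg (fun w _ => Real.rpow_nonneg (by positivity) _) z
  · by_cases hz : z ∈ (Metric.ball (0 : EuclideanSpace ℝ (Fin 3)) d)ᶜ
    · simp only [indicator_of_mem hz]
      have hz0 : d ≤ ‖z‖ := by simpa [mem_compl_iff, mem_ball_zero_iff, not_lt] using hz
      have hzpos : 0 < ‖z‖ := hd.trans_le hz0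
      calc (σ + ‖z‖ ^ 2) ^ (-(2 : ℝ)) ≤ (‖z‖ ^ 2) ^ (-(2 : ℝ)) :=
            Real.rpow_le_rpow_of_nonpos (by positivity) (by linarith) (by norm_num)
        _ = ‖z‖ ^ (-(4 : ℝ)) := by
            rw [show ‖z‖ ^ 2 = ‖z‖ ^ ((2 : ℕ) : ℝ) from (Real.rpow_natCast ‖z‖ 2).symm,
              ← Real.rpow_mul hzpos.le]
            norm_num
    · simp only [indicator_of_notMem hz, le_refl]


/-! ### §1c (continued): the two-region slice bound for a RECEDING ball (inside sup, outside Type-I field) -/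

/-- **Receding-ball slice bound.**  Let `σ > 0`, `d > 0`, `‖x‖ ≤ ρ − d`.  If `‖a(y)‖² ≤ P` for `‖y‖ < ρ` and
`‖a(y)‖ ≤ M_f` for `‖y‖ ≥ ρ`, then
`‖N_σ[a,a](x)‖ ≤ C P I σ^{−1/2} + C M_f² · min(I σ^{−1/2}, 4π/d)`:
inside sources by the `L¹` size `I σ^{−1/2}` of the kernel, outside sources (at distance `≥ d` from `x`) by the
same `L¹` size OR by the polar exterior mass `∫_{‖z‖≥d}‖z‖^{−4} = 4π/d`.  This is the slice estimate of the S3♭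
receding-ball bootstrap (card §Addendum, T2). -/
theorem norm_oseenSlice_receding {C : ℝ} (hC : 0 < C)
    (hK : ∀ {τ : ℝ}, 0 < τ → ∀ z a b : EuclideanSpace ℝ (Fin 3),
      ‖oseenKernel τ z a b‖ ≤ C * (τ + ‖z‖ ^ 2) ^
        (-(((Module.finrank ℝ (EuclideanSpace ℝ (Fin 3)) : ℝ) + 1) / 2)) * ‖a‖ * ‖b‖)
    {σ P Mf ρ d : ℝ} (hσ : 0 < σ) (hP : 0 ≤ P) (hd : 0 < d)
    {a : EuclideanSpace ℝ (Fin 3) → EuclideanSpace ℝ (Fin 3)}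
    (hin : ∀ y, ‖y‖ < ρ → ‖a y‖ ^ 2 ≤ P)
    (hout : ∀ y, ρ ≤ ‖y‖ → ‖a y‖ ≤ Mf)
    {x : EuclideanSpace ℝ (Fin 3)} (hx : ‖x‖ ≤ ρ - d) :
    ‖oseenSlice σ a a x‖ ≤
      C * P * (∫ w : EuclideanSpace ℝ (Fin 3), (1 + ‖w‖ ^ 2) ^
          (-(((Module.finrank ℝ (EuclideanSpace ℝ (Fin 3)) : ℝ) + 1) / 2))) * σ ^ (-(1 / 2 : ℝ)) +
      C * Mf ^ 2 * min ((∫ w : EuclideanSpace ℝ (Fin 3), (1 + ‖w‖ ^ 2) ^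
          (-(((Module.finrank ℝ (EuclideanSpace ℝ (Fin 3)) : ℝ) + 1) / 2))) * σ ^ (-(1 / 2 : ℝ)))
        (4 * Real.pi / d) := by
  set e : ℝ := ((Module.finrank ℝ (EuclideanSpace ℝ (Fin 3)) : ℝ) + 1) / 2 with he_def
  have he : e = 2 := oseen_exponent_eq_two
  set I : ℝ := ∫ w : EuclideanSpace ℝ (Fin 3), (1 + ‖w‖ ^ 2) ^ (-e) with hI_def
  -- common pieces
  set h₁ : EuclideanSpace ℝ (Fin 3) → ℝ := fun y => C * P * (σ + ‖x - y‖ ^ 2) ^ (-e) with hh₁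
  have hi₁ : Integrable h₁ :=
    ((integrable_add_norm_sq_rpow_neg_half_succ (E := EuclideanSpace ℝ (Fin 3)) hσ).comp_sub_left x).const_mul
      (C * P)
  have hnn₁ : ∀ y, 0 ≤ h₁ y := fun y => by
    rw [hh₁]; exact mul_nonneg (by positivity) (Real.rpow_nonneg (by positivity) _)
  have hI₁ : ∫ y, h₁ y = C * P * I * σ ^ (-(1 / 2 : ℝ)) := by
    rw [hh₁, integral_const_mul]
    have hW := integral_sub_left_eq_self (fun z : EuclideanSpace ℝ (Fin 3) => (σ + ‖z‖ ^ 2) ^ (-e)) volume x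
    rw [hW, integral_add_norm_sq_rpow_neg_half_succ hσ, hI_def]
    ring
  have hkb : ∀ y, ‖oseenKernel σ (x - y) (a y) (a y)‖ ≤ C * (σ + ‖x - y‖ ^ 2) ^ (-e) * ‖a y‖ ^ 2 := by
    intro y
    calc ‖oseenKernel σ (x - y) (a y) (a y)‖ ≤ C * (σ + ‖x - y‖ ^ 2) ^ (-e) * ‖a y‖ * ‖a y‖ :=
          hK hσ (x - y) (a y) (a y)
      _ = C * (σ + ‖x - y‖ ^ 2) ^ (-e) * ‖a y‖ ^ 2 := by ring
  have hdist : ∀ y, ρ ≤ ‖y‖ → d ≤ ‖x - y‖ := fun y hy => by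
    linarith [norm_sub_norm_le y x, norm_sub_rev x y]
  -- generic two-region step: any outside majorant `g` with `C Mf² (σ+‖x−y‖²)^{-e} ≤ g y` off the ball
  have hstep : ∀ g : EuclideanSpace ℝ (Fin 3) → ℝ, Integrable g → (∀ y, 0 ≤ g y) →
      (∀ y, ρ ≤ ‖y‖ → C * Mf ^ 2 * (σ + ‖x - y‖ ^ 2) ^ (-e) ≤ g y) →
      ‖oseenSlice σ a a x‖ ≤ C * P * I * σ ^ (-(1 / 2 : ℝ)) + ∫ y, g y := by
    intro g hgi hgnn hgout
    have hptw : ∀ y, ‖oseenKernel σ (x - y) (a y) (a y)‖ ≤ h₁ y + g y := by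
      intro y
      have hw0 : 0 ≤ (σ + ‖x - y‖ ^ 2) ^ (-e) := Real.rpow_nonneg (by positivity) _
      by_cases hy : ‖y‖ < ρ
      · have h1 : C * (σ + ‖x - y‖ ^ 2) ^ (-e) * ‖a y‖ ^ 2 ≤ h₁ y := by
          rw [hh₁]
          calc C * (σ + ‖x - y‖ ^ 2) ^ (-e) * ‖a y‖ ^ 2 ≤ C * (σ + ‖x - y‖ ^ 2) ^ (-e) * P :=
                mul_le_mul_of_nonneg_left (hin y hy) (by positivity)
            _ = C * P * (σ + ‖x - y‖ ^ 2) ^ (-e) := by ring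
        linarith [hkb y, h1, hgnn y]
      · have hy' : ρ ≤ ‖y‖ := not_lt.1 hy
        have ha2 : ‖a y‖ ^ 2 ≤ Mf ^ 2 := pow_le_pow_left₀ (norm_nonneg _) (hout y hy') 2
        have h2 : C * (σ + ‖x - y‖ ^ 2) ^ (-e) * ‖a y‖ ^ 2 ≤ g y := by
          calc C * (σ + ‖x - y‖ ^ 2) ^ (-e) * ‖a y‖ ^ 2 ≤ C * (σ + ‖x - y‖ ^ 2) ^ (-e) * Mf ^ 2 :=
                mul_le_mul_of_nonneg_left ha2 (by positivity)
            _ = C * Mf ^ 2 * (σ + ‖x - y‖ ^ 2) ^ (-e) := by ring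
            _ ≤ g y := hgout y hy'
        linarith [hkb y, h2, hnn₁ y]
    rw [oseenSlice_apply]
    have hsum : Integrable (fun y => h₁ y + g y) := hi₁.add hgi
    refine (norm_integral_le_of_norm_le hsum (Eventually.of_forall hptw)).trans ?_
    rw [integral_add hi₁ hgi, hI₁]
  -- version 1: outside by the same `L¹` size
  have hv1 : ‖oseenSlice σ a a x‖ ≤ C * P * I * σ ^ (-(1 / 2 : ℝ)) + C * Mf ^ 2 * (I * σ ^ (-(1 / 2 : ℝ))) := by
    set g : EuclideanSpace ℝ (Fin 3) → ℝ := fun y => C * Mf ^ 2 * (σ + ‖x - y‖ ^ 2) ^ (-e) with hg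
    have hgi : Integrable g :=
      ((integrable_add_norm_sq_rpow_neg_half_succ (E := EuclideanSpace ℝ (Fin 3)) hσ).comp_sub_left x).const_mul
        (C * Mf ^ 2)
    have hgI : ∫ y, g y = C * Mf ^ 2 * (I * σ ^ (-(1 / 2 : ℝ))) := by
      rw [hg, integral_const_mul]
      have hW := integral_sub_left_eq_self (fun z : EuclideanSpace ℝ (Fin 3) => (σ + ‖z‖ ^ 2) ^ (-e)) volume x
      rw [hW, integral_add_norm_sq_rpow_neg_half_succ hσ, hI_def]
      ring
    have := hstep g hgi (fun y => by rw [hg]; exact mul_nonneg (by positivity) (Real.rpow_nonneg (by positivity) _))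
      (fun y _ => by rw [hg])
    rwa [hgI] at this
  -- version 2: outside by the polar exterior mass
  have hv2 : ‖oseenSlice σ a a x‖ ≤ C * P * I * σ ^ (-(1 / 2 : ℝ)) + C * Mf ^ 2 * (4 * Real.pi / d) := by
    set g : EuclideanSpace ℝ (Fin 3) → ℝ := fun y => C * Mf ^ 2 *
      (Metric.ball (0 : EuclideanSpace ℝ (Fin 3)) d)ᶜ.indicator (fun z => ‖z‖ ^ (-(4 : ℝ))) (x - y) with hg
    have hgi : Integrable g :=
      ((integrable_indicator_compl_ball_norm_rpow_neg_four hd).comp_sub_left x).const_mul (C * Mf ^ 2)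
    have hgI : ∫ y, g y = C * Mf ^ 2 * (4 * Real.pi / d) := by
      rw [hg, integral_const_mul]
      have hW := integral_sub_left_eq_self
        (fun z : EuclideanSpace ℝ (Fin 3) =>
          (Metric.ball (0 : EuclideanSpace ℝ (Fin 3)) d)ᶜ.indicator (fun z => ‖z‖ ^ (-(4 : ℝ))) z) volume x
      rw [hW, integral_indicator_compl_ball_norm_rpow_neg_four hd]
    have hgnn : ∀ y, 0 ≤ g y := fun y => by
      rw [hg]
      exact mul_nonneg (by positivity) (Set.indicator_nonneg (fun w _ => Real.rpow_nonneg (norm_nonneg _) _) _)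
    have hgout : ∀ y, ρ ≤ ‖y‖ → C * Mf ^ 2 * (σ + ‖x - y‖ ^ 2) ^ (-e) ≤ g y := by
      intro y hy
      have hdy := hdist y hy
      have hmem : x - y ∈ (Metric.ball (0 : EuclideanSpace ℝ (Fin 3)) d)ᶜ := by
        rw [mem_compl_iff, mem_ball_zero_iff, not_lt]; exact hdy
      rw [hg]
      simp only [indicator_of_mem hmem]
      have hzpos : 0 < ‖x - y‖ := hd.trans_le hdy
      have hwe : (σ + ‖x - y‖ ^ 2) ^ (-e) ≤ ‖x - y‖ ^ (-(4 : ℝ)) := by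
        rw [he]
        calc (σ + ‖x - y‖ ^ 2) ^ (-(2 : ℝ)) ≤ (‖x - y‖ ^ 2) ^ (-(2 : ℝ)) :=
              Real.rpow_le_rpow_of_nonpos (by positivity) (by linarith) (by norm_num)
          _ = ‖x - y‖ ^ (-(4 : ℝ)) := by
              rw [show ‖x - y‖ ^ 2 = ‖x - y‖ ^ ((2 : ℕ) : ℝ) from (Real.rpow_natCast ‖x - y‖ 2).symm,
                ← Real.rpow_mul hzpos.le]
              norm_num
      exact mul_le_mul_of_nonneg_left hwe (by positivity)
    have := hstep g hgi hgnn hgout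
    rwa [hgI] at this
  -- combine
  rcases min_cases (I * σ ^ (-(1 / 2 : ℝ))) (4 * Real.pi / d) with ⟨hmin, _⟩ | ⟨hmin, _⟩
  · rw [hmin]; exact hv1
  · rw [hmin]; exact hv2


/-! ### §1c (continued): two-region maximum principle for the caloric extension (Gaussian tail) -/

/-- Heat-kernel comparison off a ball in `ℝ³`: for `‖y‖ ≥ δ`,
`G_σ(y) ≤ 2^{3/2} e^{−δ²/(8σ)} · G_{2σ}(y)`. -/
theorem heatKernel_le_tail_mul_heatKernel_two_mul {σ δ : ℝ} (hσ : 0 < σ) (hδ : 0 ≤ δ)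
    {y : EuclideanSpace ℝ (Fin 3)} (hy : δ ≤ ‖y‖) :
    UnboundedOperators.heatKernel σ y ≤
      (2 : ℝ) ^ (3 / 2 : ℝ) * Real.exp (-(δ ^ 2 / (8 * σ))) * UnboundedOperators.heatKernel (2 * σ) y := by
  rw [UnboundedOperators.heatKernel_eq, UnboundedOperators.heatKernel_eq, finrank_euclideanSpace_fin]
  simp only [Nat.cast_ofNat]
  have h2pos : (0 : ℝ) < (2 : ℝ) ^ (3 / 2 : ℝ) := by positivity
  have h4 : (0 : ℝ) ≤ 4 * Real.pi * σ := by positivity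
  -- normalisations: `(4πσ)^{-3/2} = 2^{3/2} (8πσ)^{-3/2}`
  have hnorm : (4 * Real.pi * σ) ^ (-(3 : ℝ) / 2) =
      (2 : ℝ) ^ (3 / 2 : ℝ) * (4 * Real.pi * (2 * σ)) ^ (-(3 : ℝ) / 2) := by
    have h8 : 4 * Real.pi * (2 * σ) = 2 * (4 * Real.pi * σ) := by ring
    rw [h8, Real.mul_rpow zero_le_two h4, ← mul_assoc, show (-(3 : ℝ) / 2) = -(3 / 2 : ℝ) by ring,
      Real.rpow_neg zero_le_two, mul_inv_cancel₀ h2pos.ne', one_mul]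
  -- exponentials: `e^{-‖y‖²/(4σ)} ≤ e^{-δ²/(8σ)} e^{-‖y‖²/(8σ)}`
  have hexp : Real.exp (-(1 / (4 * σ)) * ‖y‖ ^ 2) ≤
      Real.exp (-(δ ^ 2 / (8 * σ))) * Real.exp (-(1 / (4 * (2 * σ))) * ‖y‖ ^ 2) := by
    rw [← Real.exp_add]
    refine Real.exp_le_exp.2 ?_
    have hy2 : δ ^ 2 ≤ ‖y‖ ^ 2 := pow_le_pow_left₀ hδ hy 2
    rw [show -(1 / (4 * σ)) * ‖y‖ ^ 2 = -(‖y‖ ^ 2 / (8 * σ)) + -(‖y‖ ^ 2 / (8 * σ)) by field_simp; ring,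
      show -(1 / (4 * (2 * σ))) * ‖y‖ ^ 2 = -(‖y‖ ^ 2 / (8 * σ)) by field_simp; ring]
    have : δ ^ 2 / (8 * σ) ≤ ‖y‖ ^ 2 / (8 * σ) := div_le_div_of_nonneg_right hy2 (by positivity)
    linarith
  have hA : 0 ≤ (4 * Real.pi * (2 * σ)) ^ (-(3 : ℝ) / 2) := Real.rpow_nonneg (by positivity) _
  rw [hnorm]
  calc (2 : ℝ) ^ (3 / 2 : ℝ) * (4 * Real.pi * (2 * σ)) ^ (-(3 : ℝ) / 2) * Real.exp (-(1 / (4 * σ)) * ‖y‖ ^ 2)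
      ≤ (2 : ℝ) ^ (3 / 2 : ℝ) * (4 * Real.pi * (2 * σ)) ^ (-(3 : ℝ) / 2) *
          (Real.exp (-(δ ^ 2 / (8 * σ))) * Real.exp (-(1 / (4 * (2 * σ))) * ‖y‖ ^ 2)) :=
        mul_le_mul_of_nonneg_left hexp (by positivity)
    _ = _ := by ring

/-- **Two-region maximum principle.**  If `‖f‖ ≤ a` on the ball `B(x,δ)` and `‖f‖ ≤ A` everywhere
(`a, A ≥ 0`, `δ, σ > 0`), then `‖e^{σΔ}f(x)‖ ≤ a + 2^{3/2} A e^{−δ²/(8σ)}`: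
the data near `x` enter with the unit mass of `G_σ`, the data off `B(x,δ)` with its Gaussian tail.
This is the heat part of the S3♭ receding-ball bootstrap (card §Addendum, T3). -/
theorem norm_heatExtension_two_region {f : EuclideanSpace ℝ (Fin 3) → EuclideanSpace ℝ (Fin 3)}
    {a A δ σ : ℝ} (ha : 0 ≤ a) (hA : 0 ≤ A) (hδ : 0 ≤ δ) (hσ : 0 < σ)
    {x : EuclideanSpace ℝ (Fin 3)}
    (hin : ∀ z, ‖z - x‖ < δ → ‖f z‖ ≤ a) (hout : ∀ z, ‖f z‖ ≤ A) :
    ‖UnboundedOperators.heatExtension f σ x‖ ≤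
      a + (2 : ℝ) ^ (3 / 2 : ℝ) * A * Real.exp (-(δ ^ 2 / (8 * σ))) := by
  rw [UnboundedOperators.heatExtension_apply]
  set T : ℝ := (2 : ℝ) ^ (3 / 2 : ℝ) * Real.exp (-(δ ^ 2 / (8 * σ))) with hT
  have hT0 : 0 ≤ T := by rw [hT]; positivity
  set g : EuclideanSpace ℝ (Fin 3) → ℝ := fun y =>
    a * UnboundedOperators.heatKernel σ y + A * T * UnboundedOperators.heatKernel (2 * σ) y with hg
  have hG1 := UnboundedOperators.integrable_heatKernel_holds (E := EuclideanSpace ℝ (Fin 3)) hσ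
  have hG2 := UnboundedOperators.integrable_heatKernel_holds (E := EuclideanSpace ℝ (Fin 3))
    (by positivity : (0 : ℝ) < 2 * σ)
  have hgi : Integrable g := (hG1.const_mul a).add (hG2.const_mul (A * T))
  have hptw : ∀ y, ‖UnboundedOperators.heatKernel σ y • f (x - y)‖ ≤ g y := by
    intro y
    have hk0 : 0 ≤ UnboundedOperators.heatKernel σ y := (UnboundedOperators.heatKernel_pos hσ y).le
    have hk2 : 0 ≤ UnboundedOperators.heatKernel (2 * σ) y :=
      (UnboundedOperators.heatKernel_pos (by positivity) y).le
    rw [norm_smul, Real.norm_of_nonneg hk0, hg]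
    by_cases hy : ‖y‖ < δ
    · have h1 : ‖f (x - y)‖ ≤ a := hin (x - y) (by rw [sub_sub_cancel_left, norm_neg]; exact hy)
      have : UnboundedOperators.heatKernel σ y * ‖f (x - y)‖ ≤ a * UnboundedOperators.heatKernel σ y := by
        rw [mul_comm]; exact mul_le_mul_of_nonneg_right h1 hk0
      have h2 : 0 ≤ A * T * UnboundedOperators.heatKernel (2 * σ) y := by positivity
      linarith
    · have hy' : δ ≤ ‖y‖ := not_lt.1 hy
      have htail := heatKernel_le_tail_mul_heatKernel_two_mul hσ hδ hy'
      have h1 : UnboundedOperators.heatKernel σ y * ‖f (x - y)‖ ≤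
          T * UnboundedOperators.heatKernel (2 * σ) y * A := by
        rw [hT]
        exact mul_le_mul htail (hout _) (norm_nonneg _) (by positivity)
      have h2 : 0 ≤ a * UnboundedOperators.heatKernel σ y := by positivity
      linarith
  refine (norm_integral_le_of_norm_le hgi (Eventually.of_forall hptw)).trans (le_of_eq ?_)
  rw [hg, integral_add (hG1.const_mul a) (hG2.const_mul (A * T)), integral_const_mul, integral_const_mul,
    UnboundedOperators.integral_heatKernel_eq_one_holds hσ,
    UnboundedOperators.integral_heatKernel_eq_one_holds (by positivity : (0 : ℝ) < 2 * σ), hT]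
  ring


/-- **QC from S3♭ and S4♭** (kernel-checked composition). -/
theorem quietCore_of_upgrade_of_pass {M B : ℝ} (h3 : SubcriticalUpgrade M) (h4 : BudgetPass M B) :
    QuietCore M B := by
  obtain ⟨c₀, s₁, hc₀, hs₁, hup⟩ := h3
  obtain ⟨s₂, K, hs₂, hK, hpass⟩ := h4 c₀ hc₀
  refine ⟨c₀, max s₁ s₂, K, hc₀, max_lt hs₁ hs₂, hK, fun v hv hBv s hs hq t ht x hx => ?_⟩
  have hs1 : s ∈ Set.Ico s₁ 0 := ⟨(le_max_left _ _).trans hs.1, hs.2⟩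
  have hs2 : s ∈ Set.Ico s₂ 0 := ⟨(le_max_right _ _).trans hs.1, hs.2⟩
  exact hpass v hv hBv s hs2 (hup v hv s hs1 hq) t ht x hx

theorem stubQuietCore_of (h3 : StubSubcriticalUpgrade) (h4 : StubBudgetPass) : StubQuietCore :=
  fun M B => quietCore_of_upgrade_of_pass (h3 M) (h4 M B)

section RecessionLaw
open Real

/-! ### §1d  S3♭ toolbox (PROVED, v1.4): T1 — the LOG-CORRECTED recession law `Φ(u) = 8κ b^{3/8} u^{1/8}(c₁ + 8 + log(b/u))`,
`Φ' = φ` positive antitone on `(0,b]`, and the far-kick calculus. -/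

/-- The recession profile `Φ`. -/
noncomputable def recessPhi (κ b c₁ u : ℝ) : ℝ :=
  8 * κ * b ^ (3 / 8 : ℝ) * u ^ (1 / 8 : ℝ) * (c₁ + 8 + Real.log (b / u))

/-- The recession rate `φ = Φ'`. -/
noncomputable def recessRate (κ b c₁ u : ℝ) : ℝ :=
  κ * b ^ (3 / 8 : ℝ) * u ^ (-(7 / 8 : ℝ)) * (c₁ + Real.log (b / u))

theorem hasDerivAt_recessPhi {κ b c₁ u : ℝ} (hb : 0 < b) (hu : 0 < u) :
    HasDerivAt (recessPhi κ b c₁) (recessRate κ b c₁ u) u := by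
  have h1 : HasDerivAt (fun x : ℝ => x ^ (1 / 8 : ℝ)) ((1 / 8 : ℝ) * u ^ ((1 / 8 : ℝ) - 1)) u :=
    Real.hasDerivAt_rpow_const (Or.inl hu.ne')
  have h2 : HasDerivAt (fun x : ℝ => c₁ + 8 + Real.log (b / x)) (-(u⁻¹)) u := by
    have hl : HasDerivAt (fun x : ℝ => Real.log (b / x)) (-(u⁻¹)) u := by
      have hlog : ∀ᶠ x in nhds u, Real.log (b / x) = Real.log b - Real.log x := by
        filter_upwards [lt_mem_nhds hu] with x hx
        rw [Real.log_div hb.ne' hx.ne']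
      refine HasDerivAt.congr_of_eventuallyEq ?_ hlog
      simpa using (Real.hasDerivAt_log hu.ne').const_sub (Real.log b)
    simpa using hl.const_add (c₁ + 8)
  have h12 := h1.mul h2
  have h3 : HasDerivAt (fun x : ℝ => 8 * κ * b ^ (3 / 8 : ℝ) * (x ^ (1 / 8 : ℝ) * (c₁ + 8 + Real.log (b / x))))
      (8 * κ * b ^ (3 / 8 : ℝ) * ((1 / 8 : ℝ) * u ^ ((1 / 8 : ℝ) - 1) * (c₁ + 8 + Real.log (b / u)) +
        u ^ (1 / 8 : ℝ) * -(u⁻¹))) u := h12.const_mul _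
  have hfun : recessPhi κ b c₁ =
      fun x : ℝ => 8 * κ * b ^ (3 / 8 : ℝ) * (x ^ (1 / 8 : ℝ) * (c₁ + 8 + Real.log (b / x))) := by
    funext x; simp only [recessPhi]; ring
  rw [hfun]
  convert h3 using 1
  -- value of the derivative
  have hpow : u ^ ((1 / 8 : ℝ) - 1) = u ^ (-(7 / 8 : ℝ)) := by norm_num
  have hpow2 : u ^ (1 / 8 : ℝ) * u⁻¹ = u ^ (-(7 / 8 : ℝ)) := by
    rw [← Real.rpow_neg_one, ← Real.rpow_add hu]; norm_num
  simp only [recessRate]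
  rw [hpow]
  have : u ^ (1 / 8 : ℝ) * -u⁻¹ = -(u ^ (-(7 / 8 : ℝ))) := by rw [mul_neg, hpow2]
  calc κ * b ^ (3 / 8 : ℝ) * u ^ (-(7 / 8 : ℝ)) * (c₁ + Real.log (b / u))
      = 8 * κ * b ^ (3 / 8 : ℝ) * ((1 / 8 : ℝ) * u ^ (-(7 / 8 : ℝ)) * (c₁ + 8 + Real.log (b / u)) +
          -(u ^ (-(7 / 8 : ℝ)))) := by ring
    _ = 8 * κ * b ^ (3 / 8 : ℝ) * ((1 / 8 : ℝ) * u ^ (-(7 / 8 : ℝ)) * (c₁ + 8 + Real.log (b / u)) +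
          u ^ (1 / 8 : ℝ) * -u⁻¹) := by rw [this]

theorem continuousOn_recessPhi {κ b c₁ : ℝ} (hb : 0 < b) : ContinuousOn (recessPhi κ b c₁) (Ioi 0) :=
  fun _ hu => (hasDerivAt_recessPhi (κ := κ) (c₁ := c₁) hb hu).continuousAt.continuousWithinAt

/-- `φ > 0` on `(0, b]` when `κ > 0`, `c₁ > 0`. -/
theorem recessRate_pos {κ b c₁ u : ℝ} (hκ : 0 < κ) (hb : 0 < b) (hc₁ : 0 < c₁) (hu : 0 < u) (hub : u ≤ b) :
    0 < recessRate κ b c₁ u := by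
  have hlog : 0 ≤ Real.log (b / u) := Real.log_nonneg (by rw [le_div_iff₀ hu, one_mul]; exact hub)
  unfold recessRate
  have h1 : 0 < b ^ (3 / 8 : ℝ) := Real.rpow_pos_of_pos hb _
  have h2 : 0 < u ^ (-(7 / 8 : ℝ)) := Real.rpow_pos_of_pos hu _
  have h3 : 0 < c₁ + Real.log (b / u) := by linarith
  positivity

/-- `φ` is antitone on `(0, b]`. -/
theorem recessRate_antitone {κ b c₁ u v : ℝ} (hκ : 0 < κ) (hb : 0 < b) (hc₁ : 0 < c₁)
    (hu : 0 < u) (huv : u ≤ v) (hvb : v ≤ b) :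
    recessRate κ b c₁ v ≤ recessRate κ b c₁ u := by
  have hv : 0 < v := hu.trans_le huv
  unfold recessRate
  have h1 : 0 < b ^ (3 / 8 : ℝ) := Real.rpow_pos_of_pos hb _
  have hpow : v ^ (-(7 / 8 : ℝ)) ≤ u ^ (-(7 / 8 : ℝ)) :=
    Real.rpow_le_rpow_of_nonpos hu huv (by norm_num)
  have hlogv : 0 ≤ Real.log (b / v) := Real.log_nonneg (by rw [le_div_iff₀ hv, one_mul]; exact hvb)
  have hlog : Real.log (b / v) ≤ Real.log (b / u) :=
    Real.log_le_log (div_pos hb hv) (div_le_div_of_nonneg_left hb.le hu huv)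
  have hA : 0 ≤ κ * b ^ (3 / 8 : ℝ) := by positivity
  have hB : 0 ≤ u ^ (-(7 / 8 : ℝ)) := Real.rpow_nonneg hu.le _
  calc κ * b ^ (3 / 8 : ℝ) * v ^ (-(7 / 8 : ℝ)) * (c₁ + Real.log (b / v))
      ≤ κ * b ^ (3 / 8 : ℝ) * u ^ (-(7 / 8 : ℝ)) * (c₁ + Real.log (b / u)) := by
        apply mul_le_mul (mul_le_mul_of_nonneg_left hpow hA) (by linarith) (by linarith) (mul_nonneg hA hB)

/-- **Mean-value lower bound for the recession distance**: for `0 < a < v ≤ b`,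
`Φ(v) − Φ(a) ≥ φ(v)·(v − a)` (the distance between the receding spheres at times `−v < −a` is at least the
current rate times the elapsed time). -/
theorem recessRate_mul_sub_le {κ b c₁ a v : ℝ} (hκ : 0 < κ) (hb : 0 < b) (hc₁ : 0 < c₁)
    (ha : 0 < a) (hav : a < v) (hvb : v ≤ b) :
    recessRate κ b c₁ v * (v - a) ≤ recessPhi κ b c₁ v - recessPhi κ b c₁ a := by
  have hcont : ContinuousOn (recessPhi κ b c₁) (Icc a v) :=
    (continuousOn_recessPhi hb).mono fun u hu => ha.trans_le hu.1
  have hderiv : ∀ u ∈ Ioo a v, HasDerivAt (recessPhi κ b c₁) (recessRate κ b c₁ u) u :=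
    fun u hu => hasDerivAt_recessPhi hb (ha.trans hu.1)
  obtain ⟨c, hc, hslope⟩ := exists_hasDerivAt_eq_slope (recessPhi κ b c₁) (recessRate κ b c₁) hav hcont hderiv
  have hva : 0 < v - a := sub_pos.2 hav
  have hrate : recessRate κ b c₁ v ≤ recessRate κ b c₁ c :=
    recessRate_antitone hκ hb hc₁ (ha.trans hc.1) hc.2.le hvb
  calc recessRate κ b c₁ v * (v - a) ≤ recessRate κ b c₁ c * (v - a) :=
        mul_le_mul_of_nonneg_right hrate hva.le
    _ = recessPhi κ b c₁ v - recessPhi κ b c₁ a := by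
        rw [hslope, div_mul_cancel₀ _ hva.ne']

/-- `Φ` is strictly increasing on `(0, b]` (so the spheres genuinely recede): `Φ(a) < Φ(v)` for `0 < a < v ≤ b`. -/
theorem recessPhi_lt {κ b c₁ a v : ℝ} (hκ : 0 < κ) (hb : 0 < b) (hc₁ : 0 < c₁)
    (ha : 0 < a) (hav : a < v) (hvb : v ≤ b) :
    recessPhi κ b c₁ a < recessPhi κ b c₁ v := by
  have h := recessRate_mul_sub_le hκ hb hc₁ ha hav hvb
  have hpos : 0 < recessRate κ b c₁ v * (v - a) :=
    mul_pos (recessRate_pos hκ hb hc₁ (ha.trans hav) hvb) (sub_pos.2 hav)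
  linarith

/-- Total recession: `Φ(b) = 8κ(c₁ + 8)√b` (`log(b/b) = 0`, `b^{3/8} b^{1/8} = b^{1/2}`). -/
theorem recessPhi_self {κ b c₁ : ℝ} (hb : 0 < b) :
    recessPhi κ b c₁ b = 8 * κ * (c₁ + 8) * Real.sqrt b := by
  unfold recessPhi
  rw [div_self hb.ne', Real.log_one, add_zero, Real.sqrt_eq_rpow,
    show (1 / 2 : ℝ) = 3 / 8 + 1 / 8 by norm_num, Real.rpow_add hb]
  ring


/-! #### T1, near range: the kernel-crossover integral
`∫_a^{a+ℓ} min(I(u−a)^{-1/2}, 4π/(φ(u−a))) du ≤ (4π/φ)(2 + log⁺(a I² φ²/(16π²)))` for `0 < ℓ ≤ a`. -/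

/-- `∫_a^{a+λ} (u−a)^{-1/2} du = 2 λ^{1/2}` (for `λ < 0` both sides use junk values consistently). -/
theorem intervalIntegral_sub_rpow_neg_half (a lam : ℝ) :
    ∫ u in a..(a + lam), (u - a) ^ (-(1 / 2 : ℝ)) = 2 * lam ^ (1 / 2 : ℝ) := by
  rw [intervalIntegral.integral_comp_sub_right (fun x : ℝ => x ^ (-(1 / 2 : ℝ))) a, sub_self,
    add_sub_cancel_left, integral_rpow (Or.inl (by norm_num))]
  have h1 : (-(1 / 2 : ℝ)) + 1 = 1 / 2 := by norm_num
  rw [h1, Real.zero_rpow (by norm_num), sub_zero]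
  ring

/-- `∫_{a+λ}^{a+ℓ} (u−a)^{-1} du = log(ℓ/λ)` for `0 < λ ≤ ℓ`. -/
theorem intervalIntegral_inv_sub {a lam ℓ : ℝ} (hlam : 0 < lam) (hℓ : lam ≤ ℓ) :
    ∫ u in (a + lam)..(a + ℓ), (u - a)⁻¹ = Real.log (ℓ / lam) := by
  rw [intervalIntegral.integral_comp_sub_right (fun x : ℝ => x⁻¹) a, add_sub_cancel_left, add_sub_cancel_left,
    integral_inv_of_pos hlam (hlam.trans_le hℓ)]

/-- **Crossover integral.**  For `I, φ, a, ℓ > 0`, `ℓ ≤ a`: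
`∫_a^{a+ℓ} min(I(u−a)^{-1/2}, 4π/(φ(u−a))) du ≤ (4π/φ)·(2 + log⁺(a·I²φ²/(16π²)))`
(below the crossover `λ₀ = (4π/(Iφ))²` use the square-root singularity, above it the `1/σ` tail). -/
theorem crossover_integral_le {I φ a ℓ : ℝ} (hI : 0 < I) (hφ : 0 < φ) (ha : 0 < a) (hℓ : 0 < ℓ) (hℓa : ℓ ≤ a) :
    ∫ u in a..(a + ℓ), min (I * (u - a) ^ (-(1 / 2 : ℝ))) (4 * π / (φ * (u - a))) ≤
      (4 * π / φ) * (2 + max 0 (Real.log (a * (I ^ 2 * φ ^ 2 / (16 * π ^ 2))))) := by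
  set lam0 : ℝ := (4 * π / (I * φ)) ^ 2 with hlam0
  have hlam0pos : 0 < lam0 := by rw [hlam0]; positivity
  set lam : ℝ := min lam0 ℓ with hlam
  have hlampos : 0 < lam := lt_min hlam0pos hℓ
  have hlamℓ : lam ≤ ℓ := min_le_right _ _
  have hlam0' : lam ≤ lam0 := min_le_left _ _
  set g : ℝ → ℝ := fun u => min (I * (u - a) ^ (-(1 / 2 : ℝ))) (4 * π / (φ * (u - a))) with hg
  -- continuity of the two branches off `u = a`
  have hc1 : ContinuousOn (fun u : ℝ => I * (u - a) ^ (-(1 / 2 : ℝ))) (Ioi a) := by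
    refine continuousOn_const.mul ?_
    exact ContinuousOn.rpow_const (continuousOn_id.sub continuousOn_const)
      (fun u hu => Or.inl (sub_ne_zero.2 (ne_of_gt hu)))
  have hc2 : ContinuousOn (fun u : ℝ => 4 * π / (φ * (u - a))) (Ioi a) := by
    refine continuousOn_const.div (continuousOn_const.mul (continuousOn_id.sub continuousOn_const)) ?_
    intro u hu; exact mul_ne_zero hφ.ne' (sub_ne_zero.2 (ne_of_gt hu))
  have hgc : ContinuousOn g (Ioi a) := by
    rw [hg]; exact continuous_min.comp_continuousOn (hc1.prodMk hc2)
  have hgnn : ∀ u, a < u → 0 ≤ g u := fun u hu => by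
    rw [hg]
    exact le_min (mul_nonneg hI.le (Real.rpow_nonneg (by linarith) _))
      (div_nonneg (by positivity) (mul_nonneg hφ.le (by linarith)))
  -- piece 1: `[a, a+lam]`, dominated by the square-root branch
  have hsq_int : IntervalIntegrable (fun u : ℝ => I * (u - a) ^ (-(1 / 2 : ℝ))) volume a (a + lam) := by
    have h0 : IntervalIntegrable (fun x : ℝ => x ^ (-(1 / 2 : ℝ))) volume 0 lam :=
      intervalIntegral.intervalIntegrable_rpow' (by norm_num)
    have h1 := (h0.comp_sub_right a).const_mul I
    simp only [zero_add] at h1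
    rwa [add_comm lam a] at h1
  have hg_int1 : IntervalIntegrable g volume a (a + lam) := by
    refine hsq_int.mono_fun' ?_ ?_
    · refine (hgc.mono ?_).aestronglyMeasurable measurableSet_uIoc
      rw [uIoc_of_le (by linarith)]; exact fun u hu => hu.1
    · rw [uIoc_of_le (by linarith)]
      refine (ae_restrict_mem measurableSet_Ioc).mono fun u hu => ?_
      show ‖g u‖ ≤ I * (u - a) ^ (-(1 / 2 : ℝ))
      rw [Real.norm_of_nonneg (hgnn u hu.1), hg]
      exact min_le_left _ _
  have hpiece1 : ∫ u in a..(a + lam), g u ≤ 8 * π / φ := by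
    have hmono : ∫ u in a..(a + lam), g u ≤ ∫ u in a..(a + lam), I * (u - a) ^ (-(1 / 2 : ℝ)) := by
      refine intervalIntegral.integral_mono_on_of_le_Ioo (by linarith) hg_int1 hsq_int fun u hu => ?_
      rw [hg]; exact min_le_left _ _
    refine hmono.trans ?_
    rw [intervalIntegral.integral_const_mul, intervalIntegral_sub_rpow_neg_half a lam]
    -- `I · 2 lam^{1/2} ≤ I · 2 lam0^{1/2} = 8π/φ`
    have hroot : lam ^ (1 / 2 : ℝ) ≤ lam0 ^ (1 / 2 : ℝ) := Real.rpow_le_rpow hlampos.le hlam0' (by norm_num)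
    have hroot0 : lam0 ^ (1 / 2 : ℝ) = 4 * π / (I * φ) := by
      rw [hlam0, ← Real.sqrt_eq_rpow, Real.sqrt_sq (by positivity)]
    calc I * (2 * lam ^ (1 / 2 : ℝ)) ≤ I * (2 * lam0 ^ (1 / 2 : ℝ)) := by gcongr
      _ = 8 * π / φ := by rw [hroot0]; field_simp; ring
  -- piece 2: `[a+lam, a+ℓ]`, dominated by the `1/σ` branch
  have hc2' : ContinuousOn (fun u : ℝ => 4 * π / (φ * (u - a))) (uIcc (a + lam) (a + ℓ)) := by
    refine hc2.mono ?_
    rw [uIcc_of_le (by linarith)]; exact fun u hu => by simp only [mem_Ioi]; linarith [hu.1]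
  have hgc' : ContinuousOn g (uIcc (a + lam) (a + ℓ)) := by
    refine hgc.mono ?_
    rw [uIcc_of_le (by linarith)]; exact fun u hu => by simp only [mem_Ioi]; linarith [hu.1]
  have hpiece2 : ∫ u in (a + lam)..(a + ℓ), g u ≤ (4 * π / φ) * Real.log (ℓ / lam) := by
    have hmono : ∫ u in (a + lam)..(a + ℓ), g u ≤ ∫ u in (a + lam)..(a + ℓ), 4 * π / (φ * (u - a)) := by
      refine intervalIntegral.integral_mono_on (by linarith) hgc'.intervalIntegrable hc2'.intervalIntegrable
        fun u _ => ?_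
      rw [hg]; exact min_le_right _ _
    refine hmono.trans (le_of_eq ?_)
    have hfun : (fun u : ℝ => 4 * π / (φ * (u - a))) = fun u => (4 * π / φ) * (u - a)⁻¹ := by
      funext u; rw [mul_comm φ, ← div_div, div_eq_mul_inv]
      ring
    rw [hfun, intervalIntegral.integral_const_mul, intervalIntegral_inv_sub hlampos hlamℓ]
  -- the logarithm: `log(ℓ/lam) ≤ log⁺(a/lam0) = log⁺(a I² φ²/(16π²))`
  have hlog : Real.log (ℓ / lam) ≤ max 0 (Real.log (a * (I ^ 2 * φ ^ 2 / (16 * π ^ 2)))) := by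
    rcases min_cases lam0 ℓ with ⟨hm, hle⟩ | ⟨hm, hlt⟩
    · -- lam = lam0 ≤ ℓ ≤ a
      have hlamv : lam = lam0 := by rw [hlam, hm]
      refine le_trans ?_ (le_max_right _ _)
      rw [hlamv]
      refine Real.log_le_log (div_pos hℓ hlam0pos) ?_
      have ha' : a * (I ^ 2 * φ ^ 2 / (16 * π ^ 2)) = a / lam0 := by
        rw [hlam0]; field_simp; ring
      rw [ha']
      exact div_le_div_of_nonneg_right hℓa hlam0pos.le
    · -- lam = ℓ
      have hlamv : lam = ℓ := by rw [hlam, hm]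
      rw [hlamv, div_self hℓ.ne', Real.log_one]
      exact le_max_left _ _
  -- combine
  have hsplit : ∫ u in a..(a + ℓ), g u = (∫ u in a..(a + lam), g u) + ∫ u in (a + lam)..(a + ℓ), g u :=
    (intervalIntegral.integral_add_adjacent_intervals hg_int1 hgc'.intervalIntegrable).symm
  rw [hsplit]
  have h4 : 0 ≤ 4 * π / φ := by positivity
  calc (∫ u in a..(a + lam), g u) + ∫ u in (a + lam)..(a + ℓ), g u
      ≤ 8 * π / φ + (4 * π / φ) * Real.log (ℓ / lam) := add_le_add hpiece1 hpiece2
    _ ≤ 8 * π / φ + (4 * π / φ) * max 0 (Real.log (a * (I ^ 2 * φ ^ 2 / (16 * π ^ 2)))) := by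
        gcongr
    _ = (4 * π / φ) * (2 + max 0 (Real.log (a * (I ^ 2 * φ ^ 2 / (16 * π ^ 2))))) := by ring


/-- Interval-integrability of the crossover minimum on any `[a, c]` (dominated by the square-root branch). -/
theorem intervalIntegrable_crossMin {I φ a c : ℝ} (hI : 0 < I) (hφ : 0 < φ) (hac : a ≤ c) :
    IntervalIntegrable (fun u : ℝ => min (I * (u - a) ^ (-(1 / 2 : ℝ))) (4 * π / (φ * (u - a)))) volume a c := by
  have hc1 : ContinuousOn (fun u : ℝ => I * (u - a) ^ (-(1 / 2 : ℝ))) (Ioi a) := by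
    refine continuousOn_const.mul ?_
    exact ContinuousOn.rpow_const (continuousOn_id.sub continuousOn_const)
      (fun u hu => Or.inl (sub_ne_zero.2 (ne_of_gt hu)))
  have hc2 : ContinuousOn (fun u : ℝ => 4 * π / (φ * (u - a))) (Ioi a) := by
    refine continuousOn_const.div (continuousOn_const.mul (continuousOn_id.sub continuousOn_const)) ?_
    intro u hu; exact mul_ne_zero hφ.ne' (sub_ne_zero.2 (ne_of_gt hu))
  have hgc : ContinuousOn (fun u : ℝ => min (I * (u - a) ^ (-(1 / 2 : ℝ))) (4 * π / (φ * (u - a)))) (Ioi a) :=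
    continuous_min.comp_continuousOn (hc1.prodMk hc2)
  have hsq_int : IntervalIntegrable (fun u : ℝ => I * (u - a) ^ (-(1 / 2 : ℝ))) volume a c := by
    have h0 : IntervalIntegrable (fun x : ℝ => x ^ (-(1 / 2 : ℝ))) volume 0 (c - a) :=
      intervalIntegral.intervalIntegrable_rpow' (by norm_num)
    have h1 := (h0.comp_sub_right a).const_mul I
    simp only [zero_add, sub_add_cancel] at h1
    exact h1
  refine hsq_int.mono_fun' ?_ ?_
  · refine (hgc.mono ?_).aestronglyMeasurable measurableSet_uIoc
    rw [uIoc_of_le hac]; exact fun u hu => hu.1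
  · rw [uIoc_of_le hac]
    refine (ae_restrict_mem measurableSet_Ioc).mono fun u hu => ?_
    show ‖min (I * (u - a) ^ (-(1 / 2 : ℝ))) (4 * π / (φ * (u - a)))‖ ≤ I * (u - a) ^ (-(1 / 2 : ℝ))
    have h1 : 0 ≤ I * (u - a) ^ (-(1 / 2 : ℝ)) := mul_nonneg hI.le (Real.rpow_nonneg (by linarith [hu.1]) _)
    have h2 : 0 ≤ 4 * π / (φ * (u - a)) := div_nonneg (by positivity) (mul_nonneg hφ.le (by linarith [hu.1]))
    rw [Real.norm_of_nonneg (le_min h1 h2)]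
    exact min_le_left _ _

/-! #### T1, the far-kick integral against the log-corrected recession law -/

/-- `log 2 ≤ 1`. -/
theorem log_two_le_one : Real.log 2 ≤ 1 := by
  have := Real.log_two_lt_d9; linarith

/-- Floor for the recession rate on the near range `a < u ≤ min(2a, b)`:
`φ(u) ≥ κ b^{3/8} a^{-7/8} Λ/4`, `Λ = c₁ + log(b/a)`, when `c₁ ≥ 2`. -/
theorem recessRate_ge_floor {κ b c₁ a u : ℝ} (hκ : 0 < κ) (hb : 0 < b) (hc₁ : 2 ≤ c₁) (ha : 0 < a) (hab : a ≤ b)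
    (hau : a < u) (hu2 : u ≤ 2 * a) :
    κ * b ^ (3 / 8 : ℝ) * a ^ (-(7 / 8 : ℝ)) * (c₁ + Real.log (b / a)) / 4 ≤ recessRate κ b c₁ u := by
  have hu : 0 < u := ha.trans hau
  have hb38 : 0 < b ^ (3 / 8 : ℝ) := Real.rpow_pos_of_pos hb _
  -- first factor: `u^{-7/8} ≥ (2a)^{-7/8} = 2^{-7/8} a^{-7/8} ≥ a^{-7/8}/2`
  have hpow1 : (2 * a) ^ (-(7 / 8 : ℝ)) ≤ u ^ (-(7 / 8 : ℝ)) :=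
    Real.rpow_le_rpow_of_nonpos hu hu2 (by norm_num)
  have hpow2 : a ^ (-(7 / 8 : ℝ)) / 2 ≤ (2 * a) ^ (-(7 / 8 : ℝ)) := by
    rw [Real.mul_rpow (by norm_num) ha.le]
    have h2 : (1 / 2 : ℝ) ≤ (2 : ℝ) ^ (-(7 / 8 : ℝ)) := by
      rw [show (1 / 2 : ℝ) = (2 : ℝ) ^ (-(1 : ℝ)) by rw [Real.rpow_neg_one]; norm_num]
      exact Real.rpow_le_rpow_of_exponent_le (by norm_num) (by norm_num)
    have ha78 : 0 ≤ a ^ (-(7 / 8 : ℝ)) := Real.rpow_nonneg ha.le _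
    calc a ^ (-(7 / 8 : ℝ)) / 2 = (1 / 2) * a ^ (-(7 / 8 : ℝ)) := by ring
      _ ≤ (2 : ℝ) ^ (-(7 / 8 : ℝ)) * a ^ (-(7 / 8 : ℝ)) := mul_le_mul_of_nonneg_right h2 ha78
  -- second factor: `c₁ + log(b/u) ≥ c₁ + log(b/a) − log 2 ≥ Λ/2`
  have hlogba : 0 ≤ Real.log (b / a) := Real.log_nonneg (by rw [le_div_iff₀ ha, one_mul]; exact hab)
  have hlog1 : Real.log (b / a) - Real.log 2 ≤ Real.log (b / u) := by
    rw [← Real.log_div (div_pos hb ha).ne' (by norm_num)]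
    refine Real.log_le_log (by positivity) ?_
    rw [div_div, div_le_div_iff_of_pos_left hb (by positivity) hu]
    linarith
  have hΛ : (c₁ + Real.log (b / a)) / 2 ≤ c₁ + Real.log (b / u) := by
    have := log_two_le_one; linarith
  have hΛnn : 0 ≤ (c₁ + Real.log (b / a)) / 2 := by linarith
  unfold recessRate
  have hA : 0 ≤ κ * b ^ (3 / 8 : ℝ) := by positivity
  calc κ * b ^ (3 / 8 : ℝ) * a ^ (-(7 / 8 : ℝ)) * (c₁ + Real.log (b / a)) / 4
      = κ * b ^ (3 / 8 : ℝ) * (a ^ (-(7 / 8 : ℝ)) / 2) * ((c₁ + Real.log (b / a)) / 2) := by ring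
    _ ≤ κ * b ^ (3 / 8 : ℝ) * u ^ (-(7 / 8 : ℝ)) * (c₁ + Real.log (b / u)) := by
        apply mul_le_mul (mul_le_mul_of_nonneg_left (hpow2.trans hpow1) hA) hΛ hΛnn
        exact mul_nonneg hA (Real.rpow_nonneg hu.le _)

/-- Far-range pointwise bound: for `2a ≤ u ≤ b` (`0 < a`, `c₁ > 0`),
`u⁻¹ · 4π/(Φ(u) − Φ(a)) ≤ (8π/(κ b^{3/8} c₁)) · u^{-9/8}`. -/
theorem far_pointwise_le {κ b c₁ a u : ℝ} (hκ : 0 < κ) (hb : 0 < b) (hc₁ : 0 < c₁) (ha : 0 < a)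
    (hu2 : 2 * a ≤ u) (hub : u ≤ b) :
    u⁻¹ * (4 * π / (recessPhi κ b c₁ u - recessPhi κ b c₁ a)) ≤
      8 * π / (κ * b ^ (3 / 8 : ℝ) * c₁) * u ^ (-(9 / 8 : ℝ)) := by
  have hau : a < u := by linarith
  have hu : 0 < u := ha.trans hau
  have hb38 : 0 < b ^ (3 / 8 : ℝ) := Real.rpow_pos_of_pos hb _
  have hu78 : 0 < u ^ (-(7 / 8 : ℝ)) := Real.rpow_pos_of_pos hu _
  -- `Φ(u) − Φ(a) ≥ φ(u)(u − a) ≥ κ b^{3/8} u^{-7/8} c₁ · (u/2)`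
  have hmvt := recessRate_mul_sub_le hκ hb hc₁ ha hau hub
  have hlog : 0 ≤ Real.log (b / u) := Real.log_nonneg (by rw [le_div_iff₀ hu, one_mul]; exact hub)
  have hrate : κ * b ^ (3 / 8 : ℝ) * u ^ (-(7 / 8 : ℝ)) * c₁ ≤ recessRate κ b c₁ u := by
    unfold recessRate
    have hA : 0 ≤ κ * b ^ (3 / 8 : ℝ) * u ^ (-(7 / 8 : ℝ)) := by positivity
    exact mul_le_mul_of_nonneg_left (by linarith) hA
  have hD : κ * b ^ (3 / 8 : ℝ) * u ^ (-(7 / 8 : ℝ)) * c₁ * (u / 2) ≤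
      recessPhi κ b c₁ u - recessPhi κ b c₁ a := by
    have h1 : κ * b ^ (3 / 8 : ℝ) * u ^ (-(7 / 8 : ℝ)) * c₁ * (u / 2) ≤ recessRate κ b c₁ u * (u - a) := by
      apply mul_le_mul hrate (by linarith) (by linarith)
      exact (recessRate_pos hκ hb hc₁ hu hub).le
    exact h1.trans hmvt
  have hDpos : 0 < κ * b ^ (3 / 8 : ℝ) * u ^ (-(7 / 8 : ℝ)) * c₁ * (u / 2) := by positivity
  -- hence `4π/(Φu − Φa) ≤ 4π / (κ b^{3/8} u^{-7/8} c₁ u/2)`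
  have hfrac : 4 * π / (recessPhi κ b c₁ u - recessPhi κ b c₁ a) ≤
      4 * π / (κ * b ^ (3 / 8 : ℝ) * u ^ (-(7 / 8 : ℝ)) * c₁ * (u / 2)) :=
    div_le_div_of_nonneg_left (by positivity) hDpos hD
  have hupow : u ^ (-(9 / 8 : ℝ)) = u⁻¹ * u⁻¹ * (u ^ (-(7 / 8 : ℝ)))⁻¹ := by
    rw [Real.rpow_neg hu.le (7 / 8 : ℝ), inv_inv, ← Real.rpow_neg_one, ← Real.rpow_add hu, ← Real.rpow_add hu]
    norm_num
  set w : ℝ := u ^ (-(7 / 8 : ℝ)) with hw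
  have hwne : w ≠ 0 := hu78.ne'
  calc u⁻¹ * (4 * π / (recessPhi κ b c₁ u - recessPhi κ b c₁ a))
      ≤ u⁻¹ * (4 * π / (κ * b ^ (3 / 8 : ℝ) * w * c₁ * (u / 2))) :=
        mul_le_mul_of_nonneg_left hfrac (inv_nonneg.2 hu.le)
    _ = 8 * π / (κ * b ^ (3 / 8 : ℝ) * c₁) * (u⁻¹ * u⁻¹ * w⁻¹) := by
        field_simp; norm_num
    _ = 8 * π / (κ * b ^ (3 / 8 : ℝ) * c₁) * u ^ (-(9 / 8 : ℝ)) := by rw [hupow]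

/-- The logarithmic bookkeeping: if `2 ≤ Λ`, `1 ≤ r`, `log r ≤ Λ`, `2|log κ| + |log X| ≤ Λ − 2` and
`0 < y ≤ κ² r Λ² X`, then `2 + log⁺ y ≤ 4Λ`. -/
theorem two_add_posLog_le {κ X Λ r y : ℝ} (hκ : 0 < κ) (hX : 0 < X) (hΛ : 2 ≤ Λ) (hr : 1 ≤ r)
    (hrΛ : Real.log r ≤ Λ) (hc : 2 * |Real.log κ| + |Real.log X| ≤ Λ - 2) (hy0 : 0 < y)
    (hy : y ≤ κ ^ 2 * r * Λ ^ 2 * X) : 2 + max 0 (Real.log y) ≤ 4 * Λ := by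
  have hΛpos : 0 < Λ := by linarith
  have hlogy : Real.log y ≤ 2 * Real.log κ + Real.log r + 2 * Real.log Λ + Real.log X := by
    have h := Real.log_le_log hy0 hy
    rw [Real.log_mul (by positivity) hX.ne', Real.log_mul (by positivity) (by positivity),
      Real.log_mul (by positivity) (by positivity), Real.log_pow, Real.log_pow] at h
    push_cast at h
    linarith
  have hlogΛ : Real.log Λ ≤ Λ - 1 := Real.log_le_sub_one_of_pos hΛpos
  have h1 : Real.log κ ≤ |Real.log κ| := le_abs_self _
  have h2 : Real.log X ≤ |Real.log X| := le_abs_self _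
  have hly : Real.log y ≤ 4 * Λ - 4 := by linarith
  rcases le_total 0 (Real.log y) with h | h
  · rw [max_eq_right h]; linarith
  · rw [max_eq_left h]; linarith


/-- The far-kick integrand `g(u) = u⁻¹ · min(I(u−a)^{-1/2}, 4π/(Φ(u) − Φ(a)))` is continuous on `(a, b]`. -/
theorem continuousOn_farKick {κ b c₁ a I : ℝ} (hκ : 0 < κ) (hb : 0 < b) (hc₁ : 0 < c₁) (ha : 0 < a) :
    ContinuousOn (fun u : ℝ => u⁻¹ * min (I * (u - a) ^ (-(1 / 2 : ℝ)))
      (4 * π / (recessPhi κ b c₁ u - recessPhi κ b c₁ a))) (Ioc a b) := by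
  have hc0 : ContinuousOn (fun u : ℝ => u⁻¹) (Ioc a b) :=
    (continuousOn_inv₀ (G₀ := ℝ)).mono fun u hu => (ha.trans hu.1).ne'
  have hc1 : ContinuousOn (fun u : ℝ => I * (u - a) ^ (-(1 / 2 : ℝ))) (Ioc a b) := by
    refine continuousOn_const.mul ?_
    exact ContinuousOn.rpow_const (continuousOn_id.sub continuousOn_const)
      (fun u hu => Or.inl (sub_ne_zero.2 (ne_of_gt hu.1)))
  have hc2 : ContinuousOn (fun u : ℝ => 4 * π / (recessPhi κ b c₁ u - recessPhi κ b c₁ a)) (Ioc a b) := by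
    refine continuousOn_const.div (((continuousOn_recessPhi hb).mono ?_).sub continuousOn_const) ?_
    · exact fun u hu => ha.trans hu.1
    · intro u hu; exact (sub_pos.2 (recessPhi_lt hκ hb hc₁ ha hu.1 hu.2)).ne'
  exact hc0.mul (continuous_min.comp_continuousOn (hc1.prodMk hc2))

/-- **T1 (far-kick calculus for the log-corrected recession law).**
For `0 < a < b`, `κ, I > 0` and `c₁ ≥ 2 + 2|log κ| + |log(I²/(16π²))|`, with
`Φ(u) = 8κ b^{3/8} u^{1/8}(c₁ + 8 + log(b/u))`:
`∫_a^b u⁻¹ · min(I (u−a)^{-1/2}, 4π/(Φ(u) − Φ(a))) du ≤ (96π/κ) · b^{-3/8} · a^{-1/8}`.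
(In the S3♭ bootstrap: `u = −τ`, `a = −t`, `b = −s`; the Type-I far field outside the receding ball `B(0, 3/4 + Φ(−τ))`
kicks the point `x`, `‖x‖ < 3/4 + Φ(−t)`, at rate `C M² u⁻¹ min(I σ^{-1/2}, 4π/d)` by `norm_oseenSlice_receding`; choosing
`κ = 96π C M²/c₀` makes the total far kick `≤ c₀ b^{-3/8} a^{-1/8}`, a quarter of the target `4c₀ b^{-3/8} a^{-1/8}`.) -/
theorem farKick_integral_le {κ b c₁ a I : ℝ} (hκ : 0 < κ) (hI : 0 < I) (ha : 0 < a) (hab : a < b)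
    (hc₁ : 2 + 2 * |Real.log κ| + |Real.log (I ^ 2 / (16 * π ^ 2))| ≤ c₁) :
    ∫ u in a..b, u⁻¹ * min (I * (u - a) ^ (-(1 / 2 : ℝ))) (4 * π / (recessPhi κ b c₁ u - recessPhi κ b c₁ a)) ≤
      96 * π / κ * b ^ (-(3 / 8 : ℝ)) * a ^ (-(1 / 8 : ℝ)) := by
  have hb : 0 < b := ha.trans hab
  have hc₁2 : 2 ≤ c₁ := by
    have h1 := abs_nonneg (Real.log κ); have h2 := abs_nonneg (Real.log (I ^ 2 / (16 * π ^ 2))); linarith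
  have hc₁pos : 0 < c₁ := by linarith
  set Φ : ℝ → ℝ := recessPhi κ b c₁ with hΦ
  set g : ℝ → ℝ := fun u => u⁻¹ * min (I * (u - a) ^ (-(1 / 2 : ℝ))) (4 * π / (Φ u - Φ a)) with hg
  -- the split point `a₂ = min(2a, b)` and the near-range length `ℓ = a₂ − a ∈ (0, a]`
  set a₂ : ℝ := min (2 * a) b with ha₂
  have ha₂a : a < a₂ := lt_min (by linarith) hab
  have ha₂2 : a₂ ≤ 2 * a := min_le_left _ _
  have ha₂b : a₂ ≤ b := min_le_right _ _
  set ℓ : ℝ := a₂ - a with hℓ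
  have hℓpos : 0 < ℓ := by rw [hℓ]; linarith
  have hℓa : ℓ ≤ a := by rw [hℓ]; linarith
  have haℓ : a + ℓ = a₂ := by rw [hℓ]; ring
  -- `Λ` and the rate floor `φ⋆`
  set Λ : ℝ := c₁ + Real.log (b / a) with hΛ
  have hlogba : 0 ≤ Real.log (b / a) := Real.log_nonneg (by rw [le_div_iff₀ ha, one_mul]; exact hab.le)
  have hΛc : c₁ ≤ Λ := by rw [hΛ]; linarith
  have hΛ2 : 2 ≤ Λ := hc₁2.trans hΛc
  have hΛpos : 0 < Λ := by linarith
  have hb38 : 0 < b ^ (3 / 8 : ℝ) := Real.rpow_pos_of_pos hb _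
  have ha78 : 0 < a ^ (-(7 / 8 : ℝ)) := Real.rpow_pos_of_pos ha _
  set φs : ℝ := κ * b ^ (3 / 8 : ℝ) * a ^ (-(7 / 8 : ℝ)) * Λ / 4 with hφs
  have hφs_pos : 0 < φs := by rw [hφs]; positivity
  -- nonnegativity and the two pointwise majorants
  have hgnn : ∀ u, a < u → u ≤ b → 0 ≤ g u := by
    intro u hau hub
    have hu : 0 < u := ha.trans hau
    have hd : 0 < Φ u - Φ a := sub_pos.2 (recessPhi_lt hκ hb hc₁pos ha hau hub)
    rw [hg]
    exact mul_nonneg (inv_nonneg.2 hu.le) (le_min (mul_nonneg hI.le (Real.rpow_nonneg (by linarith) _))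
      (div_nonneg (by positivity) hd.le))
  have hnear : ∀ u, a < u → u ≤ a₂ →
      g u ≤ a⁻¹ * min (I * (u - a) ^ (-(1 / 2 : ℝ))) (4 * π / (φs * (u - a))) := by
    intro u hau hua₂
    have hu : 0 < u := ha.trans hau
    have hub : u ≤ b := hua₂.trans ha₂b
    have hfloor : φs ≤ recessRate κ b c₁ u := by
      rw [hφs, hΛ]; exact recessRate_ge_floor hκ hb hc₁2 ha hab.le hau (hua₂.trans ha₂2)
    have hmvt := recessRate_mul_sub_le hκ hb hc₁pos ha hau hub
    have hd : φs * (u - a) ≤ Φ u - Φ a :=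
      (mul_le_mul_of_nonneg_right hfloor (by linarith)).trans hmvt
    have hdpos : 0 < φs * (u - a) := mul_pos hφs_pos (by linarith)
    have hmin : min (I * (u - a) ^ (-(1 / 2 : ℝ))) (4 * π / (Φ u - Φ a)) ≤
        min (I * (u - a) ^ (-(1 / 2 : ℝ))) (4 * π / (φs * (u - a))) :=
      min_le_min_left _ (div_le_div_of_nonneg_left (by positivity) hdpos hd)
    have hmin_nn : 0 ≤ min (I * (u - a) ^ (-(1 / 2 : ℝ))) (4 * π / (φs * (u - a))) :=
      le_min (mul_nonneg hI.le (Real.rpow_nonneg (by linarith) _)) (div_nonneg (by positivity) hdpos.le)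
    rw [hg]
    exact mul_le_mul (inv_anti₀ ha hau.le) hmin
      (le_min (mul_nonneg hI.le (Real.rpow_nonneg (by linarith) _))
        (div_nonneg (by positivity) (hdpos.le.trans hd))) (inv_nonneg.2 ha.le)
  have hfar : ∀ u, 2 * a ≤ u → u ≤ b →
      g u ≤ 8 * π / (κ * b ^ (3 / 8 : ℝ) * c₁) * u ^ (-(9 / 8 : ℝ)) := by
    intro u hu2 hub
    have hu : 0 < u := by linarith
    have h1 : g u ≤ u⁻¹ * (4 * π / (Φ u - Φ a)) := by
      rw [hg]; exact mul_le_mul_of_nonneg_left (min_le_right _ _) (inv_nonneg.2 hu.le)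
    exact h1.trans (far_pointwise_le hκ hb hc₁pos ha hu2 hub)
  -- integrability
  have hgc : ContinuousOn g (Ioc a b) := by rw [hg]; exact continuousOn_farKick hκ hb hc₁pos ha
  have hcross_int : IntervalIntegrable
      (fun u : ℝ => a⁻¹ * min (I * (u - a) ^ (-(1 / 2 : ℝ))) (4 * π / (φs * (u - a)))) volume a a₂ :=
    (intervalIntegrable_crossMin hI hφs_pos ha₂a.le).const_mul a⁻¹
  have hsq_int : IntervalIntegrable (fun u : ℝ => a⁻¹ * (I * (u - a) ^ (-(1 / 2 : ℝ)))) volume a a₂ := by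
    have h0 : IntervalIntegrable (fun x : ℝ => x ^ (-(1 / 2 : ℝ))) volume 0 (a₂ - a) :=
      intervalIntegral.intervalIntegrable_rpow' (by norm_num)
    have h1 := ((h0.comp_sub_right a).const_mul I).const_mul a⁻¹
    simp only [zero_add, sub_add_cancel] at h1
    exact h1
  have hg_int1 : IntervalIntegrable g volume a a₂ := by
    refine hsq_int.mono_fun' ?_ ?_
    · refine (hgc.mono ?_).aestronglyMeasurable measurableSet_uIoc
      rw [uIoc_of_le ha₂a.le]; exact fun u hu => ⟨hu.1, hu.2.trans ha₂b⟩
    · rw [uIoc_of_le ha₂a.le]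
      refine (ae_restrict_mem measurableSet_Ioc).mono fun u hu => ?_
      show ‖g u‖ ≤ a⁻¹ * (I * (u - a) ^ (-(1 / 2 : ℝ)))
      rw [Real.norm_of_nonneg (hgnn u hu.1 (hu.2.trans ha₂b))]
      exact (hnear u hu.1 hu.2).trans (mul_le_mul_of_nonneg_left (min_le_left _ _) (inv_nonneg.2 ha.le))
  have hg_int2 : IntervalIntegrable g volume a₂ b := by
    refine (hgc.mono ?_).intervalIntegrable
    rw [uIcc_of_le ha₂b]; exact fun u hu => ⟨ha₂a.trans_le hu.1, hu.2⟩
  -- NEAR RANGE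
  have hX : 0 < I ^ 2 / (16 * π ^ 2) := by positivity
  have hnear_int : ∫ u in a..a₂, g u ≤ 64 * π / κ * b ^ (-(3 / 8 : ℝ)) * a ^ (-(1 / 8 : ℝ)) := by
    have hmono : ∫ u in a..a₂, g u ≤
        ∫ u in a..a₂, a⁻¹ * min (I * (u - a) ^ (-(1 / 2 : ℝ))) (4 * π / (φs * (u - a))) :=
      intervalIntegral.integral_mono_on_of_le_Ioo ha₂a.le hg_int1 hcross_int fun u hu => hnear u hu.1 hu.2.le
    refine hmono.trans ?_
    rw [intervalIntegral.integral_const_mul, ← haℓ]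
    have hcross := crossover_integral_le hI hφs_pos ha hℓpos hℓa
    -- the logarithm: `2 + log⁺(a I² φ⋆²/(16π²)) ≤ 4Λ`
    have hy0 : 0 < a * (I ^ 2 * φs ^ 2 / (16 * π ^ 2)) := by positivity
    have hy : a * (I ^ 2 * φs ^ 2 / (16 * π ^ 2)) ≤ κ ^ 2 * (b / a) * Λ ^ 2 * (I ^ 2 / (16 * π ^ 2)) := by
      -- `a φ⋆² = κ² Λ² (b/a)^{3/4}/16 ≤ κ² Λ² (b/a)`
      have hs2 : (b ^ (3 / 8 : ℝ)) ^ 2 = b ^ (3 / 4 : ℝ) := by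
        rw [← Real.rpow_natCast, ← Real.rpow_mul hb.le]; norm_num
      have ht2 : (a ^ (-(7 / 8 : ℝ))) ^ 2 = a ^ (-(7 / 4 : ℝ)) := by
        rw [← Real.rpow_natCast, ← Real.rpow_mul ha.le]; norm_num
      have hat : a * a ^ (-(7 / 4 : ℝ)) = a ^ (-(3 / 4 : ℝ)) := by
        rw [show a * a ^ (-(7 / 4 : ℝ)) = a ^ (1 : ℝ) * a ^ (-(7 / 4 : ℝ)) by rw [Real.rpow_one],
          ← Real.rpow_add ha]; norm_num
      have hquot : b ^ (3 / 4 : ℝ) * a ^ (-(3 / 4 : ℝ)) = (b / a) ^ (3 / 4 : ℝ) := by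
        rw [Real.div_rpow hb.le ha.le, Real.rpow_neg ha.le]
        exact (div_eq_mul_inv _ _).symm
      have hle1 : (b / a) ^ (3 / 4 : ℝ) ≤ b / a := by
        have h1 : 1 ≤ b / a := by rw [le_div_iff₀ ha, one_mul]; exact hab.le
        calc (b / a) ^ (3 / 4 : ℝ) ≤ (b / a) ^ (1 : ℝ) := Real.rpow_le_rpow_of_exponent_le h1 (by norm_num)
          _ = b / a := Real.rpow_one _
      have hmain : a * φs ^ 2 ≤ κ ^ 2 * (b / a) * Λ ^ 2 := by
        have hexp : a * φs ^ 2 = κ ^ 2 * Λ ^ 2 * (b / a) ^ (3 / 4 : ℝ) / 16 := by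
          rw [hφs]
          calc a * (κ * b ^ (3 / 8 : ℝ) * a ^ (-(7 / 8 : ℝ)) * Λ / 4) ^ 2
              = κ ^ 2 * Λ ^ 2 * ((b ^ (3 / 8 : ℝ)) ^ 2 * (a * (a ^ (-(7 / 8 : ℝ))) ^ 2)) / 16 := by ring
            _ = κ ^ 2 * Λ ^ 2 * (b / a) ^ (3 / 4 : ℝ) / 16 := by rw [hs2, ht2, hat, hquot]
        rw [hexp]
        have hK : 0 ≤ κ ^ 2 * Λ ^ 2 := by positivity
        have hq : 0 ≤ (b / a) ^ (3 / 4 : ℝ) := Real.rpow_nonneg (div_pos hb ha).le _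
        nlinarith [mul_le_mul_of_nonneg_left hle1 hK]
      have := mul_le_mul_of_nonneg_right hmain hX.le
      calc a * (I ^ 2 * φs ^ 2 / (16 * π ^ 2)) = a * φs ^ 2 * (I ^ 2 / (16 * π ^ 2)) := by ring
        _ ≤ κ ^ 2 * (b / a) * Λ ^ 2 * (I ^ 2 / (16 * π ^ 2)) := this
    have hlogest : 2 + max 0 (Real.log (a * (I ^ 2 * φs ^ 2 / (16 * π ^ 2)))) ≤ 4 * Λ :=
      two_add_posLog_le hκ hX hΛ2 (by rw [le_div_iff₀ ha, one_mul]; exact hab.le)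
        (by rw [hΛ]; linarith) (by linarith) hy0 hy
    have h4φ : 0 ≤ 4 * π / φs := by positivity
    have hstep : a⁻¹ * ((4 * π / φs) * (2 + max 0 (Real.log (a * (I ^ 2 * φs ^ 2 / (16 * π ^ 2)))))) ≤
        a⁻¹ * ((4 * π / φs) * (4 * Λ)) :=
      mul_le_mul_of_nonneg_left (mul_le_mul_of_nonneg_left hlogest h4φ) (inv_nonneg.2 ha.le)
    refine (mul_le_mul_of_nonneg_left hcross (inv_nonneg.2 ha.le)).trans (hstep.trans (le_of_eq ?_))
    -- algebra: `a⁻¹ · (4π/φ⋆) · 4Λ = (64π/κ) b^{-3/8} a^{-1/8}`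
    have hb_neg : b ^ (-(3 / 8 : ℝ)) = (b ^ (3 / 8 : ℝ))⁻¹ := Real.rpow_neg hb.le _
    have ha_neg : a ^ (-(1 / 8 : ℝ)) = a⁻¹ * (a ^ (-(7 / 8 : ℝ)))⁻¹ := by
      rw [Real.rpow_neg ha.le (7 / 8 : ℝ), inv_inv, ← Real.rpow_neg_one, ← Real.rpow_add ha]; norm_num
    rw [hb_neg, ha_neg, hφs]
    field_simp
    ring
  -- FAR RANGE
  have hfar_int : ∫ u in a₂..b, g u ≤ 32 * π / κ * b ^ (-(3 / 8 : ℝ)) * a ^ (-(1 / 8 : ℝ)) := by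
    have hrhs_nn : 0 ≤ 32 * π / κ * b ^ (-(3 / 8 : ℝ)) * a ^ (-(1 / 8 : ℝ)) := by positivity
    rcases le_or_gt b (2 * a) with h2a | h2a
    · -- `a₂ = b`: empty far range
      have : a₂ = b := by rw [ha₂]; exact min_eq_right h2a
      rw [this, intervalIntegral.integral_same]; exact hrhs_nn
    · have ha₂eq : a₂ = 2 * a := by rw [ha₂]; exact min_eq_left h2a.le
      rw [ha₂eq]
      set K₉ : ℝ := 8 * π / (κ * b ^ (3 / 8 : ℝ) * c₁) with hK₉
      have hK₉nn : 0 ≤ K₉ := by rw [hK₉]; positivity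
      have hmaj_cont : ContinuousOn (fun u : ℝ => K₉ * u ^ (-(9 / 8 : ℝ))) (uIcc (2 * a) b) := by
        refine continuousOn_const.mul (ContinuousOn.rpow_const continuousOn_id fun u hu => Or.inl ?_)
        rw [uIcc_of_le h2a.le] at hu; exact (by linarith [hu.1] : (0 : ℝ) < u).ne'
      have hg_int2' : IntervalIntegrable g volume (2 * a) b := by rw [← ha₂eq]; exact hg_int2
      have hmono : ∫ u in (2 * a)..b, g u ≤ ∫ u in (2 * a)..b, K₉ * u ^ (-(9 / 8 : ℝ)) :=
        intervalIntegral.integral_mono_on h2a.le hg_int2' hmaj_cont.intervalIntegrable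
          fun u hu => hfar u hu.1 hu.2
      refine hmono.trans ?_
      rw [intervalIntegral.integral_const_mul,
        integral_rpow (Or.inr ⟨by norm_num, notMem_uIcc_of_lt (by linarith) hb⟩)]
      have hexp : (-(9 / 8 : ℝ)) + 1 = -(1 / 8 : ℝ) := by norm_num
      rw [hexp]
      -- `K₉ · (b^{-1/8} − (2a)^{-1/8})/(−1/8) = 8 K₉ ((2a)^{-1/8} − b^{-1/8}) ≤ 8 K₉ a^{-1/8}`
      have h2a_le : (2 * a) ^ (-(1 / 8 : ℝ)) ≤ a ^ (-(1 / 8 : ℝ)) :=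
        Real.rpow_le_rpow_of_nonpos ha (by linarith) (by norm_num)
      have hb_nn : 0 ≤ b ^ (-(1 / 8 : ℝ)) := Real.rpow_nonneg hb.le _
      have hval : K₉ * ((b ^ (-(1 / 8 : ℝ)) - (2 * a) ^ (-(1 / 8 : ℝ))) / -(1 / 8 : ℝ)) ≤ 8 * K₉ * a ^ (-(1 / 8 : ℝ)) := by
        have : K₉ * ((b ^ (-(1 / 8 : ℝ)) - (2 * a) ^ (-(1 / 8 : ℝ))) / -(1 / 8 : ℝ)) =
            8 * K₉ * ((2 * a) ^ (-(1 / 8 : ℝ)) - b ^ (-(1 / 8 : ℝ))) := by ring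
        rw [this]
        have h8K : 0 ≤ 8 * K₉ := by positivity
        exact mul_le_mul_of_nonneg_left (by linarith) h8K
      refine hval.trans ?_
      -- `8 K₉ a^{-1/8} = (64π/(κ c₁)) b^{-3/8} a^{-1/8} ≤ (32π/κ) b^{-3/8} a^{-1/8}`
      have hb_neg : b ^ (-(3 / 8 : ℝ)) = (b ^ (3 / 8 : ℝ))⁻¹ := Real.rpow_neg hb.le _
      have ha18 : 0 ≤ a ^ (-(1 / 8 : ℝ)) := Real.rpow_nonneg ha.le _
      have hcoef : 8 * K₉ ≤ 32 * π / κ * b ^ (-(3 / 8 : ℝ)) := by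
        rw [hK₉, hb_neg]
        rw [show 8 * (8 * π / (κ * b ^ (3 / 8 : ℝ) * c₁)) = (64 * π / (κ * b ^ (3 / 8 : ℝ))) * (1 / c₁) by
          field_simp; ring]
        rw [show 32 * π / κ * (b ^ (3 / 8 : ℝ))⁻¹ = (64 * π / (κ * b ^ (3 / 8 : ℝ))) * (1 / 2) by
          field_simp; ring]
        have hpos : 0 ≤ 64 * π / (κ * b ^ (3 / 8 : ℝ)) := by positivity
        exact mul_le_mul_of_nonneg_left (by rw [one_div_le_one_div hc₁pos (by norm_num)]; exact hc₁2) hpos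
      exact mul_le_mul_of_nonneg_right hcoef ha18
  -- SUM
  have hsplit : ∫ u in a..b, g u = (∫ u in a..a₂, g u) + ∫ u in a₂..b, g u :=
    (intervalIntegral.integral_add_adjacent_intervals hg_int1 hg_int2).symm
  show ∫ u in a..b, g u ≤ 96 * π / κ * b ^ (-(3 / 8 : ℝ)) * a ^ (-(1 / 8 : ℝ))
  rw [hsplit]
  calc (∫ u in a..a₂, g u) + ∫ u in a₂..b, g u
      ≤ 64 * π / κ * b ^ (-(3 / 8 : ℝ)) * a ^ (-(1 / 8 : ℝ)) + 32 * π / κ * b ^ (-(3 / 8 : ℝ)) * a ^ (-(1 / 8 : ℝ)) :=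
        add_le_add hnear_int hfar_int
    _ = 96 * π / κ * b ^ (-(3 / 8 : ℝ)) * a ^ (-(1 / 8 : ℝ)) := by ring

end RecessionLaw

/-! ### §1e  S3♭ ASSEMBLY (T4): the receding-ball real induction -/

section Assembly
open Real

/-- `Φ ≥ 0` on `(0, b]`. -/
theorem recessPhi_nonneg {κ b c₁ u : ℝ} (hκ : 0 ≤ κ) (hb : 0 < b) (hc₁ : 0 ≤ c₁) (hu : 0 < u) (hub : u ≤ b) :
    0 ≤ recessPhi κ b c₁ u := by
  have hlog : 0 ≤ Real.log (b / u) := Real.log_nonneg (by rw [le_div_iff₀ hu, one_mul]; exact hub)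
  unfold recessPhi
  have h1 : 0 ≤ b ^ (3 / 8 : ℝ) := Real.rpow_nonneg hb.le _
  have h2 : 0 ≤ u ^ (1 / 8 : ℝ) := Real.rpow_nonneg hu.le _
  have h3 : 0 ≤ c₁ + 8 + Real.log (b / u) := by linarith
  positivity

/-- `Φ` is monotone on `(0, b]`. -/
theorem recessPhi_le {κ b c₁ a v : ℝ} (hκ : 0 < κ) (hb : 0 < b) (hc₁ : 0 < c₁)
    (ha : 0 < a) (hav : a ≤ v) (hvb : v ≤ b) :
    recessPhi κ b c₁ a ≤ recessPhi κ b c₁ v := by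
  rcases eq_or_lt_of_le hav with h | h
  · rw [h]
  · exact (recessPhi_lt hκ hb hc₁ ha h hvb).le

/-- `exp(−X) ≤ 1/X` for `X > 0`. -/
theorem exp_neg_le_one_div {X : ℝ} (hX : 0 < X) : Real.exp (-X) ≤ 1 / X := by
  rw [Real.exp_neg, inv_eq_one_div]
  have h := Real.add_one_le_exp X
  exact one_div_le_one_div_of_le hX (by linarith)

/-- Nonnegativity of the far-kick integrand on `(a, b]`. -/
theorem farKick_nonneg {κ b c₁ a I u : ℝ} (hκ : 0 < κ) (hb : 0 < b) (hc₁ : 0 < c₁) (hI : 0 ≤ I) (ha : 0 < a)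
    (hau : a < u) (hub : u ≤ b) :
    0 ≤ u⁻¹ * min (I * (u - a) ^ (-(1 / 2 : ℝ))) (4 * π / (recessPhi κ b c₁ u - recessPhi κ b c₁ a)) := by
  have hu : 0 < u := ha.trans hau
  have hd : 0 < recessPhi κ b c₁ u - recessPhi κ b c₁ a := sub_pos.2 (recessPhi_lt hκ hb hc₁ ha hau hub)
  exact mul_nonneg (inv_nonneg.2 hu.le) (le_min (mul_nonneg hI (Real.rpow_nonneg (by linarith) _))
    (div_nonneg (by positivity) hd.le))

/-- Interval-integrability of the far-kick integrand on `[a, b]`. -/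
theorem intervalIntegrable_farKick {κ b c₁ a I : ℝ} (hκ : 0 < κ) (hI : 0 < I) (ha : 0 < a) (hab : a < b)
    (hc₁ : 2 ≤ c₁) :
    IntervalIntegrable (fun u : ℝ => u⁻¹ * min (I * (u - a) ^ (-(1 / 2 : ℝ)))
      (4 * π / (recessPhi κ b c₁ u - recessPhi κ b c₁ a))) volume a b := by
  have hb : 0 < b := ha.trans hab
  have hc₁pos : 0 < c₁ := by linarith
  set g : ℝ → ℝ := fun u => u⁻¹ * min (I * (u - a) ^ (-(1 / 2 : ℝ)))
      (4 * π / (recessPhi κ b c₁ u - recessPhi κ b c₁ a)) with hg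
  have hgc : ContinuousOn g (Ioc a b) := by rw [hg]; exact continuousOn_farKick hκ hb hc₁pos ha
  set a₂ : ℝ := min (2 * a) b with ha₂
  have ha₂a : a < a₂ := lt_min (by linarith) hab
  have ha₂b : a₂ ≤ b := min_le_right _ _
  have hsq_int : IntervalIntegrable (fun u : ℝ => a⁻¹ * (I * (u - a) ^ (-(1 / 2 : ℝ)))) volume a a₂ := by
    have h0 : IntervalIntegrable (fun x : ℝ => x ^ (-(1 / 2 : ℝ))) volume 0 (a₂ - a) :=
      intervalIntegral.intervalIntegrable_rpow' (by norm_num)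
    have h1 := ((h0.comp_sub_right a).const_mul I).const_mul a⁻¹
    simp only [zero_add, sub_add_cancel] at h1
    exact h1
  have hg_int1 : IntervalIntegrable g volume a a₂ := by
    refine hsq_int.mono_fun' ?_ ?_
    · refine (hgc.mono ?_).aestronglyMeasurable measurableSet_uIoc
      rw [uIoc_of_le ha₂a.le]; exact fun u hu => ⟨hu.1, hu.2.trans ha₂b⟩
    · rw [uIoc_of_le ha₂a.le]
      refine (ae_restrict_mem measurableSet_Ioc).mono fun u hu => ?_
      show ‖g u‖ ≤ a⁻¹ * (I * (u - a) ^ (-(1 / 2 : ℝ)))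
      have hub : u ≤ b := hu.2.trans ha₂b
      rw [Real.norm_of_nonneg (by rw [hg]; exact farKick_nonneg hκ hb hc₁pos hI.le ha hu.1 hub), hg]
      refine mul_le_mul (inv_anti₀ ha hu.1.le) (min_le_left _ _) ?_ (inv_nonneg.2 ha.le)
      have hd : 0 < recessPhi κ b c₁ u - recessPhi κ b c₁ a :=
        sub_pos.2 (recessPhi_lt hκ hb hc₁pos ha hu.1 hub)
      exact le_min (mul_nonneg hI.le (Real.rpow_nonneg (by linarith [hu.1]) _)) (div_nonneg (by positivity) hd.le)
  have hg_int2 : IntervalIntegrable g volume a₂ b := by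
    refine (hgc.mono ?_).intervalIntegrable
    rw [uIcc_of_le ha₂b]; exact fun u hu => ⟨ha₂a.trans_le hu.1, hu.2⟩
  exact hg_int1.trans hg_int2

set_option maxHeartbeats 4000000 in
/-- **T4 · KEY STEP of the receding-ball bootstrap.**  Fixed data: kernel constant `C`, a bound `I₁` for the
kernel mass integral, constants `M ≤ M₁`, `c₀`, `κ`, `c₁` tied by `128 C I₁ c₀ ≤ 1`, `C M₁² (96π/κ) ≤ c₀/2`,
`c₁ ≥ 2 + 2|log κ| + |log(I₁²/(16π²))|`; a base time `s < 0` with `Φ(−s) ≤ 1/8` and `2^{3/2}·512·M₁·(−s) ≤ c₀`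
(`Φ = recessPhi κ (−s) c₁`).  If `v` is Type-I ancient mild, `c₀/√(−s)`-quiet on `B(0,1)` at time `s`, and the
bound `‖v(t',y)‖ ≤ V(t') := 4c₀(−s)^{−3/8}(−t')^{−1/8}` holds on the receding balls `‖y‖ < 3/4 + Φ(−t')` for all
`t' ∈ (s, t)`, then it holds at every `t'' ∈ [t, t + η) ∩ (s, 0)` for some `η > 0` (heat part by T3, inside
sources by the hypothesis, outside Type-I sources by T2 + T1, the un-hypothesised strip `[t, t'')` crudely). -/
theorem keyStep {C : ℝ} (hC : 0 < C)
    (hK : ∀ {τ : ℝ}, 0 < τ → ∀ z a b : EuclideanSpace ℝ (Fin 3),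
      ‖oseenKernel τ z a b‖ ≤ C * (τ + ‖z‖ ^ 2) ^
        (-(((Module.finrank ℝ (EuclideanSpace ℝ (Fin 3)) : ℝ) + 1) / 2)) * ‖a‖ * ‖b‖)
    {I₁ : ℝ} (hI₁ : (∫ w : EuclideanSpace ℝ (Fin 3), (1 + ‖w‖ ^ 2) ^
          (-(((Module.finrank ℝ (EuclideanSpace ℝ (Fin 3)) : ℝ) + 1) / 2))) ≤ I₁) (hI₁pos : 0 < I₁)
    {M M₁ c₀ κ c₁ : ℝ} (hM₁ : 0 < M₁) (hMM₁ : M ≤ M₁) (hc₀ : 0 < c₀) (hc₀I : 128 * C * I₁ * c₀ ≤ 1)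
    (hκ : 0 < κ) (hκc : C * M₁ ^ 2 * (96 * π / κ) ≤ c₀ / 2)
    (hc₁ : 2 + 2 * |Real.log κ| + |Real.log (I₁ ^ 2 / (16 * π ^ 2))| ≤ c₁)
    {s : ℝ} (hs : s < 0) (hΦb : recessPhi κ (-s) c₁ (-s) ≤ 1 / 8)
    (hheat : (2 : ℝ) ^ (3 / 2 : ℝ) * 512 * M₁ * (-s) ≤ c₀)
    {v : ℝ → EuclideanSpace ℝ (Fin 3) → EuclideanSpace ℝ (Fin 3)} (hv : IsTypeIAncientMild M v)
    (hq : ∀ y ∈ Metric.ball (0 : EuclideanSpace ℝ (Fin 3)) 1, ‖v s y‖ ≤ c₀ / Real.sqrt (-s))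
    {t : ℝ} (hst : s ≤ t) (ht0 : t < 0)
    (hyp : ∀ t' ∈ Set.Ioo s t, ∀ y : EuclideanSpace ℝ (Fin 3), ‖y‖ < 3 / 4 + recessPhi κ (-s) c₁ (-t') →
      ‖v t' y‖ ≤ 4 * c₀ * (-s) ^ (-(3 / 8 : ℝ)) * (-t') ^ (-(1 / 8 : ℝ))) :
    ∃ η : ℝ, 0 < η ∧ ∀ t'' : ℝ, s < t'' → t ≤ t'' → t'' < t + η → t'' < 0 →
      ∀ x : EuclideanSpace ℝ (Fin 3), ‖x‖ < 3 / 4 + recessPhi κ (-s) c₁ (-t'') →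
        ‖v t'' x‖ ≤ 4 * c₀ * (-s) ^ (-(3 / 8 : ℝ)) * (-t'') ^ (-(1 / 8 : ℝ)) := by
  set I : ℝ := ∫ w : EuclideanSpace ℝ (Fin 3), (1 + ‖w‖ ^ 2) ^
      (-(((Module.finrank ℝ (EuclideanSpace ℝ (Fin 3)) : ℝ) + 1) / 2)) with hI_def
  have hI0 : 0 ≤ I := integral_nonneg fun w => Real.rpow_nonneg (by positivity) _
  set b : ℝ := -s with hb_def
  have hb : 0 < b := by rw [hb_def]; linarith
  set Φ : ℝ → ℝ := recessPhi κ b c₁ with hΦ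
  have hc₁2 : 2 ≤ c₁ := by
    have h1 := abs_nonneg (Real.log κ); have h2 := abs_nonneg (Real.log (I₁ ^ 2 / (16 * π ^ 2))); linarith
  have hc₁pos : 0 < c₁ := by linarith
  have hM0 : 0 ≤ M := hv.nonneg
  set at_ : ℝ := -t with hat_def
  have hat : 0 < at_ := by rw [hat_def]; linarith
  -- the slack length
  set ρη : ℝ := c₀ * b ^ (-(3 / 8 : ℝ)) * at_ ^ (7 / 8 : ℝ) / (8 * C * M₁ ^ 2 * I₁) with hρη
  have hρη_pos : 0 < ρη := by rw [hρη]; positivity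
  refine ⟨min (at_ / 2) (ρη ^ 2), lt_min (by linarith) (by positivity), ?_⟩
  intro t'' hst'' htt'' ht''η ht''0 x hx
  have hη1 : t'' < t + at_ / 2 := by linarith [min_le_left (at_ / 2) (ρη ^ 2)]
  have hη2 : t'' - t < ρη ^ 2 := by linarith [min_le_right (at_ / 2) (ρη ^ 2)]
  set a'' : ℝ := -t'' with ha''_def
  have ha'' : 0 < a'' := by rw [ha''_def]; linarith
  have ha''b : a'' < b := by rw [ha''_def, hb_def]; linarith
  have ha''at : a'' ≤ at_ := by rw [ha''_def, hat_def]; linarith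
  have ha''at2 : at_ / 2 < a'' := by rw [ha''_def]; linarith
  have hsqb : 0 < Real.sqrt b := Real.sqrt_pos.2 hb
  -- the basic rpow facts for the target
  have hb38 : 0 < b ^ (-(3 / 8 : ℝ)) := Real.rpow_pos_of_pos hb _
  have ha18 : 0 < a'' ^ (-(1 / 8 : ℝ)) := Real.rpow_pos_of_pos ha'' _
  have hVpos : 0 < 4 * c₀ * b ^ (-(3 / 8 : ℝ)) * a'' ^ (-(1 / 8 : ℝ)) := by positivity
  have hbinv : 1 / Real.sqrt b ≤ b ^ (-(3 / 8 : ℝ)) * a'' ^ (-(1 / 8 : ℝ)) := by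
    have h1 : 1 / Real.sqrt b = b ^ (-(3 / 8 : ℝ)) * b ^ (-(1 / 8 : ℝ)) := by
      rw [← Real.rpow_add hb, show (-(3 / 8 : ℝ)) + -(1 / 8 : ℝ) = -(1 / 2 : ℝ) by norm_num,
        Real.rpow_neg hb.le, Real.sqrt_eq_rpow, inv_eq_one_div]
    rw [h1]
    exact mul_le_mul_of_nonneg_left (Real.rpow_le_rpow_of_nonpos ha'' ha''b.le (by norm_num)) hb38.le
  -- ### the representation from time `s`
  have hrep := hv.2.2.1 s t'' hst'' ht''0 x
  have hT0 : 0 < t'' - s := by linarith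
  have hTb : t'' - s ≤ b := by rw [hb_def]; linarith
  -- ### HEAT PART (T3 with δ = 1/8)
  have hΦmono : Φ a'' ≤ Φ b := by rw [hΦ]; exact recessPhi_le hκ hb hc₁pos ha'' ha''b.le le_rfl
  have hΦb' : Φ b ≤ 1 / 8 := by rw [hΦ, hb_def]; exact hΦb
  have hxn : ‖x‖ < 3 / 4 + Φ a'' := by rw [hΦ, ha''_def, hb_def]; exact hx
  have hheat_le : ‖heatFlow (v s) (t'' - s) x‖ ≤ 2 * c₀ / Real.sqrt b := by
    rw [heatFlow_of_pos _ hT0]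
    have hin : ∀ z : EuclideanSpace ℝ (Fin 3), ‖z - x‖ < 1 / 8 → ‖v s z‖ ≤ c₀ / Real.sqrt b := by
      intro z hz
      have hz1 : ‖z‖ < 1 := by
        have := norm_le_norm_add_norm_sub' z x
        have h2 : ‖z‖ ≤ ‖x‖ + ‖z - x‖ := by
          calc ‖z‖ = ‖x + (z - x)‖ := by rw [add_sub_cancel]
            _ ≤ ‖x‖ + ‖z - x‖ := norm_add_le _ _
        linarith
      have := hq z (mem_ball_zero_iff.2 hz1)
      rwa [hb_def]
    have hout : ∀ z : EuclideanSpace ℝ (Fin 3), ‖v s z‖ ≤ M₁ / Real.sqrt b := by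
      intro z
      refine (hv.norm_le hs z).trans ?_
      rw [← hb_def]
      exact div_le_div_of_nonneg_right hMM₁ hsqb.le
    have hT3 := norm_heatExtension_two_region (f := v s) (by positivity) (by positivity)
      (by norm_num : (0 : ℝ) ≤ 1 / 8) hT0 hin hout
    refine hT3.trans ?_
    -- the Gaussian tail: `exp(−(1/8)²/(8σ)) ≤ 512 σ ≤ 512 b`
    have hexp : Real.exp (-((1 / 8 : ℝ) ^ 2 / (8 * (t'' - s)))) ≤ 512 * b := by
      have hX : 0 < (1 / 8 : ℝ) ^ 2 / (8 * (t'' - s)) := by positivity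
      refine (exp_neg_le_one_div hX).trans ?_
      rw [one_div_div]
      have : 8 * (t'' - s) / (1 / 8 : ℝ) ^ 2 = 512 * (t'' - s) := by norm_num; ring
      rw [this]; linarith
    have htail : (2 : ℝ) ^ (3 / 2 : ℝ) * (M₁ / Real.sqrt b) * Real.exp (-((1 / 8 : ℝ) ^ 2 / (8 * (t'' - s)))) ≤
        c₀ / Real.sqrt b := by
      have h1 : (2 : ℝ) ^ (3 / 2 : ℝ) * (M₁ / Real.sqrt b) * Real.exp (-((1 / 8 : ℝ) ^ 2 / (8 * (t'' - s)))) ≤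
          (2 : ℝ) ^ (3 / 2 : ℝ) * (M₁ / Real.sqrt b) * (512 * b) :=
        mul_le_mul_of_nonneg_left hexp (by positivity)
      refine h1.trans ?_
      rw [show (2 : ℝ) ^ (3 / 2 : ℝ) * (M₁ / Real.sqrt b) * (512 * b) =
        ((2 : ℝ) ^ (3 / 2 : ℝ) * 512 * M₁ * b) / Real.sqrt b by ring]
      exact div_le_div_of_nonneg_right (by rw [hb_def]; exact hheat) hsqb.le
    calc c₀ / Real.sqrt b + (2 : ℝ) ^ (3 / 2 : ℝ) * (M₁ / Real.sqrt b) *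
          Real.exp (-((1 / 8 : ℝ) ^ 2 / (8 * (t'' - s))))
        ≤ c₀ / Real.sqrt b + c₀ / Real.sqrt b := by linarith [htail]
      _ = 2 * c₀ / Real.sqrt b := by ring
  -- ### DUHAMEL PART: the majorant
  set K₁ : ℝ := 16 * C * I₁ * c₀ ^ 2 * b ^ (-(3 / 4 : ℝ)) with hK₁
  set g : ℝ → ℝ := fun u => u⁻¹ * min (I₁ * (u - a'') ^ (-(1 / 2 : ℝ))) (4 * π / (Φ u - Φ a'')) with hg
  set K₃ : ℝ := 4 * C * M₁ ^ 2 * I₁ / at_ with hK₃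
  have hK₁0 : 0 ≤ K₁ := by rw [hK₁]; positivity
  have hK₃0 : 0 ≤ K₃ := by rw [hK₃]; positivity
  set m : ℝ → ℝ := fun τ => K₁ * (t'' - τ) ^ (-(3 / 4 : ℝ)) + C * M₁ ^ 2 * g (-τ) +
    (Ioi t).indicator (fun τ => K₃ * (t'' - τ) ^ (-(1 / 2 : ℝ))) τ with hm
  -- integrability of the three pieces on `Ioo s t''`
  have hk34 : IntegrableOn (fun τ : ℝ => (t'' - τ) ^ (-(3 / 4 : ℝ))) (Ioo s t'') :=
    integrableOn_sub_rpow_Ioo (by norm_num)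
  have hk12 : IntegrableOn (fun τ : ℝ => (t'' - τ) ^ (-(1 / 2 : ℝ))) (Ioo s t'') :=
    integrableOn_sub_rpow_Ioo (by norm_num)
  have hgII : IntervalIntegrable g volume a'' b := by
    rw [hg]; exact intervalIntegrable_farKick hκ hI₁pos ha'' ha''b hc₁2
  have hg_neg : IntegrableOn (fun τ : ℝ => g (-τ)) (Ioo s t'') := by
    have h1 := hgII.comp_sub_left 0
    simp only [zero_sub] at h1
    -- `h1 : IntervalIntegrable (fun x => g (-x)) volume (-a'') (-b)`
    have h2 := h1.symm
    rw [show -b = s by rw [hb_def, neg_neg], show -a'' = t'' by rw [ha''_def, neg_neg],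
      intervalIntegrable_iff_integrableOn_Ioc_of_le hst''.le] at h2
    exact h2.mono_set Ioo_subset_Ioc_self
  have hm3 : IntegrableOn (fun τ : ℝ => (Ioi t).indicator (fun τ => K₃ * (t'' - τ) ^ (-(1 / 2 : ℝ))) τ)
      (Ioo s t'') := (hk12.const_mul K₃).indicator measurableSet_Ioi
  have hmi : IntegrableOn m (Ioo s t'') := by
    rw [hm]; exact ((hk34.const_mul K₁).add (hg_neg.const_mul _)).add hm3
  -- ### the pointwise slice bound, a.e. on `Ioo s t''` (off `τ = t`)
  have hne_t : ∀ᵐ τ : ℝ ∂(volume.restrict (Ioo s t'')), τ ≠ t := by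
    have h : ∀ᵐ τ : ℝ ∂volume, τ ≠ t := by
      have : ({t}ᶜ : Set ℝ) ∈ ae (volume : Measure ℝ) := compl_mem_ae_iff.2 (measure_singleton t)
      filter_upwards [this] with τ hτ
      simpa using hτ
    exact ae_restrict_of_ae h
  have hptw : ∀ᵐ τ : ℝ ∂(volume.restrict (Ioo s t'')), ‖oseenSlice (t'' - τ) (v τ) (v τ) x‖ ≤ m τ := by
    filter_upwards [ae_restrict_mem measurableSet_Ioo, hne_t] with τ hτ hτne
    have hτ0 : τ < 0 := hτ.2.trans ht''0
    have hu : 0 < -τ := by linarith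
    have hσ : 0 < t'' - τ := by linarith [hτ.2]
    have hσu : t'' - τ ≤ -τ := by linarith
    -- Type-I everywhere at time `τ`
    set Mf : ℝ := M₁ / Real.sqrt (-τ) with hMf
    have hsqτ : 0 < Real.sqrt (-τ) := Real.sqrt_pos.2 hu
    have hfar : ∀ y : EuclideanSpace ℝ (Fin 3), ‖v τ y‖ ≤ Mf := fun y =>
      (hv.norm_le hτ0 y).trans (div_le_div_of_nonneg_right hMM₁ hsqτ.le)
    have hMf0 : 0 ≤ Mf := by rw [hMf]; positivity
    have hMf2 : Mf ^ 2 = M₁ ^ 2 / (-τ) := by rw [hMf, div_pow, Real.sq_sqrt hu.le]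
    -- the three majorant pieces are nonnegative
    have hm1nn : 0 ≤ K₁ * (t'' - τ) ^ (-(3 / 4 : ℝ)) := mul_nonneg hK₁0 (Real.rpow_nonneg hσ.le _)
    have hgnn : 0 ≤ g (-τ) := by
      rw [hg]
      have := farKick_nonneg (I := I₁) (u := -τ) hκ hb hc₁pos hI₁pos.le ha''
        (by rw [ha''_def]; linarith [hτ.2]) (by rw [hb_def]; linarith [hτ.1])
      simpa only [sub_neg_eq_add] using this
    have hm2nn : 0 ≤ C * M₁ ^ 2 * g (-τ) := mul_nonneg (by positivity) hgnn
    have hm3nn : 0 ≤ (Ioi t).indicator (fun τ => K₃ * (t'' - τ) ^ (-(1 / 2 : ℝ))) τ := by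
      by_cases h : τ ∈ Ioi t
      · rw [indicator_of_mem h]; exact mul_nonneg hK₃0 (Real.rpow_nonneg hσ.le _)
      · rw [indicator_of_notMem h]
    -- monotonicity in the kernel-mass constant
    have hIσ : I * (t'' - τ) ^ (-(1 / 2 : ℝ)) ≤ I₁ * (t'' - τ) ^ (-(1 / 2 : ℝ)) :=
      mul_le_mul_of_nonneg_right hI₁ (Real.rpow_nonneg hσ.le _)
    rcases lt_or_gt_of_ne hτne with hτt | hτt
    · -- CASE τ < t: inside by the hypothesis, outside by Type-I (T2), then T1's integrand
      set ρ : ℝ := 3 / 4 + Φ (-τ) with hρ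
      set d : ℝ := Φ (-τ) - Φ a'' with hd
      have hdpos : 0 < d := by
        rw [hd, hΦ]; exact sub_pos.2 (recessPhi_lt hκ hb hc₁pos ha'' (by rw [ha''_def]; linarith [hτ.2])
          (by rw [hb_def]; linarith [hτ.1]))
      set P : ℝ := (4 * c₀ * b ^ (-(3 / 8 : ℝ)) * (-τ) ^ (-(1 / 8 : ℝ))) ^ 2 with hP
      have hP0 : 0 ≤ P := by rw [hP]; positivity
      have hin : ∀ y : EuclideanSpace ℝ (Fin 3), ‖y‖ < ρ → ‖v τ y‖ ^ 2 ≤ P := by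
        intro y hy
        have h := hyp τ ⟨hτ.1, hτt⟩ y (by rw [hρ] at hy; exact hy)
        rw [hP]
        exact pow_le_pow_left₀ (norm_nonneg _) h 2
      have hxρ : ‖x‖ ≤ ρ - d := by rw [hρ, hd]; linarith
      have hT2 := norm_oseenSlice_receding hC hK hσ hP0 hdpos (ρ := ρ) (Mf := Mf) hin
        (fun y _ => hfar y) hxρ
      -- term 1: `C P I σ^{-1/2} ≤ K₁ σ^{-3/4}`
      have hP_eq : P = 16 * c₀ ^ 2 * b ^ (-(3 / 4 : ℝ)) * (-τ) ^ (-(1 / 4 : ℝ)) := by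
        rw [hP, mul_pow, mul_pow, mul_pow, ← Real.rpow_mul_natCast hb.le, ← Real.rpow_mul_natCast hu.le]
        norm_num
      have h1 : C * P * I * (t'' - τ) ^ (-(1 / 2 : ℝ)) ≤ K₁ * (t'' - τ) ^ (-(3 / 4 : ℝ)) := by
        have hq14 : (-τ) ^ (-(1 / 4 : ℝ)) ≤ (t'' - τ) ^ (-(1 / 4 : ℝ)) :=
          Real.rpow_le_rpow_of_nonpos hσ hσu (by norm_num)
        have hσ34 : (t'' - τ) ^ (-(1 / 4 : ℝ)) * (t'' - τ) ^ (-(1 / 2 : ℝ)) = (t'' - τ) ^ (-(3 / 4 : ℝ)) := by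
          rw [← Real.rpow_add hσ]; norm_num
        have hCPI : C * P * I * (t'' - τ) ^ (-(1 / 2 : ℝ)) ≤ C * P * (I₁ * (t'' - τ) ^ (-(1 / 2 : ℝ))) := by
          rw [mul_assoc (C * P)]; exact mul_le_mul_of_nonneg_left hIσ (by positivity)
        refine hCPI.trans ?_
        rw [hP_eq, hK₁]
        have hrest : 0 ≤ C * (16 * c₀ ^ 2 * b ^ (-(3 / 4 : ℝ))) * I₁ * (t'' - τ) ^ (-(1 / 2 : ℝ)) := by positivity
        calc C * (16 * c₀ ^ 2 * b ^ (-(3 / 4 : ℝ)) * (-τ) ^ (-(1 / 4 : ℝ))) * (I₁ * (t'' - τ) ^ (-(1 / 2 : ℝ)))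
            = (C * (16 * c₀ ^ 2 * b ^ (-(3 / 4 : ℝ))) * I₁ * (t'' - τ) ^ (-(1 / 2 : ℝ))) * (-τ) ^ (-(1 / 4 : ℝ)) := by
              ring
          _ ≤ (C * (16 * c₀ ^ 2 * b ^ (-(3 / 4 : ℝ))) * I₁ * (t'' - τ) ^ (-(1 / 2 : ℝ))) * (t'' - τ) ^ (-(1 / 4 : ℝ)) :=
              mul_le_mul_of_nonneg_left hq14 hrest
          _ = 16 * C * I₁ * c₀ ^ 2 * b ^ (-(3 / 4 : ℝ)) * ((t'' - τ) ^ (-(1 / 4 : ℝ)) * (t'' - τ) ^ (-(1 / 2 : ℝ))) := by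
              ring
          _ = 16 * C * I₁ * c₀ ^ 2 * b ^ (-(3 / 4 : ℝ)) * (t'' - τ) ^ (-(3 / 4 : ℝ)) := by rw [hσ34]
      -- term 2: `C Mf² min(I σ^{-1/2}, 4π/d) ≤ C M₁² g(−τ)`
      have h2 : C * Mf ^ 2 * min (I * (t'' - τ) ^ (-(1 / 2 : ℝ))) (4 * π / d) ≤ C * M₁ ^ 2 * g (-τ) := by
        have hmin : min (I * (t'' - τ) ^ (-(1 / 2 : ℝ))) (4 * π / d) ≤
            min (I₁ * (-τ - a'') ^ (-(1 / 2 : ℝ))) (4 * π / (Φ (-τ) - Φ a'')) := by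
          have hσeq : -τ - a'' = t'' - τ := by rw [ha''_def]; ring
          rw [hσeq, ← hd]
          exact min_le_min_right _ hIσ
        have hmin0 : 0 ≤ min (I * (t'' - τ) ^ (-(1 / 2 : ℝ))) (4 * π / d) :=
          le_min (mul_nonneg hI0 (Real.rpow_nonneg hσ.le _)) (div_nonneg (by positivity) hdpos.le)
        rw [hg, hMf2]
        calc C * (M₁ ^ 2 / -τ) * min (I * (t'' - τ) ^ (-(1 / 2 : ℝ))) (4 * π / d)
            = C * M₁ ^ 2 * ((-τ)⁻¹ * min (I * (t'' - τ) ^ (-(1 / 2 : ℝ))) (4 * π / d)) := by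
              rw [div_eq_mul_inv]; ring
          _ ≤ C * M₁ ^ 2 * ((-τ)⁻¹ * min (I₁ * (-τ - a'') ^ (-(1 / 2 : ℝ))) (4 * π / (Φ (-τ) - Φ a''))) :=
              mul_le_mul_of_nonneg_left (mul_le_mul_of_nonneg_left hmin (inv_nonneg.2 hu.le)) (by positivity)
      rw [hm]
      show ‖oseenSlice (t'' - τ) (v τ) (v τ) x‖ ≤ K₁ * (t'' - τ) ^ (-(3 / 4 : ℝ)) + C * M₁ ^ 2 * g (-τ) +
        (Ioi t).indicator (fun τ => K₃ * (t'' - τ) ^ (-(1 / 2 : ℝ))) τ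
      linarith [hT2, h1, h2, hm3nn]
    · -- CASE t < τ: the crude whole-space bound `2 C Mf² I₁ σ^{-1/2} ≤ K₃ σ^{-1/2}`
      have hin : ∀ y : EuclideanSpace ℝ (Fin 3), ‖y‖ < ‖x‖ + 1 → ‖v τ y‖ ^ 2 ≤ Mf ^ 2 := fun y _ =>
        pow_le_pow_left₀ (norm_nonneg _) (hfar y) 2
      have hT2 := norm_oseenSlice_receding hC hK hσ (sq_nonneg Mf) one_pos (ρ := ‖x‖ + 1) (Mf := Mf) hin
        (fun y _ => hfar y) (by linarith : ‖x‖ ≤ ‖x‖ + 1 - 1)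
      have hmin : min (I * (t'' - τ) ^ (-(1 / 2 : ℝ))) (4 * π / 1) ≤ I₁ * (t'' - τ) ^ (-(1 / 2 : ℝ)) :=
        (min_le_left _ _).trans hIσ
      have hCMI : C * Mf ^ 2 * I * (t'' - τ) ^ (-(1 / 2 : ℝ)) ≤ C * Mf ^ 2 * (I₁ * (t'' - τ) ^ (-(1 / 2 : ℝ))) := by
        rw [mul_assoc (C * Mf ^ 2)]; exact mul_le_mul_of_nonneg_left hIσ (by positivity)
      have hslice : ‖oseenSlice (t'' - τ) (v τ) (v τ) x‖ ≤ 2 * C * Mf ^ 2 * (I₁ * (t'' - τ) ^ (-(1 / 2 : ℝ))) := by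
        have h2 : C * Mf ^ 2 * min (I * (t'' - τ) ^ (-(1 / 2 : ℝ))) (4 * π / 1) ≤
            C * Mf ^ 2 * (I₁ * (t'' - τ) ^ (-(1 / 2 : ℝ))) := mul_le_mul_of_nonneg_left hmin (by positivity)
        linarith [hT2, hCMI, h2]
      -- `Mf² = M₁²/(−τ) ≤ 2 M₁²/a_t`
      have hMf_le : Mf ^ 2 ≤ M₁ ^ 2 * (2 / at_) := by
        rw [hMf2, div_eq_mul_inv]
        refine mul_le_mul_of_nonneg_left ?_ (sq_nonneg _)
        rw [inv_eq_one_div, div_le_div_iff₀ hu hat]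
        have : at_ / 2 < -τ := by linarith [hτ.2]
        linarith
      have hind : (Ioi t).indicator (fun τ => K₃ * (t'' - τ) ^ (-(1 / 2 : ℝ))) τ = K₃ * (t'' - τ) ^ (-(1 / 2 : ℝ)) :=
        indicator_of_mem (mem_Ioi.2 hτt) _
      rw [hm]
      show ‖oseenSlice (t'' - τ) (v τ) (v τ) x‖ ≤ K₁ * (t'' - τ) ^ (-(3 / 4 : ℝ)) + C * M₁ ^ 2 * g (-τ) +
        (Ioi t).indicator (fun τ => K₃ * (t'' - τ) ^ (-(1 / 2 : ℝ))) τ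
      rw [hind]
      have h3 : 2 * C * Mf ^ 2 * (I₁ * (t'' - τ) ^ (-(1 / 2 : ℝ))) ≤ K₃ * (t'' - τ) ^ (-(1 / 2 : ℝ)) := by
        have hA : 0 ≤ 2 * C * (I₁ * (t'' - τ) ^ (-(1 / 2 : ℝ))) := by positivity
        calc 2 * C * Mf ^ 2 * (I₁ * (t'' - τ) ^ (-(1 / 2 : ℝ)))
            = (2 * C * (I₁ * (t'' - τ) ^ (-(1 / 2 : ℝ)))) * Mf ^ 2 := by ring
          _ ≤ (2 * C * (I₁ * (t'' - τ) ^ (-(1 / 2 : ℝ)))) * (M₁ ^ 2 * (2 / at_)) :=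
              mul_le_mul_of_nonneg_left hMf_le hA
          _ = K₃ * (t'' - τ) ^ (-(1 / 2 : ℝ)) := by rw [hK₃]; field_simp; ring
      linarith [hslice, h3, hm1nn, hm2nn]
  -- ### the three integrals
  have hInt1 : ∫ τ in Ioo s t'', K₁ * (t'' - τ) ^ (-(3 / 4 : ℝ)) ≤ c₀ / 2 * (1 / Real.sqrt b) := by
    rw [integral_const_mul, setIntegral_Ioo_sub_rpow_neg_three_quarters hst''.le]
    have hq14 : (t'' - s) ^ (1 / 4 : ℝ) ≤ b ^ (1 / 4 : ℝ) := Real.rpow_le_rpow hT0.le hTb (by norm_num)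
    have hbb : b ^ (-(3 / 4 : ℝ)) * b ^ (1 / 4 : ℝ) = 1 / Real.sqrt b := by
      rw [← Real.rpow_add hb, show (-(3 / 4 : ℝ)) + 1 / 4 = -(1 / 2 : ℝ) by norm_num, Real.rpow_neg hb.le,
        Real.sqrt_eq_rpow, inv_eq_one_div]
    have hb34 : 0 ≤ b ^ (-(3 / 4 : ℝ)) := Real.rpow_nonneg hb.le _
    calc K₁ * (4 * (t'' - s) ^ (1 / 4 : ℝ)) = 64 * C * I₁ * c₀ ^ 2 * (b ^ (-(3 / 4 : ℝ)) * (t'' - s) ^ (1 / 4 : ℝ)) := by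
          rw [hK₁]; ring
      _ ≤ 64 * C * I₁ * c₀ ^ 2 * (b ^ (-(3 / 4 : ℝ)) * b ^ (1 / 4 : ℝ)) := by gcongr
      _ = (128 * C * I₁ * c₀) * (c₀ / 2) * (1 / Real.sqrt b) := by rw [hbb]; ring
      _ ≤ 1 * (c₀ / 2) * (1 / Real.sqrt b) := by gcongr
      _ = c₀ / 2 * (1 / Real.sqrt b) := by ring
  have hInt2 : ∫ τ in Ioo s t'', C * M₁ ^ 2 * g (-τ) ≤ c₀ / 2 * (b ^ (-(3 / 8 : ℝ)) * a'' ^ (-(1 / 8 : ℝ))) := by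
    rw [integral_const_mul]
    have hsub : ∫ τ in Ioo s t'', g (-τ) = ∫ u in a''..b, g u := by
      rw [← integral_Ioc_eq_integral_Ioo, ← intervalIntegral.integral_of_le hst''.le,
        intervalIntegral.integral_comp_neg, show -t'' = a'' by rw [ha''_def], show -s = b by rw [hb_def]]
    rw [hsub]
    have hT1 : ∫ u in a''..b, g u ≤ 96 * π / κ * b ^ (-(3 / 8 : ℝ)) * a'' ^ (-(1 / 8 : ℝ)) := by
      rw [hg, hΦ]; exact farKick_integral_le hκ hI₁pos ha'' ha''b hc₁
    calc C * M₁ ^ 2 * ∫ u in a''..b, g u ≤ C * M₁ ^ 2 * (96 * π / κ * b ^ (-(3 / 8 : ℝ)) * a'' ^ (-(1 / 8 : ℝ))) :=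
          mul_le_mul_of_nonneg_left hT1 (by positivity)
      _ = (C * M₁ ^ 2 * (96 * π / κ)) * (b ^ (-(3 / 8 : ℝ)) * a'' ^ (-(1 / 8 : ℝ))) := by ring
      _ ≤ c₀ / 2 * (b ^ (-(3 / 8 : ℝ)) * a'' ^ (-(1 / 8 : ℝ))) :=
          mul_le_mul_of_nonneg_right hκc (by positivity)
  have hInt3 : ∫ τ in Ioo s t'', (Ioi t).indicator (fun τ => K₃ * (t'' - τ) ^ (-(1 / 2 : ℝ))) τ ≤
      c₀ * (b ^ (-(3 / 8 : ℝ)) * a'' ^ (-(1 / 8 : ℝ))) := by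
    rw [integral_indicator measurableSet_Ioi, Measure.restrict_restrict measurableSet_Ioi,
      show Ioi t ∩ Ioo s t'' = Ioo t t'' from Set.ext fun τ =>
        ⟨fun h => ⟨h.1, h.2.2⟩, fun h => ⟨h.1, lt_of_le_of_lt hst h.1, h.2⟩⟩,
      integral_const_mul, setIntegral_Ioo_sub_rpow_neg_half htt'']
    -- `K₃ · 2 (t''−t)^{1/2} ≤ K₃ · 2 ρη = c₀ b^{-3/8} a_t^{-1/8} ≤ c₀ b^{-3/8} a''^{-1/8}`
    have hroot : (t'' - t) ^ (1 / 2 : ℝ) ≤ ρη := by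
      have h1 : (t'' - t) ^ (1 / 2 : ℝ) ≤ (ρη ^ 2) ^ (1 / 2 : ℝ) :=
        Real.rpow_le_rpow (by linarith) hη2.le (by norm_num)
      have h2 : (ρη ^ 2) ^ (1 / 2 : ℝ) = ρη := by rw [← Real.sqrt_eq_rpow, Real.sqrt_sq hρη_pos.le]
      rw [h2] at h1
      exact h1
    have hat18 : at_ ^ (-(1 / 8 : ℝ)) ≤ a'' ^ (-(1 / 8 : ℝ)) :=
      Real.rpow_le_rpow_of_nonpos ha'' ha''at (by norm_num)
    have hat_split : at_ ^ (7 / 8 : ℝ) / at_ = at_ ^ (-(1 / 8 : ℝ)) := by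
      rw [div_eq_mul_inv, ← Real.rpow_neg_one, ← Real.rpow_add hat]; norm_num
    calc K₃ * (2 * (t'' - t) ^ (1 / 2 : ℝ)) ≤ K₃ * (2 * ρη) := by gcongr
      _ = c₀ * b ^ (-(3 / 8 : ℝ)) * (at_ ^ (7 / 8 : ℝ) / at_) := by
          rw [hK₃, hρη]; field_simp; ring
      _ = c₀ * (b ^ (-(3 / 8 : ℝ)) * at_ ^ (-(1 / 8 : ℝ))) := by rw [hat_split]; ring
      _ ≤ c₀ * (b ^ (-(3 / 8 : ℝ)) * a'' ^ (-(1 / 8 : ℝ))) := by gcongr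
  have hDuh : ‖oseenDuhamel 1 s v v t'' x‖ ≤ c₀ / 2 * (1 / Real.sqrt b) +
      c₀ / 2 * (b ^ (-(3 / 8 : ℝ)) * a'' ^ (-(1 / 8 : ℝ))) + c₀ * (b ^ (-(3 / 8 : ℝ)) * a'' ^ (-(1 / 8 : ℝ))) := by
    rw [oseenDuhamel_one_eq_setIntegral_oseenSlice]
    refine (norm_integral_le_of_norm_le hmi hptw).trans ?_
    have e1 : ∫ τ in Ioo s t'', m τ = (∫ τ in Ioo s t'', (K₁ * (t'' - τ) ^ (-(3 / 4 : ℝ)) + C * M₁ ^ 2 * g (-τ))) +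
        ∫ τ in Ioo s t'', (Ioi t).indicator (fun τ => K₃ * (t'' - τ) ^ (-(1 / 2 : ℝ))) τ := by
      rw [hm]; exact integral_add ((hk34.const_mul K₁).add (hg_neg.const_mul _)) hm3
    have e2 : ∫ τ in Ioo s t'', (K₁ * (t'' - τ) ^ (-(3 / 4 : ℝ)) + C * M₁ ^ 2 * g (-τ)) =
        (∫ τ in Ioo s t'', K₁ * (t'' - τ) ^ (-(3 / 4 : ℝ))) + ∫ τ in Ioo s t'', C * M₁ ^ 2 * g (-τ) :=
      integral_add (hk34.const_mul K₁) (hg_neg.const_mul _)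
    rw [e1, e2]
    linarith [hInt1, hInt2, hInt3]
  -- ### total
  rw [hrep]
  have hgoal : 4 * c₀ * (-s) ^ (-(3 / 8 : ℝ)) * (-t'') ^ (-(1 / 8 : ℝ)) =
      4 * c₀ * (b ^ (-(3 / 8 : ℝ)) * a'' ^ (-(1 / 8 : ℝ))) := by rw [hb_def, ha''_def]; ring
  rw [hgoal]
  have hW : 0 ≤ b ^ (-(3 / 8 : ℝ)) * a'' ^ (-(1 / 8 : ℝ)) := by positivity
  calc ‖heatFlow (v s) (t'' - s) x - oseenDuhamel 1 s v v t'' x‖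
      ≤ ‖heatFlow (v s) (t'' - s) x‖ + ‖oseenDuhamel 1 s v v t'' x‖ := norm_sub_le _ _
    _ ≤ 2 * c₀ / Real.sqrt b + (c₀ / 2 * (1 / Real.sqrt b) +
          c₀ / 2 * (b ^ (-(3 / 8 : ℝ)) * a'' ^ (-(1 / 8 : ℝ))) + c₀ * (b ^ (-(3 / 8 : ℝ)) * a'' ^ (-(1 / 8 : ℝ)))) :=
        add_le_add hheat_le hDuh
    _ = (5 / 2 * c₀) * (1 / Real.sqrt b) + (3 / 2 * c₀) * (b ^ (-(3 / 8 : ℝ)) * a'' ^ (-(1 / 8 : ℝ))) := by ring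
    _ ≤ (5 / 2 * c₀) * (b ^ (-(3 / 8 : ℝ)) * a'' ^ (-(1 / 8 : ℝ))) +
          (3 / 2 * c₀) * (b ^ (-(3 / 8 : ℝ)) * a'' ^ (-(1 / 8 : ℝ))) := by
        gcongr
    _ = 4 * c₀ * (b ^ (-(3 / 8 : ℝ)) * a'' ^ (-(1 / 8 : ℝ))) := by ring

set_option maxHeartbeats 2000000 in
/-- **T4 · S3♭ PROVED: the subcritical upgrade `SubcriticalUpgrade M` for every `M`** (receding-ball real induction).
Constants (chosen before the field): `C` the Oseen-kernel constant, `I₁ = I + 1` (kernel mass), `M₁ = |M| + 1`,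
`c₀ = 1/(128 C I₁ + 1)`, `κ = 192π C M₁²/c₀`, `c₁ = 2 + 2|log κ| + |log(I₁²/(16π²))|`,
`b₁ = min (1/(64κ(c₁+8)))² (c₀/(2048 M₁))`, `s₁ = −b₁`.  Induction set `S = {t' | ∀ t'' ∈ (s,t'), G t''}` (closed for free),
right-openness by `keyStep`, `IsClosed.Icc_subset_of_forall_mem_nhdsWithin`; no continuity of `v` in time is used. -/
theorem subcriticalUpgrade_all (M : ℝ) : SubcriticalUpgrade M := by
  obtain ⟨C, hC, hK⟩ := exists_norm_oseenKernel_le (E := EuclideanSpace ℝ (Fin 3))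
  set I : ℝ := ∫ w : EuclideanSpace ℝ (Fin 3), (1 + ‖w‖ ^ 2) ^
      (-(((Module.finrank ℝ (EuclideanSpace ℝ (Fin 3)) : ℝ) + 1) / 2)) with hI_def
  have hI0 : 0 ≤ I := integral_nonneg fun w => Real.rpow_nonneg (by positivity) _
  set I₁ : ℝ := I + 1 with hI₁
  have hI₁pos : 0 < I₁ := by rw [hI₁]; linarith
  have hII₁ : I ≤ I₁ := by rw [hI₁]; linarith
  set M₁ : ℝ := |M| + 1 with hM₁_def
  have hM₁ : 0 < M₁ := by rw [hM₁_def]; positivity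
  have hMM₁ : M ≤ M₁ := by rw [hM₁_def]; linarith [le_abs_self M]
  set c₀ : ℝ := 1 / (128 * C * I₁ + 1) with hc₀_def
  have hden : 0 < 128 * C * I₁ + 1 := by positivity
  have hc₀ : 0 < c₀ := by rw [hc₀_def]; positivity
  have hc₀I : 128 * C * I₁ * c₀ ≤ 1 := by
    rw [hc₀_def, ← mul_div_assoc, mul_one, div_le_one hden]; linarith
  set κ : ℝ := 192 * π * C * M₁ ^ 2 / c₀ with hκ_def
  have hκ : 0 < κ := by rw [hκ_def]; positivity
  have hκc : C * M₁ ^ 2 * (96 * π / κ) ≤ c₀ / 2 := by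
    have : C * M₁ ^ 2 * (96 * π / κ) = c₀ / 2 := by
      rw [hκ_def]; field_simp; ring
    rw [this]
  set c₁ : ℝ := 2 + 2 * |Real.log κ| + |Real.log (I₁ ^ 2 / (16 * π ^ 2))| with hc₁_def
  have hc₁ : 2 + 2 * |Real.log κ| + |Real.log (I₁ ^ 2 / (16 * π ^ 2))| ≤ c₁ := by rw [hc₁_def]
  have hc₁pos : 0 < c₁ := by rw [hc₁_def]; positivity
  set b₁ : ℝ := min ((1 / (64 * κ * (c₁ + 8))) ^ 2) (c₀ / (2048 * M₁)) with hb₁_def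
  have hb₁ : 0 < b₁ := by rw [hb₁_def]; positivity
  refine ⟨c₀, -b₁, hc₀, by linarith, ?_⟩
  intro v hv s hs hq t ht x hx
  have hs0 : s < 0 := hs.2
  have hb : 0 < -s := by linarith
  have hsb : -s ≤ b₁ := by linarith [hs.1]
  -- smallness 1: `Φ(b) = 8κ(c₁+8)√b ≤ 1/8`
  have hΦb : recessPhi κ (-s) c₁ (-s) ≤ 1 / 8 := by
    rw [recessPhi_self hb]
    have h64 : 0 < 64 * κ * (c₁ + 8) := by positivity
    have hsq : Real.sqrt (-s) ≤ 1 / (64 * κ * (c₁ + 8)) := by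
      rw [← Real.sqrt_sq (le_of_lt (by positivity : (0 : ℝ) < 1 / (64 * κ * (c₁ + 8))))]
      exact Real.sqrt_le_sqrt (hsb.trans (min_le_left _ _))
    calc 8 * κ * (c₁ + 8) * Real.sqrt (-s) ≤ 8 * κ * (c₁ + 8) * (1 / (64 * κ * (c₁ + 8))) := by gcongr
      _ = 1 / 8 := by field_simp; ring
  -- smallness 2: the Gaussian tail of the heat part, `2^{3/2}·512·M₁·b ≤ c₀`
  have hheat : (2 : ℝ) ^ (3 / 2 : ℝ) * 512 * M₁ * (-s) ≤ c₀ := by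
    have h232 : (2 : ℝ) ^ (3 / 2 : ℝ) ≤ 4 := by
      have h := Real.rpow_le_rpow_of_exponent_le (by norm_num : (1 : ℝ) ≤ 2) (by norm_num : (3 / 2 : ℝ) ≤ 2)
      have h4 : (2 : ℝ) ^ (2 : ℝ) = 4 := by norm_num
      rwa [h4] at h
    have hb2 : -s ≤ c₀ / (2048 * M₁) := hsb.trans (min_le_right _ _)
    calc (2 : ℝ) ^ (3 / 2 : ℝ) * 512 * M₁ * (-s) ≤ 4 * 512 * M₁ * (c₀ / (2048 * M₁)) := by gcongr
      _ = c₀ := by field_simp; ring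
  -- the receding-ball property `G`
  have key : ∀ t₁ : ℝ, s ≤ t₁ → t₁ < 0 →
      (∀ t' ∈ Set.Ioo s t₁, ∀ y : EuclideanSpace ℝ (Fin 3), ‖y‖ < 3 / 4 + recessPhi κ (-s) c₁ (-t') →
        ‖v t' y‖ ≤ 4 * c₀ * (-s) ^ (-(3 / 8 : ℝ)) * (-t') ^ (-(1 / 8 : ℝ))) →
      ∃ η : ℝ, 0 < η ∧ ∀ t'' : ℝ, s < t'' → t₁ ≤ t'' → t'' < t₁ + η → t'' < 0 →
        ∀ y : EuclideanSpace ℝ (Fin 3), ‖y‖ < 3 / 4 + recessPhi κ (-s) c₁ (-t'') →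
          ‖v t'' y‖ ≤ 4 * c₀ * (-s) ^ (-(3 / 8 : ℝ)) * (-t'') ^ (-(1 / 8 : ℝ)) :=
    fun t₁ hst₁ ht₁ hyp => keyStep hC hK hII₁ hI₁pos hM₁ hMM₁ hc₀ hc₀I hκ hκc hc₁ hs0 hΦb hheat hv hq hst₁ ht₁ hyp
  set G : ℝ → Prop := fun t' => ∀ y : EuclideanSpace ℝ (Fin 3), ‖y‖ < 3 / 4 + recessPhi κ (-s) c₁ (-t') →
    ‖v t' y‖ ≤ 4 * c₀ * (-s) ^ (-(3 / 8 : ℝ)) * (-t') ^ (-(1 / 8 : ℝ)) with hG_def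
  -- base: `G s` from quietness (`‖y‖ < 3/4 + Φ(b) ≤ 7/8 < 1`, `c₀/√b ≤ 4c₀ b^{-3/8} b^{-1/8}`)
  have hGs : G s := by
    intro y hy
    have hy1 : ‖y‖ < 1 := by linarith
    refine (hq y (mem_ball_zero_iff.2 hy1)).trans ?_
    have e : (-s) ^ (-(3 / 8 : ℝ)) * (-s) ^ (-(1 / 8 : ℝ)) = 1 / Real.sqrt (-s) := by
      rw [← Real.rpow_add hb, show (-(3 / 8 : ℝ)) + -(1 / 8 : ℝ) = -(1 / 2 : ℝ) by norm_num,
        Real.rpow_neg hb.le, Real.sqrt_eq_rpow, inv_eq_one_div]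
    have hsq0 : 0 ≤ 1 / Real.sqrt (-s) := by positivity
    calc c₀ / Real.sqrt (-s) = c₀ * (1 / Real.sqrt (-s)) := by ring
      _ ≤ 4 * c₀ * (1 / Real.sqrt (-s)) := by nlinarith
      _ = 4 * c₀ * (-s) ^ (-(3 / 8 : ℝ)) * (-s) ^ (-(1 / 8 : ℝ)) := by rw [mul_assoc (4 * c₀), e]
  have hx34 : ‖x‖ < 3 / 4 := mem_ball_zero_iff.1 hx
  have hΦt : 0 ≤ recessPhi κ (-s) c₁ (-t) :=
    recessPhi_nonneg hκ.le hb hc₁pos.le (by linarith [ht.2]) (by linarith [ht.1])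
  rcases eq_or_lt_of_le ht.1 with heq | hlt
  · -- `t = s`
    have hGt : G t := by rw [← heq]; exact hGs
    exact hGt x (by linarith)
  · -- `s < t`: real induction on `[s, t]`
    set S : Set ℝ := {t' | ∀ t'' ∈ Set.Ioo s t', G t''} with hS_def
    have hS_closed : IsClosed S := by
      have hS : S = ⋂ t'' : ℝ, {t' : ℝ | t'' < t' → (s < t'' → G t'')} := by
        ext t'
        simp only [hS_def, Set.mem_setOf_eq, Set.mem_iInter, Set.mem_Ioo]
        exact ⟨fun h t'' h1 h2 => h t'' ⟨h2, h1⟩, fun h t'' ht'' => h t'' ht''.2 ht''.1⟩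
      rw [hS]
      refine isClosed_iInter fun t'' => ?_
      by_cases hP : (s < t'' → G t'')
      · have h1 : {t' : ℝ | t'' < t' → (s < t'' → G t'')} = Set.univ := Set.eq_univ_of_forall fun t' _ => hP
        rw [h1]; exact isClosed_univ
      · have h1 : {t' : ℝ | t'' < t' → (s < t'' → G t'')} = Set.Iic t'' := by
          ext t'
          simp only [Set.mem_setOf_eq, Set.mem_Iic]
          exact ⟨fun h => not_lt.1 fun hlt' => hP (h hlt'), fun h hlt' => absurd hlt' (not_lt.2 h)⟩
        rw [h1]; exact isClosed_Iic
    have hsS : s ∈ S := fun t'' ht'' => absurd ht''.2 (not_lt.2 ht''.1.le)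
    have hstepS : ∀ t' ∈ S ∩ Set.Ico s t, S ∈ 𝓝[>] t' := by
      rintro t' ⟨ht'S, ht'⟩
      have ht'0 : t' < 0 := ht'.2.trans ht.2
      obtain ⟨η, hη, hstep⟩ := key t' ht'.1 ht'0 ht'S
      refine mem_nhdsGT_iff_exists_Ioo_subset.2 ⟨t' + min η (-t' / 2), ?_, fun t₃ ht₃ => ?_⟩
      · show t' < t' + min η (-t' / 2)
        have : 0 < min η (-t' / 2) := lt_min hη (by linarith)
        linarith
      · intro t'' ht''
        rcases lt_or_ge t'' t' with h | h
        · exact ht'S t'' ⟨ht''.1, h⟩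
        · have h3 : t₃ < t' + min η (-t' / 2) := ht₃.2
          exact hstep t'' ht''.1 h (by linarith [min_le_left η (-t' / 2), ht''.2])
            (by linarith [min_le_right η (-t' / 2), ht''.2])
    have hind : Set.Icc s t ⊆ S :=
      IsClosed.Icc_subset_of_forall_mem_nhdsWithin (hS_closed.inter isClosed_Icc) hsS hstepS
    have htS : t ∈ S := hind (Set.right_mem_Icc.2 ht.1)
    obtain ⟨η, hη, hstep⟩ := key t ht.1 ht.2 htS
    have hGt : G t := hstep t hlt le_rfl (by linarith) ht.2
    exact hGt x (by linarith)

end Assembly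

/-- **Stub S3♭ — PROVED (v1.5)** by the receding-ball real induction `subcriticalUpgrade_all` (§1e; toolbox §1c–§1d).
The registered name and statement are unchanged. -/
theorem stub_subcriticalUpgrade : StubSubcriticalUpgrade := subcriticalUpgrade_all

/-- QC as it stands in this skeleton: **a theorem** (both registered stubs it rests on, S3♭ and S4♭, are proved in-file;
no `sorry` in its cone). -/
theorem quietCore_skeleton : StubQuietCore := stubQuietCore_of stub_subcriticalUpgrade stub_budgetPass

/-- `QuietCore M B` for all `M, B` — unconditional (v1.5). -/
theorem quietCore_all (M B : ℝ) : QuietCore M B := quietCore_skeleton M B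

/-! ## §2 De-flickering: a bounded core is not singular; Q3♭ from QC -/

/-- A uniform bound on `[s,0) × B(0,1/2)` excludes an apex singularity. -/
theorem not_singularAt_of_bound {v : ℝ → EuclideanSpace ℝ (Fin 3) → EuclideanSpace ℝ (Fin 3)} {s A : ℝ}
    (hs : s < 0)
    (hbd : ∀ t ∈ Set.Ico s 0, ∀ x ∈ Metric.ball (0 : EuclideanSpace ℝ (Fin 3)) (1 / 2), ‖v t x‖ ≤ A) :
    ¬ SingularAt v 0 := by
  intro hsing
  have hs0 : 0 < -s := by linarith
  set r : ℝ := min (1 / 2) (Real.sqrt (-s)) with hr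
  have hr0 : 0 < r := lt_min (by norm_num) (Real.sqrt_pos.2 hs0)
  obtain ⟨t, ht, y, hy, hA⟩ := hsing r hr0 A
  have hr2 : r ^ 2 ≤ -s := by
    calc r ^ 2 ≤ Real.sqrt (-s) ^ 2 := pow_le_pow_left₀ hr0.le (min_le_right _ _) 2
      _ = -s := Real.sq_sqrt hs0.le
  have hts : t ∈ Set.Ico s 0 := ⟨by linarith [ht.1], ht.2⟩
  have hy' : y ∈ Metric.ball (0 : EuclideanSpace ℝ (Fin 3)) (1 / 2) :=
    Metric.ball_subset_ball (min_le_left _ _) hy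
  exact absurd (hbd t hts y hy') (not_le.2 hA)

/-- **Q3♭ from QC.**  In the log-cube class an apex singularity carries a unit-ball rate floor: otherwise there are
arbitrarily late `c₀`-quiet slices, QC bounds the core up to the apex, and the apex is regular. -/
theorem localRateFloor_of_singularAt (hQC : StubQuietCore) {M : ℝ}
    {v : ℝ → EuclideanSpace ℝ (Fin 3) → EuclideanSpace ℝ (Fin 3)}
    (hv : IsTypeIAncientMild M v) (hB : EnvelopeCubeBudget v) (hsing : SingularAt v 0) :
    LocalRateFloor v := by
  obtain ⟨B, hBv⟩ := (envelopeCubeBudget_iff v).1 hB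
  obtain ⟨c₀, s₁, K, hc₀, hs₁, -, hcore⟩ := hQC M B
  by_contra hfl
  -- no floor at level `c₀` from `s₁` on: a quiet slice exists
  have hquiet : ∃ s ∈ Set.Ico s₁ 0,
      ∀ x ∈ Metric.ball (0 : EuclideanSpace ℝ (Fin 3)) 1, ‖v s x‖ ≤ c₀ / Real.sqrt (-s) := by
    by_contra hne
    push Not at hne
    exact hfl ⟨c₀, s₁, hc₀, hs₁, fun s hs => by
      obtain ⟨x, hx, hlt⟩ := hne s hs
      exact ⟨x, hx, hlt.le⟩⟩
  obtain ⟨s, hs, hq⟩ := hquiet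
  exact not_singularAt_of_bound hs.2 (hcore v hv hBv s hs hq) hsing

/-- Q3 restricted to the log-cube class (what the loop actually consumes). -/
def LocalRateFloorLogCube : Prop :=
  ∀ (M : ℝ) (v : ℝ → EuclideanSpace ℝ (Fin 3) → EuclideanSpace ℝ (Fin 3)),
    IsTypeIAncientMild M v → EnvelopeCubeBudget v → SingularAt v 0 → LocalRateFloor v

theorem localRateFloorLogCube_of_quietCore (hQC : StubQuietCore) : LocalRateFloorLogCube :=
  fun _ _ hv hB hs => localRateFloor_of_singularAt hQC hv hB hs

/-- g9's (flicker-risk) Q3 implies the class-restricted Q3♭ trivially. -/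
theorem localRateFloorLogCube_of_stubLocalRateFloor (h : StubLocalRateFloor) : LocalRateFloorLogCube :=
  fun M v hv _ hs => h M v hv hs

/-! ## §3 The de-flickered loop -/

/-- Stub Q2♭ (REGISTERED, converse side): if the crux fails, extract a Type-I ancient mild field with a log-cube budget
that is SINGULAR AT THE APEX (no rate floor required — §2 supplies it).  Why it might fail: the all-time CENTRED
log-cube budget of the extracted object (same risk as g9's Q2); sources: BP21 (arXiv:2012.09776), KNSS 2009
(arXiv:0709.3599), tree `CubeBridge`. -/
def StubLogCubeExtractionFlat : Prop :=
  ¬ Summit.NavierStokesRegularity.NavierStokesRegularity.Theses.QuarterLogPincer.TypeIQuantSubcubicExp →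
    ∃ (M : ℝ) (v : ℝ → EuclideanSpace ℝ (Fin 3) → EuclideanSpace ℝ (Fin 3)),
      IsTypeIAncientMild M v ∧ EnvelopeCubeBudget v ∧ SingularAt v 0

theorem stub_logCubeExtractionFlat : StubLogCubeExtractionFlat := by
  sorry

/-- Q2 from Q2♭ (mod QC): the floor of the extracted object is automatic. -/
theorem stubLogCubeExtraction_of_flat (hQC : StubQuietCore) (h : StubLogCubeExtractionFlat) :
    StubLogCubeExtraction := by
  intro hn
  obtain ⟨M, v, hv, hB, hs⟩ := h hn
  exact ⟨M, v, hv, hB, localRateFloor_of_singularAt hQC hv hB hs⟩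

/-- The floor-Liouville value implies the apex-Liouville value (mod QC). -/
theorem logCubeLiouville_of_logCubeFloorLiouville (hQC : StubQuietCore) (hL : LogCubeFloorLiouville) :
    LogCubeLiouville :=
  fun M v hv hB hs => hL M v hv hB (localRateFloor_of_singularAt hQC hv hB hs)

/-- Converse edge: Q2♭ and the apex-Liouville value give the crux. -/
theorem typeIQuantSubcubicExp_of_logCubeLiouville (h : StubLogCubeExtractionFlat) (hL : LogCubeLiouville) :
    Summit.NavierStokesRegularity.NavierStokesRegularity.Theses.QuarterLogPincer.TypeIQuantSubcubicExp := by
  by_contra hn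
  obtain ⟨M, v, hv, hB, hs⟩ := h hn
  exact hL M v hv hB hs

/-- **LOOP♭.**  Given g9's edge `crux → LogCubeFloorLiouville` (kernel-checked in `Lines/quiet_collar.lean` modulo
Q1), QC and Q2♭ identify the crux with the apex-Liouville value `LogCubeLiouville` itself. -/
theorem typeIQuantSubcubicExp_iff_logCubeLiouville
    (hEdge : Summit.NavierStokesRegularity.NavierStokesRegularity.Theses.QuarterLogPincer.TypeIQuantSubcubicExp →
      LogCubeFloorLiouville)
    (hQC : StubQuietCore) (h : StubLogCubeExtractionFlat) :
    Summit.NavierStokesRegularity.NavierStokesRegularity.Theses.QuarterLogPincer.TypeIQuantSubcubicExp ↔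
      LogCubeLiouville :=
  ⟨fun hc => logCubeLiouville_of_logCubeFloorLiouville hQC (hEdge hc),
    typeIQuantSubcubicExp_of_logCubeLiouville h⟩

/-- Under QC the two Liouville values agree on the direction the loop uses. -/
theorem logCubeFloorLiouville_iff_logCubeLiouville (hQC : StubQuietCore)
    (hconv : LogCubeLiouville → LogCubeFloorLiouville) : LogCubeFloorLiouville ↔ LogCubeLiouville :=
  ⟨logCubeLiouville_of_logCubeFloorLiouville hQC, hconv⟩

/-- **Composition concluding the crux BY NAME**: Q2♭ → (the value `LogCubeLiouville`) → crux. -/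
theorem TypeIQuantSubcubicExp_of :
    StubLogCubeExtractionFlat → LogCubeLiouville →
      Summit.NavierStokesRegularity.NavierStokesRegularity.Theses.QuarterLogPincer.TypeIQuantSubcubicExp :=
  typeIQuantSubcubicExp_of_logCubeLiouville

/-! ## §4 First rung of the value: small budget ⇒ no apex singularity (mod QC) -/

/-- **Uniform slab Lipschitz bounds** — `exists_slab_lipschitz` with ONE constant `D₀(M)` for the whole class
(the class rates `exists_spaceTime_rate_of_class` are uniform in `v`). -/
theorem uniform_slab_lipschitz (M : ℝ) :
    ∃ D₀ : ℝ, 1 ≤ D₀ ∧ ∀ v : ℝ → EuclideanSpace ℝ (Fin 3) → EuclideanSpace ℝ (Fin 3),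
      IsTypeIAncientMild M v → ∀ ε : ℝ, 0 < ε → ε ≤ 1 →
      (∀ s ∈ Set.Icc (-1 : ℝ) (-(ε / 2)), ∀ x y : EuclideanSpace ℝ (Fin 3),
          ‖v s x - v s y‖ ≤ D₀ / ε ^ 2 * ‖x - y‖) ∧
      (∀ x : EuclideanSpace ℝ (Fin 3), ∀ s ∈ Set.Icc (-1 : ℝ) (-(ε / 2)), ∀ s' ∈ Set.Icc (-1 : ℝ) (-(ε / 2)),
          ‖v s x - v s' x‖ ≤ D₀ / ε ^ 2 * |s - s'|) := by
  obtain ⟨Kx, hKx0, hKx'⟩ := exists_spaceTime_rate_of_class M 1 0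
  obtain ⟨Kt, hKt0, hKt'⟩ := exists_spaceTime_rate_of_class M 0 1
  refine ⟨2 * Kx + 4 * Kt + 1, by linarith, fun v hv ε hε hε1 => ?_⟩
  have hcont : ContinuousOn (uncurry v) (Iio (0 : ℝ) ×ˢ univ) := hv.1.continuousOn
  have hmild : ∀ s t : ℝ, s < t → t < 0 → ∀ y,
      v t y = UnboundedOperators.heatExtension (v s) (t - s) y - oseenDuhamel 1 s v v t y :=
    fun s t hst ht y => hv.mild_eq_heatExtension hst ht y
  -- the class rates, specialised to `v`
  have hKx : ∀ t < 0, ∀ y, ‖fderiv ℝ (v t) y‖ ≤ Kx / (-t) := by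
    intro t ht y
    have h := hKx' v hv.2.2.2 hcont hmild t ht y
    have hid : (fun y' => iteratedDeriv 0 (fun τ => v τ y') t) = v t := by
      funext y'; rw [iteratedDeriv_zero]
    rw [hid, norm_iteratedFDeriv_one] at h
    have h2 : Real.sqrt (-t) ^ (1 + 2 * 0 + 1) = -t := by
      rw [show 1 + 2 * 0 + 1 = 2 by norm_num, Real.sq_sqrt (neg_pos.2 ht).le]
    rwa [h2] at h
  have hKt : ∀ t < 0, ∀ y, ‖deriv (fun τ => v τ y) t‖ ≤ Kt / ((-t) * Real.sqrt (-t)) := by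
    intro t ht y
    have h := hKt' v hv.2.2.2 hcont hmild t ht y
    rw [norm_iteratedFDeriv_zero, iteratedDeriv_one] at h
    have h3 : Real.sqrt (-t) ^ (0 + 2 * 1 + 1) = (-t) * Real.sqrt (-t) := by
      rw [show 0 + 2 * 1 + 1 = 3 by norm_num, pow_succ, Real.sq_sqrt (neg_pos.2 ht).le]
    rwa [h3] at h
  -- differentiability of slices and time lines on the open past
  have hdiff : DifferentiableOn ℝ (uncurry v) (Iio (0 : ℝ) ×ˢ univ) := hv.1.differentiableOn (by simp)
  have hopen : IsOpen (Iio (0 : ℝ) ×ˢ (univ : Set (EuclideanSpace ℝ (Fin 3)))) :=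
    isOpen_Iio.prod isOpen_univ
  have hdAt : ∀ s < (0 : ℝ), ∀ x : EuclideanSpace ℝ (Fin 3), DifferentiableAt ℝ (uncurry v) (s, x) :=
    fun s hs x => hdiff.differentiableAt (hopen.mem_nhds ⟨hs, mem_univ _⟩)
  have hslice : ∀ s < (0 : ℝ), ∀ x : EuclideanSpace ℝ (Fin 3), DifferentiableAt ℝ (v s) x := by
    intro s hs x
    have h2 : DifferentiableAt ℝ
        (fun y : EuclideanSpace ℝ (Fin 3) => ((s, y) : ℝ × EuclideanSpace ℝ (Fin 3))) x :=
      (differentiableAt_const s).prodMk differentiableAt_id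
    exact (hdAt s hs x).comp x h2
  have hline : ∀ x : EuclideanSpace ℝ (Fin 3), ∀ s < (0 : ℝ), DifferentiableAt ℝ (fun τ => v τ x) s := by
    intro x s hs
    have h2 : DifferentiableAt ℝ (fun τ : ℝ => ((τ, x) : ℝ × EuclideanSpace ℝ (Fin 3))) s :=
      differentiableAt_id.prodMk (differentiableAt_const x)
    exact (hdAt s hs x).comp s h2
  refine ⟨?_, ?_⟩
  · intro s hs x y
    have hs0 : s < 0 := by linarith [hs.2]
    have hns : ε / 2 ≤ -s := by linarith [hs.2]
    have hbound : ∀ z ∈ (univ : Set (EuclideanSpace ℝ (Fin 3))),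
        ‖fderiv ℝ (v s) z‖ ≤ (2 * Kx + 4 * Kt + 1) / ε ^ 2 := by
      intro z _
      refine (hKx s hs0 z).trans ?_
      rw [div_le_div_iff₀ (by linarith) (by positivity)]
      have h1 : Kx * ε ^ 2 ≤ Kx * ε := mul_le_mul_of_nonneg_left (by nlinarith) hKx0
      have h2 : Kx * ε ≤ 2 * Kx * (-s) := by nlinarith
      have h3 : 2 * Kx * (-s) ≤ (2 * Kx + 4 * Kt + 1) * (-s) :=
        mul_le_mul_of_nonneg_right (by linarith) (by linarith)
      linarith
    have := Convex.norm_image_sub_le_of_norm_fderiv_le (fun z _ => hslice s hs0 z) hbound convex_univ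
      (mem_univ y) (mem_univ x)
    simpa using this
  · intro x s hs s' hs'
    have hbound : ∀ τ ∈ Set.Icc (-1 : ℝ) (-(ε / 2)),
        ‖deriv (fun τ => v τ x) τ‖ ≤ (2 * Kx + 4 * Kt + 1) / ε ^ 2 := by
      intro τ hτ
      have hτ0 : τ < 0 := by linarith [hτ.2]
      have hnτ : ε / 2 ≤ -τ := by linarith [hτ.2]
      have hnτ1 : -τ ≤ 1 := by linarith [hτ.1]
      refine (hKt τ hτ0 x).trans ?_
      have hsq : -τ ≤ Real.sqrt (-τ) := by
        rw [Real.le_sqrt (by linarith) (by linarith)]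
        nlinarith
      have hden : ε ^ 2 / 4 ≤ (-τ) * Real.sqrt (-τ) := by
        have : (-τ) * (-τ) ≤ (-τ) * Real.sqrt (-τ) := mul_le_mul_of_nonneg_left hsq (by linarith)
        nlinarith
      have hpos : 0 < (-τ) * Real.sqrt (-τ) := lt_of_lt_of_le (by positivity) hden
      rw [div_le_div_iff₀ hpos (by positivity)]
      calc Kt * ε ^ 2 = 4 * Kt * (ε ^ 2 / 4) := by ring
        _ ≤ 4 * Kt * ((-τ) * Real.sqrt (-τ)) := mul_le_mul_of_nonneg_left hden (by positivity)
        _ ≤ (2 * Kx + 4 * Kt + 1) * ((-τ) * Real.sqrt (-τ)) :=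
          mul_le_mul_of_nonneg_right (by linarith) hpos.le
    have := Convex.norm_image_sub_le_of_norm_deriv_le (fun τ hτ => hline x τ (by linarith [hτ.2])) hbound
      (convex_Icc _ _) hs' hs
    rw [Real.norm_eq_abs] at this
    exact this

/-- The small-budget Liouville value at level `B₀`: a Type-I ancient mild field (constant `M`) whose log-cube budget
constant is `≤ B₀` is not singular at the apex. -/
def SmallBudgetLiouville (M B₀ : ℝ) : Prop :=
  ∀ (B : ℝ) (v : ℝ → EuclideanSpace ℝ (Fin 3) → EuclideanSpace ℝ (Fin 3)),
    IsTypeIAncientMild M v → CubeBudgetWith B v → B ≤ B₀ → ¬ SingularAt v 0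

/-- **No spike above the slab budget.**  With uniform slab Lipschitz constant `D₀/ε²` on `[−1,−ε/2]` and budget
constant `B`, a value `‖v(−ε,x₀)‖ > η` at some `|x₀| < 1` forces
`(η/2)³·a⁴·|B₁| ≤ B·(1 + log 2 + log(2/ε))`, `a = η/(4D₀/ε²)`, provided `a ≤ ε/2`. -/
theorem spike_le_budget {v : ℝ → EuclideanSpace ℝ (Fin 3) → EuclideanSpace ℝ (Fin 3)} {M B ε D₀ η a : ℝ}
    (hv : IsTypeIAncientMild M v) (hBv : CubeBudgetWith B v) (hε : 0 < ε) (hε1 : ε ≤ 1) (hD₀ : 1 ≤ D₀)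
    (hLx : ∀ s ∈ Set.Icc (-1 : ℝ) (-(ε / 2)), ∀ x y : EuclideanSpace ℝ (Fin 3),
      ‖v s x - v s y‖ ≤ D₀ / ε ^ 2 * ‖x - y‖)
    (hLt : ∀ x : EuclideanSpace ℝ (Fin 3), ∀ s ∈ Set.Icc (-1 : ℝ) (-(ε / 2)),
      ∀ s' ∈ Set.Icc (-1 : ℝ) (-(ε / 2)), ‖v s x - v s' x‖ ≤ D₀ / ε ^ 2 * |s - s'|)
    (hη : 0 < η) (ha : a = η / (4 * (D₀ / ε ^ 2))) (haε : a ≤ ε / 2)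
    {x₀ : EuclideanSpace ℝ (Fin 3)} (hx₀ : x₀ ∈ Metric.ball (0 : EuclideanSpace ℝ (Fin 3)) 1)
    (hspike : η < ‖v (-ε) x₀‖) :
    (η / 2) ^ 3 * (a * (a ^ 3 * volume.real (Metric.ball (0 : EuclideanSpace ℝ (Fin 3)) 1))) ≤
      B * (1 + Real.log 2 + Real.log (1 / (ε / 2))) := by
  have hD : 0 < D₀ / ε ^ 2 := by positivity
  have ha0 : 0 < a := by rw [ha]; positivity
  -- the box below the spike
  have hbox := le_boxIntegral_of_spike (v := v) (s₀ := -ε) hD hη ha haε hLx hLt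
    ⟨by linarith, le_rfl⟩ hspike
  -- the slab budget at `R = 2`, `ε' = ε/2`
  obtain ⟨b, hb0, hb3, hsl⟩ := hBv.2 2 le_rfl (ε / 2) ⟨by linarith, by linarith⟩
  have hslab := slabMass_le_of_slices hv.continuousOn_uncurry (R := 2) (by linarith : 0 < ε) hb0 hsl
  -- the box lies in the slab
  have hsub : Set.Icc (-ε) (-ε + a) ×ˢ Metric.closedBall x₀ a ⊆
      Set.Icc (-1 : ℝ) (-(ε / 2)) ×ˢ Metric.ball (0 : EuclideanSpace ℝ (Fin 3)) 2 := by
    refine Set.prod_mono ?_ ?_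
    · intro s hs; exact ⟨by linarith [hs.1], by linarith [hs.2]⟩
    · intro x hx
      rw [Metric.mem_closedBall] at hx
      rw [Metric.mem_ball] at hx₀ ⊢
      calc dist x 0 ≤ dist x x₀ + dist x₀ 0 := dist_triangle _ _ _
        _ < 2 := by linarith
  have hchain : ENNReal.ofReal ((η / 2) ^ 3 * (a * (a ^ 3 *
      volume.real (Metric.ball (0 : EuclideanSpace ℝ (Fin 3)) 1)))) ≤ ENNReal.ofReal (b ^ 3) :=
    hbox.trans ((lintegral_mono_set hsub).trans hslab)
  rw [ENNReal.ofReal_le_ofReal_iff (by positivity)] at hchain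
  exact hchain.trans hb3

/-- **FIRST RUNG OF THE VALUE (mod QC).**  For every `M` there is `B₀ > 0` with `SmallBudgetLiouville M B₀`:
small log-cube budget ⇒ a quiet slice at `s = −ε(M)` (no spike survives the slab budget) ⇒ QC ⇒ bounded core ⇒
no apex singularity. -/
theorem smallBudgetLiouville_of_quietCore (hQC : StubQuietCore) (M : ℝ) :
    ∃ B₀ : ℝ, 0 < B₀ ∧ SmallBudgetLiouville M B₀ := by
  obtain ⟨c₀, s₁, K, hc₀, hs₁, -, hcore⟩ := hQC M 1
  obtain ⟨D₀, hD₀, hLip⟩ := uniform_slab_lipschitz M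
  -- the quiet time `−ε`
  set ε : ℝ := min (-s₁) (1 / 2) with hεdef
  have hε0 : 0 < ε := lt_min (by linarith) (by norm_num)
  have hε1 : ε ≤ 1 / 2 := min_le_right _ _
  have hεs : ε ≤ -s₁ := min_le_left _ _
  -- the quiet level `c ≤ c₀` (small enough that the spike box fits the slab) and the spike height `η`
  set c : ℝ := min c₀ (D₀ * Real.sqrt ε) with hcdef
  have hc0 : 0 < c := lt_min hc₀ (by positivity)
  set η : ℝ := c / Real.sqrt ε with hηdef
  have hη0 : 0 < η := by positivity
  set a : ℝ := η / (4 * (D₀ / ε ^ 2)) with hadef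
  have hsqε : 0 < Real.sqrt ε := Real.sqrt_pos.2 hε0
  have ha_eq : a = c * ε ^ 2 / (4 * D₀ * Real.sqrt ε) := by
    rw [hadef, hηdef]; field_simp
  have haε2 : a ≤ ε ^ 2 / 4 := by
    rw [ha_eq, div_le_div_iff₀ (by positivity) (by positivity)]
    have hcle : c ≤ D₀ * Real.sqrt ε := min_le_right _ _
    have : c * ε ^ 2 * 4 ≤ D₀ * Real.sqrt ε * ε ^ 2 * 4 := by
      have hε2 : 0 ≤ ε ^ 2 * 4 := by positivity
      nlinarith
    nlinarith
  have haε : a ≤ ε / 2 := by nlinarith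
  have ha0 : 0 < a := by rw [hadef]; positivity
  -- the threshold
  set L : ℝ := 1 + Real.log 2 + Real.log (1 / (ε / 2)) with hLdef
  have hL0 : 0 < L := by
    have h1 : 0 ≤ Real.log 2 := Real.log_nonneg (by norm_num)
    have h2 : 0 ≤ Real.log (1 / (ε / 2)) :=
      Real.log_nonneg (by rw [le_div_iff₀ (by positivity)]; linarith)
    simp only [hLdef]; linarith
  have hvol : 0 < volume.real (Metric.ball (0 : EuclideanSpace ℝ (Fin 3)) 1) := by
    rw [measureReal_def]
    exact ENNReal.toReal_pos (Metric.measure_ball_pos volume _ one_pos).ne' measure_ball_lt_top.ne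
  set m : ℝ := (η / 2) ^ 3 * (a * (a ^ 3 * volume.real (Metric.ball (0 : EuclideanSpace ℝ (Fin 3)) 1)))
    with hmdef
  have hm0 : 0 < m := by positivity
  refine ⟨min 1 (m / (2 * L)), lt_min one_pos (by positivity), ?_⟩
  intro B v hv hBv hB hsing
  -- (i) the slice `−ε` is quiet at level `c`
  have hquiet : ∀ x ∈ Metric.ball (0 : EuclideanSpace ℝ (Fin 3)) 1, ‖v (-ε) x‖ ≤ c₀ / Real.sqrt (-(-ε)) := by
    intro x hx
    rw [neg_neg]
    by_contra hlt
    push Not at hlt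
    have hspike : η < ‖v (-ε) x‖ := by
      refine lt_of_le_of_lt ?_ hlt
      rw [hηdef]
      exact div_le_div_of_nonneg_right (min_le_left _ _) hsqε.le
    obtain ⟨hLx, hLt⟩ := hLip v hv ε hε0 (by linarith)
    have hsp := spike_le_budget hv hBv hε0 (by linarith) hD₀ hLx hLt hη0 hadef haε hx hspike
    -- `m ≤ B·L ≤ (m/(2L))·L = m/2`, absurd
    have hBL : B * L ≤ m / (2 * L) * L :=
      mul_le_mul_of_nonneg_right (hB.trans (min_le_right _ _)) hL0.le
    have : m / (2 * L) * L = m / 2 := by field_simp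
    have hm : m ≤ m / 2 := by
      calc m ≤ B * L := hsp
        _ ≤ m / 2 := by rw [← this]; exact hBL
    linarith
  -- (ii) QC bounds the core up to the apex
  have hBv1 : CubeBudgetWith 1 v := hBv.mono (hB.trans (min_le_left _ _))
  have hsIco : (-ε) ∈ Set.Ico s₁ 0 := ⟨by linarith, by linarith⟩
  have hbd := hcore v hv hBv1 (-ε) hsIco hquiet
  exact not_singularAt_of_bound (by linarith) hbd hsing

/-- The rung in `EnvelopeCubeBudget` language: small budgets are Liouville (mod QC). -/
theorem logCubeLiouville_smallBudget (hQC : StubQuietCore) (M : ℝ) :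
    ∃ B₀ : ℝ, 0 < B₀ ∧ ∀ (B : ℝ) (v : ℝ → EuclideanSpace ℝ (Fin 3) → EuclideanSpace ℝ (Fin 3)),
      B ≤ B₀ → IsTypeIAncientMild M v → CubeBudgetWith B v → ¬ SingularAt v 0 := by
  obtain ⟨B₀, hB₀, h⟩ := smallBudgetLiouville_of_quietCore hQC M
  exact ⟨B₀, hB₀, fun B v hB hv hBv => h B v hv hBv hB⟩

/-! ## §5 UNCONDITIONAL COROLLARIES (v1.6): QC discharged by `quietCore_all` everywhere -/

/-- **Q3♭ PROVED outright**: a log-cube Type-I ancient mild field that is singular at the apex carries a unit-ball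
rate floor (de-flickering).  This is the statement g9's loop (`Lines/quiet_collar.lean`,
`logCubeLiouville_of_typeIQuantSubcubicExp`) actually consumes from its flicker-risk stub Q3 `StubLocalRateFloor`
(it applies Q3 only at fields WITH `EnvelopeCubeBudget`), so the loop's value side needs no Q3 any more. -/
theorem localRateFloorLogCube : LocalRateFloorLogCube := localRateFloorLogCube_of_quietCore quietCore_all

/-- g9's Q3, restricted to the log-cube class, as a function (unconditional). -/
theorem localRateFloor_of_singularAt' {M : ℝ} {v : ℝ → EuclideanSpace ℝ (Fin 3) → EuclideanSpace ℝ (Fin 3)}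
    (hv : IsTypeIAncientMild M v) (hB : EnvelopeCubeBudget v) (hsing : SingularAt v 0) : LocalRateFloor v :=
  localRateFloor_of_singularAt quietCore_all hv hB hsing

/-- **The two Liouville values coincide (unconditional):** `LogCubeFloorLiouville → LogCubeLiouville`
(the converse `LogCubeLiouville → LogCubeFloorLiouville` is trivial only after translation plumbing, see header). -/
theorem logCubeLiouville_of_logCubeFloorLiouville' (hL : LogCubeFloorLiouville) : LogCubeLiouville :=
  logCubeLiouville_of_logCubeFloorLiouville quietCore_all hL

/-- **Q2 ⇐ Q2♭ (unconditional):** the converse-side extraction only has to produce `SingularAt v 0`. -/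
theorem stubLogCubeExtraction_of_flat' (h : StubLogCubeExtractionFlat) : StubLogCubeExtraction :=
  stubLogCubeExtraction_of_flat quietCore_all h

/-- **Value of the crux, de-flickered (mod g9's EDGE theorem only):** given the edge `crux → LogCubeFloorLiouville`
(kernel-checked in `Lines/quiet_collar.lean` modulo QP2; enters BY STATEMENT), the crux implies the apex-Liouville
value `LogCubeLiouville` with NO floor/flicker hypothesis. -/
theorem logCubeLiouville_of_edge
    (hEdge : Summit.NavierStokesRegularity.NavierStokesRegularity.Theses.QuarterLogPincer.TypeIQuantSubcubicExp →
      LogCubeFloorLiouville)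
    (h : Summit.NavierStokesRegularity.NavierStokesRegularity.Theses.QuarterLogPincer.TypeIQuantSubcubicExp) :
    LogCubeLiouville :=
  logCubeLiouville_of_logCubeFloorLiouville' (hEdge h)

/-- **LOOP♭ with QC discharged:** `(crux → LogCubeFloorLiouville) → Q2♭ → (crux ↔ LogCubeLiouville)`. -/
theorem typeIQuantSubcubicExp_iff_logCubeLiouville'
    (hEdge : Summit.NavierStokesRegularity.NavierStokesRegularity.Theses.QuarterLogPincer.TypeIQuantSubcubicExp →
      LogCubeFloorLiouville)
    (h : StubLogCubeExtractionFlat) :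
    Summit.NavierStokesRegularity.NavierStokesRegularity.Theses.QuarterLogPincer.TypeIQuantSubcubicExp ↔
      LogCubeLiouville :=
  typeIQuantSubcubicExp_iff_logCubeLiouville hEdge quietCore_all h

/-- **FIRST RUNG OF THE VALUE, UNCONDITIONAL:** for every Type-I constant `M` there is `B₀(M) > 0` such that a
Type-I ancient mild field with cube budget constant `B ≤ B₀` is not singular at the apex. -/
theorem smallBudgetLiouville (M : ℝ) : ∃ B₀ : ℝ, 0 < B₀ ∧ SmallBudgetLiouville M B₀ :=
  smallBudgetLiouville_of_quietCore quietCore_all M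

/-- The same rung in `CubeBudgetWith` language (unconditional). -/
theorem logCubeLiouville_smallBudget' (M : ℝ) :
    ∃ B₀ : ℝ, 0 < B₀ ∧ ∀ (B : ℝ) (v : ℝ → EuclideanSpace ℝ (Fin 3) → EuclideanSpace ℝ (Fin 3)),
      B ≤ B₀ → IsTypeIAncientMild M v → CubeBudgetWith B v → ¬ SingularAt v 0 :=
  logCubeLiouville_smallBudget quietCore_all M

/-! ## §6 (v1.7) THE UNIFORM-LOCAL-ENERGY CLASS: QC for THIN OBJECTS, their de-flickering, the DE-FLICKERED LEFT EDGE
`ThinFloorTowerLiouville → 24077` (kernel, no stub).  The budget enters QC only through the FAR Duhamel sources, where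
uniform unit-scale energy suffices by Fubini averaging (`|B₁|·∫(1+‖y‖)^{-4}‖v(t,y)‖²dy ≤ 16·E·J₄`). -/

section LocalEnergy

open Summit.NavierStokesRegularity.NavierStokesRegularity.Cruxes.ScarEnvelopeTypeI.ZoomDictionary (ABTower RegPt)
open Summit.NavierStokesRegularity.NavierStokesRegularity.Cruxes.TypeIQuantSubcubicExp.AbRoot
  (ThinTowerLiouville typeIQuantSubcubicExp_of_thinTowerLiouville exists_thin_singular_abTower_of_not_typeIQuantSubcubicExp)

/-- **Uniform local (unit-scale) energy up to the apex**: `∫_{B(x₀,1)} ‖v(t)‖² ≤ E` for every centre `x₀` and every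
`t ∈ (−1, 0)` — verbatim the second clause of `ThinCascade.ThinObject`. -/
def LocalEnergyBound (E : ℝ) (v : ℝ → EuclideanSpace ℝ (Fin 3) → EuclideanSpace ℝ (Fin 3)) : Prop :=
  ∀ x₀ : EuclideanSpace ℝ (Fin 3), ∀ t ∈ Set.Ioo (-1 : ℝ) 0,
    ∫⁻ y in Metric.ball x₀ 1, ENNReal.ofReal (‖v t y‖ ^ 2) ≤ ENNReal.ofReal E

theorem LocalEnergyBound.mono {E E' : ℝ} {v : ℝ → EuclideanSpace ℝ (Fin 3) → EuclideanSpace ℝ (Fin 3)}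
    (h : LocalEnergyBound E v) (hEE' : E ≤ E') : LocalEnergyBound E' v :=
  fun x₀ t ht => (h x₀ t ht).trans (ENNReal.ofReal_le_ofReal hEE')

/-- A thin object has uniform local energy with a nonnegative constant. -/
theorem localEnergyBound_of_thinObject {M q : ℝ} {W : ℝ → EuclideanSpace ℝ (Fin 3) → EuclideanSpace ℝ (Fin 3)}
    {g : EuclideanSpace ℝ (Fin 3) → EuclideanSpace ℝ (Fin 3)} (h : ThinObject M q W g) :
    ∃ E : ℝ, 0 ≤ E ∧ LocalEnergyBound E W := by
  obtain ⟨E, hE⟩ := h.2.1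
  exact ⟨max E 0, le_max_right _ _, fun x₀ t ht => (hE x₀ t ht).trans (ENNReal.ofReal_le_ofReal (le_max_left _ _))⟩

/-! #### Local energy ⇒ weighted energy (the Fubini averaging) -/

/-- The weighted-energy constant of the uniform-local-energy class: `16·E·J₄/|B₁|`. -/
noncomputable def energyWeightConst (E : ℝ) : ℝ :=
  (16 * ENNReal.ofReal E * ENNReal.ofReal jFour /
    volume (Metric.ball (0 : EuclideanSpace ℝ (Fin 3)) 1)).toReal

theorem energyWeightConst_nonneg (E : ℝ) : 0 ≤ energyWeightConst E := ENNReal.toReal_nonneg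

/-- Pointwise comparison of the weights on a unit ball: `(1+‖y‖)^{-4} ≤ 16 (1+‖x₀‖)^{-4}` for `dist x₀ y < 1`. -/
theorem weight_le_sixteen_mul {x₀ y : EuclideanSpace ℝ (Fin 3)} (h : dist x₀ y < 1) :
    (1 + ‖y‖) ^ (-(4 : ℝ)) ≤ 16 * (1 + ‖x₀‖) ^ (-(4 : ℝ)) := by
  have hx0 : ‖x₀‖ ≤ ‖y‖ + 1 := by
    have := norm_le_norm_add_norm_sub' x₀ y
    rw [← dist_eq_norm] at this
    linarith
  have h2 : 1 + ‖x₀‖ ≤ 2 * (1 + ‖y‖) := by linarith [norm_nonneg y]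
  have hy0 : 0 < 1 + ‖y‖ := by positivity
  have hx00 : 0 < 1 + ‖x₀‖ := by positivity
  rw [Real.rpow_neg hy0.le, Real.rpow_neg hx00.le,
    show (4 : ℝ) = ((4 : ℕ) : ℝ) by norm_num, Real.rpow_natCast, Real.rpow_natCast]
  rw [show (16 : ℝ) * ((1 + ‖x₀‖) ^ 4)⁻¹ = ((1 + ‖x₀‖) ^ 4 / 16)⁻¹ by rw [inv_div]; ring]
  refine inv_anti₀ (by positivity) ?_
  rw [div_le_iff₀ (by norm_num : (0:ℝ) < 16)]
  calc (1 + ‖x₀‖) ^ 4 ≤ (2 * (1 + ‖y‖)) ^ 4 := pow_le_pow_left₀ hx00.le h2 4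
    _ = (1 + ‖y‖) ^ 4 * 16 := by ring

/-- **Local energy ⇒ weighted energy.**  If `∫_{B(x₀,1)} ‖a‖² ≤ E` for every centre `x₀` (and `a` is continuous),
then `|B₁| · ∫ (1+‖y‖)^{-4} ‖a(y)‖² dy ≤ 16 · E · J₄`: average the hypothesis against the weight `(1+‖x₀‖)^{-4}`
(whose mean over `B(y,1)` dominates `(1+‖y‖)^{-4}/16`) and swap the two integrals (Tonelli). -/
theorem lintegral_weight_sq_le_of_localEnergy
    {a : EuclideanSpace ℝ (Fin 3) → EuclideanSpace ℝ (Fin 3)} (ha : Continuous a) {E : ℝ}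
    (hloc : ∀ x₀ : EuclideanSpace ℝ (Fin 3),
      ∫⁻ y in Metric.ball x₀ 1, ENNReal.ofReal (‖a y‖ ^ 2) ≤ ENNReal.ofReal E) :
    volume (Metric.ball (0 : EuclideanSpace ℝ (Fin 3)) 1) *
        ∫⁻ y, ENNReal.ofReal ((1 + ‖y‖) ^ (-(4 : ℝ))) * ENNReal.ofReal (‖a y‖ ^ 2) ≤
      16 * ENNReal.ofReal E * ENNReal.ofReal jFour := by
  set μB : ℝ≥0∞ := volume (Metric.ball (0 : EuclideanSpace ℝ (Fin 3)) 1) with hμB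
  set w : EuclideanSpace ℝ (Fin 3) → ℝ := fun x₀ => (1 + ‖x₀‖) ^ (-(4 : ℝ)) with hw
  have hwc : Continuous w := by
    rw [hw]
    exact Continuous.rpow_const (by fun_prop) fun z => Or.inl (by positivity)
  have hwm : Measurable fun x₀ => ENNReal.ofReal (w x₀) := hwc.measurable.ennreal_ofReal
  have ham : Measurable fun y => ENNReal.ofReal (‖a y‖ ^ 2) := (ha.norm.pow 2).measurable.ennreal_ofReal
  -- Step 1: the weight at `y` is dominated by the average of `16 w` over `B(y,1)`
  have hstep1 : ∀ y : EuclideanSpace ℝ (Fin 3),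
      μB * ENNReal.ofReal (w y) ≤ 16 * ∫⁻ x₀ in Metric.ball y 1, ENNReal.ofReal (w x₀) := by
    intro y
    have hvol : volume (Metric.ball y 1) = μB := by
      rw [hμB]; exact Measure.addHaar_ball_center volume y 1
    calc μB * ENNReal.ofReal (w y)
        = ∫⁻ _ in Metric.ball y 1, ENNReal.ofReal (w y) := by
          rw [setLIntegral_const, hvol, mul_comm]
      _ ≤ ∫⁻ x₀ in Metric.ball y 1, 16 * ENNReal.ofReal (w x₀) := by
          refine setLIntegral_mono (hwm.const_mul _) fun x₀ hx₀ => ?_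
          rw [show (16 : ℝ≥0∞) = ENNReal.ofReal 16 by norm_num, ← ENNReal.ofReal_mul (by norm_num)]
          exact ENNReal.ofReal_le_ofReal (weight_le_sixteen_mul (mem_ball.1 hx₀))
      _ = 16 * ∫⁻ x₀ in Metric.ball y 1, ENNReal.ofReal (w x₀) := by
          rw [lintegral_const_mul _ hwm]
  -- Step 2: Tonelli
  set S : Set (EuclideanSpace ℝ (Fin 3) × EuclideanSpace ℝ (Fin 3)) := {p | dist p.2 p.1 < 1} with hS
  have hSo : IsOpen S := isOpen_lt (continuous_snd.dist continuous_fst) continuous_const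
  have hSm : MeasurableSet S := hSo.measurableSet
  set f : EuclideanSpace ℝ (Fin 3) → EuclideanSpace ℝ (Fin 3) → ℝ≥0∞ := fun y x₀ =>
    (Metric.ball y 1).indicator (fun x₀ => ENNReal.ofReal (w x₀)) x₀ * ENNReal.ofReal (‖a y‖ ^ 2) with hf
  have hfu : uncurry f = fun p => S.indicator (fun p => ENNReal.ofReal (w p.2)) p * ENNReal.ofReal (‖a p.1‖ ^ 2) := by
    funext p
    rcases p with ⟨y, x₀⟩
    simp only [uncurry, hf, Set.indicator, hS, Set.mem_setOf_eq, Metric.mem_ball]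
  have hfm : AEMeasurable (uncurry f) (volume.prod volume) := by
    rw [hfu]
    refine Measurable.aemeasurable ?_
    exact ((hwc.measurable.comp measurable_snd).ennreal_ofReal.indicator hSm).mul
      ((ha.norm.pow 2).measurable.comp measurable_fst).ennreal_ofReal
  calc μB * ∫⁻ y, ENNReal.ofReal (w y) * ENNReal.ofReal (‖a y‖ ^ 2)
      = ∫⁻ y, μB * (ENNReal.ofReal (w y) * ENNReal.ofReal (‖a y‖ ^ 2)) :=
        (lintegral_const_mul (f := fun y => ENNReal.ofReal (w y) * ENNReal.ofReal (‖a y‖ ^ 2)) μB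
          (hwm.mul ham)).symm
    _ ≤ ∫⁻ y, (16 * ∫⁻ x₀ in Metric.ball y 1, ENNReal.ofReal (w x₀)) * ENNReal.ofReal (‖a y‖ ^ 2) :=
        lintegral_mono fun y => by rw [← mul_assoc]; exact mul_le_mul' (hstep1 y) le_rfl
    _ = ∫⁻ y, 16 * ∫⁻ x₀, f y x₀ := by
        refine lintegral_congr fun y => ?_
        rw [hf]
        simp only
        rw [lintegral_mul_const _ (hwm.indicator measurableSet_ball), lintegral_indicator measurableSet_ball,
          mul_assoc]
    _ = 16 * ∫⁻ y, ∫⁻ x₀, f y x₀ := by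
        rw [lintegral_const_mul' _ _ (by norm_num)]
    _ = 16 * ∫⁻ x₀, ∫⁻ y, f y x₀ := by rw [lintegral_lintegral_swap hfm]
    _ = 16 * ∫⁻ x₀, ENNReal.ofReal (w x₀) * ∫⁻ y in Metric.ball x₀ 1, ENNReal.ofReal (‖a y‖ ^ 2) := by
        congr 1
        refine lintegral_congr fun x₀ => ?_
        rw [← lintegral_indicator measurableSet_ball, ← lintegral_const_mul _ (ham.indicator measurableSet_ball)]
        refine lintegral_congr fun y => ?_
        rw [hf]
        simp only [Set.indicator, Metric.mem_ball]
        rw [dist_comm]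
        split_ifs <;> simp
    _ ≤ 16 * ∫⁻ x₀, ENNReal.ofReal (w x₀) * ENNReal.ofReal E := by
        gcongr with x₀
        exact hloc x₀
    _ = 16 * ENNReal.ofReal E * ∫⁻ x₀, ENNReal.ofReal (w x₀) := by
        rw [lintegral_mul_const _ hwm]; ring
    _ = 16 * ENNReal.ofReal E * ENNReal.ofReal jFour := by
        rw [jFour, ofReal_integral_eq_lintegral_ofReal integrable_one_add_norm_neg_four
          (Eventually.of_forall fun z => Real.rpow_nonneg (by positivity) _)]

/-- Real-valued corollary: integrability of `(1+‖y‖)^{-4}‖a(y)‖²` and its bound by `energyWeightConst E`. -/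
theorem integral_weight_sq_le_of_localEnergy
    {a : EuclideanSpace ℝ (Fin 3) → EuclideanSpace ℝ (Fin 3)} (ha : Continuous a) {E : ℝ}
    (hloc : ∀ x₀ : EuclideanSpace ℝ (Fin 3),
      ∫⁻ y in Metric.ball x₀ 1, ENNReal.ofReal (‖a y‖ ^ 2) ≤ ENNReal.ofReal E) :
    Integrable (fun y : EuclideanSpace ℝ (Fin 3) => (1 + ‖y‖) ^ (-(4 : ℝ)) * ‖a y‖ ^ 2) ∧
      ∫ y, (1 + ‖y‖) ^ (-(4 : ℝ)) * ‖a y‖ ^ 2 ≤ energyWeightConst E := by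
  set μB : ℝ≥0∞ := volume (Metric.ball (0 : EuclideanSpace ℝ (Fin 3)) 1) with hμB
  have hμB0 : μB ≠ 0 := (measure_ball_pos volume (0 : EuclideanSpace ℝ (Fin 3)) one_pos).ne'
  have hμBt : μB ≠ ∞ := measure_ball_lt_top.ne
  set g : EuclideanSpace ℝ (Fin 3) → ℝ := fun y => (1 + ‖y‖) ^ (-(4 : ℝ)) * ‖a y‖ ^ 2 with hg
  have hg0 : ∀ y, 0 ≤ g y := fun y => mul_nonneg (Real.rpow_nonneg (by positivity) _) (by positivity)
  have hgc : Continuous g := by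
    rw [hg]
    exact (Continuous.rpow_const (by fun_prop) fun z => Or.inl (by positivity)).mul (ha.norm.pow 2)
  have hmain := lintegral_weight_sq_le_of_localEnergy ha hloc
  have hlint_eq : ∫⁻ y, ENNReal.ofReal (g y) =
      ∫⁻ y, ENNReal.ofReal ((1 + ‖y‖) ^ (-(4 : ℝ))) * ENNReal.ofReal (‖a y‖ ^ 2) :=
    lintegral_congr fun y => by
      rw [hg]; exact ENNReal.ofReal_mul (Real.rpow_nonneg (by positivity) _)
  have hRt : 16 * ENNReal.ofReal E * ENNReal.ofReal jFour ≠ ∞ := by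
    refine ENNReal.mul_ne_top (ENNReal.mul_ne_top (by norm_num) ENNReal.ofReal_ne_top) ENNReal.ofReal_ne_top
  have hbound : ∫⁻ y, ENNReal.ofReal (g y) ≤ 16 * ENNReal.ofReal E * ENNReal.ofReal jFour / μB := by
    rw [hlint_eq, ENNReal.le_div_iff_mul_le (Or.inl hμB0) (Or.inl hμBt), mul_comm]
    exact hmain
  have hfin : ∫⁻ y, ENNReal.ofReal (g y) < ∞ :=
    lt_of_le_of_lt hbound (ENNReal.div_lt_top hRt hμB0)
  have hint : Integrable g := by
    refine ⟨hgc.aestronglyMeasurable, ?_⟩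
    rw [hasFiniteIntegral_iff_ofReal (Eventually.of_forall hg0)]
    exact hfin
  refine ⟨hint, ?_⟩
  rw [integral_eq_lintegral_of_nonneg_ae (Eventually.of_forall hg0) hgc.aestronglyMeasurable, energyWeightConst,
    ← hμB]
  exact ENNReal.toReal_mono (ENNReal.div_ne_top hRt hμB0) hbound

/-! #### The two-region slice bound at a core point (near: sup; far: weighted energy) -/

theorem one_div_pow_four_le_weight {x y : EuclideanSpace ℝ (Fin 3)} (hx : ‖x‖ < 1 / 2) (hy : 3 / 4 ≤ ‖y‖) :
    1 / ‖x - y‖ ^ 4 ≤ 2401 * (1 + ‖y‖) ^ (-(4 : ℝ)) := by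
  have hd : ‖y‖ - 1 / 2 ≤ ‖x - y‖ := by linarith [norm_sub_norm_le y x, norm_sub_rev x y]
  have hd0 : 0 < ‖x - y‖ := by linarith
  have h7 : 1 + ‖y‖ ≤ 7 * ‖x - y‖ := by linarith
  have hy0 : 0 < 1 + ‖y‖ := by positivity
  rw [Real.rpow_neg hy0.le, show (4 : ℝ) = ((4 : ℕ) : ℝ) by norm_num, Real.rpow_natCast]
  rw [show (2401 : ℝ) * ((1 + ‖y‖) ^ 4)⁻¹ = 1 / ((1 + ‖y‖) ^ 4 / 2401) by rw [one_div, inv_div]; ring]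
  refine one_div_le_one_div_of_le (by positivity) ?_
  rw [div_le_iff₀ (by norm_num : (0:ℝ) < 2401)]
  calc (1 + ‖y‖) ^ 4 ≤ (7 * ‖x - y‖) ^ 4 := pow_le_pow_left₀ hy0.le h7 4
    _ = ‖x - y‖ ^ 4 * 2401 := by ring

/-- **Two-region slice bound at a core point (energy class).**  `‖x‖ < 1/2`, `σ > 0`; if `‖a(y)‖² ≤ P` on `‖y‖ < 3/4`
and `∫(1+‖y‖)^{-4}‖a‖² ≤ Q`, then `‖N_σ[a,a](x)‖ ≤ C P I σ^{-1/2} + 2401 C Q`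
(far sources `‖y‖ ≥ 3/4` are at distance `≥ ‖y‖ − 1/2 ≥ (1+‖y‖)/7`, where the kernel weight is `≤ ‖x−y‖^{-4}`). -/
theorem norm_oseenSlice_core_L2 {C : ℝ} (hC : 0 < C)
    (hK : ∀ {τ : ℝ}, 0 < τ → ∀ z a b : EuclideanSpace ℝ (Fin 3),
      ‖oseenKernel τ z a b‖ ≤ C * (τ + ‖z‖ ^ 2) ^
        (-(((Module.finrank ℝ (EuclideanSpace ℝ (Fin 3)) : ℝ) + 1) / 2)) * ‖a‖ * ‖b‖)
    {σ P Q : ℝ} (hσ : 0 < σ) (hP : 0 ≤ P)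
    {a : EuclideanSpace ℝ (Fin 3) → EuclideanSpace ℝ (Fin 3)}
    (hnear : ∀ y, ‖y‖ < 3 / 4 → ‖a y‖ ^ 2 ≤ P)
    (hwint : Integrable (fun y : EuclideanSpace ℝ (Fin 3) => (1 + ‖y‖) ^ (-(4 : ℝ)) * ‖a y‖ ^ 2))
    (hQ : ∫ y, (1 + ‖y‖) ^ (-(4 : ℝ)) * ‖a y‖ ^ 2 ≤ Q)
    {x : EuclideanSpace ℝ (Fin 3)} (hx : ‖x‖ < 1 / 2) :
    ‖oseenSlice σ a a x‖ ≤
      C * P * (∫ w : EuclideanSpace ℝ (Fin 3), (1 + ‖w‖ ^ 2) ^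
          (-(((Module.finrank ℝ (EuclideanSpace ℝ (Fin 3)) : ℝ) + 1) / 2))) * σ ^ (-(1 / 2 : ℝ)) +
      2401 * C * Q := by
  set e : ℝ := ((Module.finrank ℝ (EuclideanSpace ℝ (Fin 3)) : ℝ) + 1) / 2 with he_def
  have he : e = 2 := oseen_exponent_eq_two
  set I : ℝ := ∫ w : EuclideanSpace ℝ (Fin 3), (1 + ‖w‖ ^ 2) ^ (-e) with hI_def
  set h₁ : EuclideanSpace ℝ (Fin 3) → ℝ := fun y => C * P * (σ + ‖x - y‖ ^ 2) ^ (-e) with hh₁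
  set h₂ : EuclideanSpace ℝ (Fin 3) → ℝ := fun y => 2401 * C * ((1 + ‖y‖) ^ (-(4 : ℝ)) * ‖a y‖ ^ 2) with hh₂
  have hi₁ : Integrable h₁ :=
    ((integrable_add_norm_sq_rpow_neg_half_succ (E := EuclideanSpace ℝ (Fin 3)) hσ).comp_sub_left x).const_mul
      (C * P)
  have hi₂ : Integrable h₂ := hwint.const_mul (2401 * C)
  have hnn₁ : ∀ y, 0 ≤ h₁ y := fun y => by
    rw [hh₁]; exact mul_nonneg (by positivity) (Real.rpow_nonneg (by positivity) _)
  have hnn₂ : ∀ y, 0 ≤ h₂ y := fun y => by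
    rw [hh₂]
    exact mul_nonneg (by positivity) (mul_nonneg (Real.rpow_nonneg (by positivity) _) (by positivity))
  have hptw : ∀ y, ‖oseenKernel σ (x - y) (a y) (a y)‖ ≤ h₁ y + h₂ y := by
    intro y
    have hk := hK hσ (x - y) (a y) (a y)
    have hk' : ‖oseenKernel σ (x - y) (a y) (a y)‖ ≤ C * (σ + ‖x - y‖ ^ 2) ^ (-e) * ‖a y‖ ^ 2 := by
      calc ‖oseenKernel σ (x - y) (a y) (a y)‖ ≤ C * (σ + ‖x - y‖ ^ 2) ^ (-e) * ‖a y‖ * ‖a y‖ := hk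
        _ = C * (σ + ‖x - y‖ ^ 2) ^ (-e) * ‖a y‖ ^ 2 := by ring
    by_cases hy : ‖y‖ < 3 / 4
    · have h1 : C * (σ + ‖x - y‖ ^ 2) ^ (-e) * ‖a y‖ ^ 2 ≤ h₁ y := by
        rw [hh₁]
        calc C * (σ + ‖x - y‖ ^ 2) ^ (-e) * ‖a y‖ ^ 2 ≤ C * (σ + ‖x - y‖ ^ 2) ^ (-e) * P :=
              mul_le_mul_of_nonneg_left (hnear y hy) (mul_nonneg hC.le (Real.rpow_nonneg (by positivity) _))
          _ = C * P * (σ + ‖x - y‖ ^ 2) ^ (-e) := by ring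
      linarith [hk', h1, hnn₂ y]
    · have hy' : 3 / 4 ≤ ‖y‖ := not_lt.1 hy
      have hd0 : 0 < ‖x - y‖ := by linarith [norm_sub_norm_le y x, norm_sub_rev x y]
      have hwe : (σ + ‖x - y‖ ^ 2) ^ (-e) ≤ 2401 * (1 + ‖y‖) ^ (-(4 : ℝ)) := by
        rw [he]; exact (weight_le_one_div_pow_four hσ hd0).trans (one_div_pow_four_le_weight hx hy')
      have h2 : C * (σ + ‖x - y‖ ^ 2) ^ (-e) * ‖a y‖ ^ 2 ≤ h₂ y := by
        rw [hh₂]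
        calc C * (σ + ‖x - y‖ ^ 2) ^ (-e) * ‖a y‖ ^ 2 ≤ C * (2401 * (1 + ‖y‖) ^ (-(4 : ℝ))) * ‖a y‖ ^ 2 := by
              gcongr
          _ = 2401 * C * ((1 + ‖y‖) ^ (-(4 : ℝ)) * ‖a y‖ ^ 2) := by ring
      linarith [hk', h2, hnn₁ y]
  rw [oseenSlice_apply]
  have hhint : Integrable (fun y => h₁ y + h₂ y) := hi₁.add hi₂
  refine (norm_integral_le_of_norm_le hhint (Eventually.of_forall hptw)).trans ?_
  rw [integral_add hi₁ hi₂]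
  have hI₁ : ∫ y, h₁ y = C * P * I * σ ^ (-(1 / 2 : ℝ)) := by
    rw [hh₁, integral_const_mul]
    have hW := integral_sub_left_eq_self (fun z : EuclideanSpace ℝ (Fin 3) => (σ + ‖z‖ ^ 2) ^ (-e)) volume x
    rw [hW, integral_add_norm_sq_rpow_neg_half_succ hσ, hI_def]
    ring
  have hI₂ : ∫ y, h₂ y ≤ 2401 * C * Q := by
    rw [hh₂, integral_const_mul]
    exact mul_le_mul_of_nonneg_left hQ (by positivity)
  rw [hI₁]
  linarith [hI₂]

/-! #### The energy pass (S4♭ for the energy class), QC for the class, de-flickering of thin objects -/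

/-- **Per-slice estimate in physical time (energy class).**  `s ∈ [−1/2,0)`, `s < τ < t < 0`, subcritical bound at
time `τ` on `B(0,3/4)`, core point `‖x‖ < 1/2`:
`‖N_{t−τ}[v(τ),v(τ)](x)‖ ≤ 16 C I c₀² (−s)^{-3/4}(t−τ)^{-3/4} + 2401 C · energyWeightConst E`. -/
theorem norm_oseenSlice_le_of_subcritical_L2 {C : ℝ} (hC : 0 < C)
    (hK : ∀ {τ : ℝ}, 0 < τ → ∀ z a b : EuclideanSpace ℝ (Fin 3),
      ‖oseenKernel τ z a b‖ ≤ C * (τ + ‖z‖ ^ 2) ^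
        (-(((Module.finrank ℝ (EuclideanSpace ℝ (Fin 3)) : ℝ) + 1) / 2)) * ‖a‖ * ‖b‖)
    {M E c₀ : ℝ} (hc₀ : 0 < c₀) {v : ℝ → EuclideanSpace ℝ (Fin 3) → EuclideanSpace ℝ (Fin 3)}
    (hv : IsTypeIAncientMild M v) (hEn : LocalEnergyBound E v)
    {s τ t : ℝ} (hs : s ∈ Set.Ico (-(1 / 2 : ℝ)) 0) (hsτ : s < τ) (hτt : τ < t) (ht0 : t < 0)
    (hsubτ : ∀ y ∈ Metric.ball (0 : EuclideanSpace ℝ (Fin 3)) (3 / 4),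
      ‖v τ y‖ ≤ 4 * c₀ * (-s) ^ (-(3 / 8 : ℝ)) * (-τ) ^ (-(1 / 8 : ℝ)))
    {x : EuclideanSpace ℝ (Fin 3)} (hx : ‖x‖ < 1 / 2) :
    ‖oseenSlice (t - τ) (v τ) (v τ) x‖ ≤
      16 * C * (∫ w : EuclideanSpace ℝ (Fin 3), (1 + ‖w‖ ^ 2) ^
          (-(((Module.finrank ℝ (EuclideanSpace ℝ (Fin 3)) : ℝ) + 1) / 2))) * c₀ ^ 2 *
          (-s) ^ (-(3 / 4 : ℝ)) * (t - τ) ^ (-(3 / 4 : ℝ)) +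
      2401 * C * energyWeightConst E := by
  set I : ℝ := ∫ w : EuclideanSpace ℝ (Fin 3), (1 + ‖w‖ ^ 2) ^
      (-(((Module.finrank ℝ (EuclideanSpace ℝ (Fin 3)) : ℝ) + 1) / 2)) with hI_def
  have hI0 : 0 ≤ I := integral_nonneg fun w => Real.rpow_nonneg (by positivity) _
  have hτ0 : τ < 0 := hτt.trans ht0
  have hu0 : 0 < -τ := by linarith
  have hσ : 0 < t - τ := by linarith
  have hσu : t - τ ≤ -τ := by linarith
  -- near bound
  set Pτ : ℝ := (4 * c₀ * (-s) ^ (-(3 / 8 : ℝ)) * (-τ) ^ (-(1 / 8 : ℝ))) ^ 2 with hP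
  have hnear : ∀ y, ‖y‖ < 3 / 4 → ‖v τ y‖ ^ 2 ≤ Pτ := fun y hy => by
    rw [hP]
    exact pow_le_pow_left₀ (norm_nonneg _) (hsubτ y (mem_ball_zero_iff.2 hy)) 2
  -- weighted energy at time `τ ∈ (−1, 0)`
  have hτI : τ ∈ Set.Ioo (-1 : ℝ) 0 := ⟨by linarith [hs.1], hτ0⟩
  have hw := integral_weight_sq_le_of_localEnergy (hv.continuous_slice hτ0) (fun x₀ => hEn x₀ τ hτI)
  have hS := norm_oseenSlice_core_L2 hC hK hσ (P := Pτ) (Q := energyWeightConst E) (by positivity) hnear hw.1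
    hw.2 hx
  -- arithmetic of the near term (as in `norm_oseenSlice_le_of_subcritical`)
  have hP_eq : Pτ = 16 * c₀ ^ 2 * (-s) ^ (-(3 / 4 : ℝ)) * (-τ) ^ (-(1 / 4 : ℝ)) := by
    have hs0 : 0 ≤ -s := by linarith [hs.2]
    rw [hP, mul_pow, mul_pow, mul_pow, ← Real.rpow_mul_natCast hs0, ← Real.rpow_mul_natCast hu0.le]
    norm_num
  have h1 : C * Pτ * I * (t - τ) ^ (-(1 / 2 : ℝ)) ≤
      16 * C * I * c₀ ^ 2 * (-s) ^ (-(3 / 4 : ℝ)) * (t - τ) ^ (-(3 / 4 : ℝ)) := by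
    have hq : (-τ) ^ (-(1 / 4 : ℝ)) ≤ (t - τ) ^ (-(1 / 4 : ℝ)) :=
      Real.rpow_le_rpow_of_nonpos hσ hσu (by norm_num)
    have hsplit : (t - τ) ^ (-(3 / 4 : ℝ)) = (t - τ) ^ (-(1 / 4 : ℝ)) * (t - τ) ^ (-(1 / 2 : ℝ)) := by
      rw [← Real.rpow_add hσ]; norm_num
    have hs34 : 0 ≤ (-s) ^ (-(3 / 4 : ℝ)) := Real.rpow_nonneg (by linarith [hs.2]) _
    have hh : 0 ≤ (t - τ) ^ (-(1 / 2 : ℝ)) := Real.rpow_nonneg hσ.le _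
    rw [hP_eq, hsplit]
    have := mul_le_mul_of_nonneg_left hq (by positivity : 0 ≤ 16 * C * I * c₀ ^ 2 * (-s) ^ (-(3 / 4 : ℝ)) *
      (t - τ) ^ (-(1 / 2 : ℝ)))
    calc C * (16 * c₀ ^ 2 * (-s) ^ (-(3 / 4 : ℝ)) * (-τ) ^ (-(1 / 4 : ℝ))) * I * (t - τ) ^ (-(1 / 2 : ℝ))
        = 16 * C * I * c₀ ^ 2 * (-s) ^ (-(3 / 4 : ℝ)) * (t - τ) ^ (-(1 / 2 : ℝ)) * (-τ) ^ (-(1 / 4 : ℝ)) := by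
          ring
      _ ≤ 16 * C * I * c₀ ^ 2 * (-s) ^ (-(3 / 4 : ℝ)) * (t - τ) ^ (-(1 / 2 : ℝ)) * (t - τ) ^ (-(1 / 4 : ℝ)) :=
          this
      _ = 16 * C * I * c₀ ^ 2 * (-s) ^ (-(3 / 4 : ℝ)) * ((t - τ) ^ (-(1 / 4 : ℝ)) * (t - τ) ^ (-(1 / 2 : ℝ))) := by
          ring
  linarith [hS, h1]

/-- **The energy pass** (S4♭ for the energy class): for `(M, E)` and any level `c₀ > 0` there are `s₂ < 0`, `K ≥ 0`
such that a Type-I ancient mild field with uniform local energy `E`, subcritical on `[s,0) × B(0,3/4)` in the sense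
of S3♭ (`s ∈ [s₂,0)`), is bounded by `K/√(−s)` on `[s,0) × B(0,1/2)`. -/
def EnergyPass (M E : ℝ) : Prop :=
  ∀ c₀ : ℝ, 0 < c₀ → ∃ s₂ K : ℝ, s₂ < 0 ∧ 0 ≤ K ∧
    ∀ v : ℝ → EuclideanSpace ℝ (Fin 3) → EuclideanSpace ℝ (Fin 3),
      IsTypeIAncientMild M v → LocalEnergyBound E v →
      ∀ s ∈ Set.Ico s₂ 0,
        (∀ t ∈ Set.Ico s 0, ∀ x ∈ Metric.ball (0 : EuclideanSpace ℝ (Fin 3)) (3 / 4),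
          ‖v t x‖ ≤ 4 * c₀ * (-s) ^ (-(3 / 8 : ℝ)) * (-t) ^ (-(1 / 8 : ℝ))) →
        ∀ t ∈ Set.Ico s 0, ∀ x ∈ Metric.ball (0 : EuclideanSpace ℝ (Fin 3)) (1 / 2),
          ‖v t x‖ ≤ K / Real.sqrt (-s)

/-- **The energy pass PROVED** (`s₂ = −1/2`; heat part by the maximum principle, Duhamel part by the time integral of
`norm_oseenSlice_le_of_subcritical_L2`: `64 C I c₀² (−s)^{-3/4}(t−s)^{1/4} + 2401 C·c_E·(t−s) ≤ K/√(−s)`). -/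
theorem energyPass (M E : ℝ) : EnergyPass M E := by
  intro c₀ hc₀
  obtain ⟨C, hC, hK⟩ := exists_norm_oseenKernel_le (E := EuclideanSpace ℝ (Fin 3))
  set I : ℝ := ∫ w : EuclideanSpace ℝ (Fin 3), (1 + ‖w‖ ^ 2) ^
      (-(((Module.finrank ℝ (EuclideanSpace ℝ (Fin 3)) : ℝ) + 1) / 2)) with hI_def
  have hI0 : 0 ≤ I := integral_nonneg fun w => Real.rpow_nonneg (by positivity) _
  set a₃ : ℝ := 2401 * C * energyWeightConst E with ha₃
  have ha₃0 : 0 ≤ a₃ := by rw [ha₃]; exact mul_nonneg (by positivity) (energyWeightConst_nonneg E)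
  set K : ℝ := |M| + 64 * C * I * c₀ ^ 2 + a₃ with hK_def
  have hK0 : 0 ≤ K := by rw [hK_def]; positivity
  refine ⟨-(1 / 2), K, by norm_num, hK0, ?_⟩
  intro v hv hEn s hs hsub t ht x hx
  have hM0 : 0 ≤ M := hv.nonneg
  have hMabs : |M| = M := abs_of_nonneg hM0
  have hs0 : 0 < -s := by linarith [hs.2]
  have hs1 : -s ≤ 1 / 2 := by linarith [hs.1]
  have hsq0 : 0 < Real.sqrt (-s) := Real.sqrt_pos.2 hs0
  have hsq1 : Real.sqrt (-s) ≤ 1 := by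
    rw [← Real.sqrt_one]; exact Real.sqrt_le_sqrt (by linarith)
  have hxn : ‖x‖ < 1 / 2 := mem_ball_zero_iff.1 hx
  have hMK : M ≤ K := by
    rw [hK_def, hMabs]
    have : 0 ≤ 64 * C * I * c₀ ^ 2 + a₃ := by positivity
    linarith
  rcases eq_or_lt_of_le ht.1 with hts | hts
  · rw [← hts]
    exact (hv.norm_le hs.2 x).trans (div_le_div_of_nonneg_right hMK hsq0.le)
  have ht0 : t < 0 := ht.2
  have hT0 : 0 < t - s := by linarith
  have hTs : t - s ≤ -s := by linarith
  have hT1 : t - s ≤ 1 := by linarith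
  have h1 := hv.2.2.1 s t hts ht0 x
  have h3 := oseenDuhamel_comp_sub_right 1 0 (t - s) (-s) v v x
  simp only [sub_neg_eq_add, zero_add, sub_add_cancel] at h3
  have hheat : ‖heatFlow (v s) (t - s) x‖ ≤ M / Real.sqrt (-s) := by
    rw [heatFlow_of_pos _ hT0]
    exact UnboundedOperators.norm_heatExtension_le (fun y => hv.norm_le hs.2 y) hT0 x
  set a₁ : ℝ := 16 * C * I * c₀ ^ 2 * (-s) ^ (-(3 / 4 : ℝ)) with ha₁
  set m : ℝ → ℝ := fun τ' => a₁ * (t - s - τ') ^ (-(3 / 4 : ℝ)) + a₃ with hm_def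
  have hk34 : IntegrableOn (fun τ' : ℝ => (t - s - τ') ^ (-(3 / 4 : ℝ))) (Ioo 0 (t - s)) :=
    integrableOn_sub_rpow_Ioo (by norm_num)
  have hkc : IntegrableOn (fun _ : ℝ => a₃) (Ioo 0 (t - s)) := integrableOn_const measure_Ioo_lt_top.ne
  have hmi : IntegrableOn m (Ioo 0 (t - s)) := (hk34.const_mul a₁).add hkc
  have hptw : ∀ᵐ τ' ∂(volume.restrict (Ioo 0 (t - s))),
      ‖oseenSlice (t - s - τ') (v (τ' + s)) (v (τ' + s)) x‖ ≤ m τ' := by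
    filter_upwards [ae_restrict_mem measurableSet_Ioo] with τ' hτ'
    have hsτ : s < τ' + s := by linarith [hτ'.1]
    have hτt : τ' + s < t := by linarith [hτ'.2]
    have hτ0 : τ' + s < 0 := hτt.trans ht0
    have hsl := norm_oseenSlice_le_of_subcritical_L2 hC hK hc₀ hv hEn hs hsτ hτt ht0
      (fun y hy => hsub (τ' + s) ⟨hsτ.le, hτ0⟩ y hy) hxn
    have hσeq : t - (τ' + s) = t - s - τ' := by ring
    rw [hσeq] at hsl
    rw [hm_def]
    simpa only [ha₁, ha₃, hI_def] using hsl
  have hDuh : ‖oseenDuhamel 1 0 (fun τ => v (τ + s)) (fun τ => v (τ + s)) (t - s) x‖ ≤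
      a₁ * (4 * (t - s) ^ (1 / 4 : ℝ)) + a₃ * (t - s) := by
    rw [oseenDuhamel_one_eq_setIntegral_oseenSlice]
    refine (norm_integral_le_of_norm_le hmi hptw).trans (le_of_eq ?_)
    have e1 : ∫ τ' in Ioo 0 (t - s), (a₁ * (t - s - τ') ^ (-(3 / 4 : ℝ)) + a₃) =
        (∫ τ' in Ioo 0 (t - s), a₁ * (t - s - τ') ^ (-(3 / 4 : ℝ))) + ∫ _ in Ioo 0 (t - s), a₃ :=
      integral_add (hk34.const_mul a₁) hkc
    have e3 : ∫ τ' in Ioo 0 (t - s), a₁ * (t - s - τ') ^ (-(3 / 4 : ℝ)) = a₁ * (4 * (t - s) ^ (1 / 4 : ℝ)) := by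
      rw [integral_const_mul, setIntegral_Ioo_sub_rpow_neg_three_quarters hT0.le, sub_zero]
    have e5 : ∫ _ in Ioo 0 (t - s), a₃ = a₃ * (t - s) := by
      rw [setIntegral_const, smul_eq_mul, Real.volume_real_Ioo_of_le hT0.le, sub_zero, mul_comm]
    rw [hm_def]
    show ∫ τ' in Ioo 0 (t - s), (a₁ * (t - s - τ') ^ (-(3 / 4 : ℝ)) + a₃) = _
    rw [e1, e3, e5]
  have hq14 : (t - s) ^ (1 / 4 : ℝ) ≤ (-s) ^ (1 / 4 : ℝ) := Real.rpow_le_rpow hT0.le hTs (by norm_num)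
  have hsinv : (-s) ^ (-(3 / 4 : ℝ)) * (-s) ^ (1 / 4 : ℝ) = 1 / Real.sqrt (-s) := by
    rw [← Real.rpow_add hs0, show (-(3 / 4 : ℝ)) + 1 / 4 = -(1 / 2 : ℝ) by norm_num, Real.rpow_neg hs0.le,
      Real.sqrt_eq_rpow, inv_eq_one_div]
  have hnear_fin : a₁ * (4 * (t - s) ^ (1 / 4 : ℝ)) ≤ 64 * C * I * c₀ ^ 2 / Real.sqrt (-s) := by
    have hs34 : 0 ≤ (-s) ^ (-(3 / 4 : ℝ)) := Real.rpow_nonneg hs0.le _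
    calc a₁ * (4 * (t - s) ^ (1 / 4 : ℝ)) = 64 * C * I * c₀ ^ 2 * ((-s) ^ (-(3 / 4 : ℝ)) * (t - s) ^ (1 / 4 : ℝ)) := by
          rw [ha₁]; ring
      _ ≤ 64 * C * I * c₀ ^ 2 * ((-s) ^ (-(3 / 4 : ℝ)) * (-s) ^ (1 / 4 : ℝ)) := by gcongr
      _ = 64 * C * I * c₀ ^ 2 / Real.sqrt (-s) := by rw [hsinv]; ring
  have hconst_fin : a₃ * (t - s) ≤ a₃ / Real.sqrt (-s) := by
    have h1' : a₃ * (t - s) ≤ a₃ := mul_le_of_le_one_right ha₃0 hT1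
    have h2' : a₃ ≤ a₃ / Real.sqrt (-s) := by
      rw [le_div_iff₀ hsq0]; exact mul_le_of_le_one_right ha₃0 hsq1
    exact h1'.trans h2'
  have hKeq : K / Real.sqrt (-s) = M / Real.sqrt (-s) + 64 * C * I * c₀ ^ 2 / Real.sqrt (-s) +
      a₃ / Real.sqrt (-s) := by
    rw [hK_def, hMabs]
    field_simp
  rw [h1, hKeq]
  calc ‖heatFlow (v s) (t - s) x - oseenDuhamel 1 s v v t x‖
      ≤ ‖heatFlow (v s) (t - s) x‖ + ‖oseenDuhamel 1 s v v t x‖ := norm_sub_le _ _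
    _ ≤ M / Real.sqrt (-s) + (a₁ * (4 * (t - s) ^ (1 / 4 : ℝ)) + a₃ * (t - s)) := by
        rw [← h3]; exact add_le_add hheat hDuh
    _ ≤ M / Real.sqrt (-s) + (64 * C * I * c₀ ^ 2 / Real.sqrt (-s) + a₃ / Real.sqrt (-s)) := by
        linarith [hnear_fin, hconst_fin]
    _ = _ := by ring

/-- **QUIET-CORE PROPAGATION IN THE ENERGY CLASS** (QC with the log-cube budget replaced by uniform local energy). -/
def QuietCoreL2 (M E : ℝ) : Prop :=
  ∃ c₀ s₁ K : ℝ, 0 < c₀ ∧ s₁ < 0 ∧ 0 ≤ K ∧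
    ∀ v : ℝ → EuclideanSpace ℝ (Fin 3) → EuclideanSpace ℝ (Fin 3),
      IsTypeIAncientMild M v → LocalEnergyBound E v →
      ∀ s ∈ Set.Ico s₁ 0,
        (∀ x ∈ Metric.ball (0 : EuclideanSpace ℝ (Fin 3)) 1, ‖v s x‖ ≤ c₀ / Real.sqrt (-s)) →
        ∀ t ∈ Set.Ico s 0, ∀ x ∈ Metric.ball (0 : EuclideanSpace ℝ (Fin 3)) (1 / 2),
          ‖v t x‖ ≤ K / Real.sqrt (-s)

/-- QC (energy class) from S3♭ (budget-free, PROVED: `subcriticalUpgrade_all`) and the energy pass. -/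
theorem quietCoreL2_of_upgrade_of_pass {M E : ℝ} (h3 : SubcriticalUpgrade M) (h4 : EnergyPass M E) :
    QuietCoreL2 M E := by
  obtain ⟨c₀, s₁, hc₀, hs₁, hup⟩ := h3
  obtain ⟨s₂, K, hs₂, hK, hpass⟩ := h4 c₀ hc₀
  refine ⟨c₀, max s₁ s₂, K, hc₀, max_lt hs₁ hs₂, hK, fun v hv hEv s hs hq t ht x hx => ?_⟩
  have hs1 : s ∈ Set.Ico s₁ 0 := ⟨(le_max_left _ _).trans hs.1, hs.2⟩
  have hs2 : s ∈ Set.Ico s₂ 0 := ⟨(le_max_right _ _).trans hs.1, hs.2⟩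
  exact hpass v hv hEv s hs2 (hup v hv s hs1 hq) t ht x hx

/-- **QC IN THE ENERGY CLASS, UNCONDITIONAL.** -/
theorem quietCoreL2_all (M E : ℝ) : QuietCoreL2 M E :=
  quietCoreL2_of_upgrade_of_pass (subcriticalUpgrade_all M) (energyPass M E)

/-- **De-flickering in the energy class**: an apex singularity of a Type-I ancient mild field with uniform local
energy carries a unit-ball rate floor (else arbitrarily late quiet slices exist, QC bounds the core, the apex is regular). -/
theorem localRateFloor_of_singularAt_L2 {M E : ℝ}
    {v : ℝ → EuclideanSpace ℝ (Fin 3) → EuclideanSpace ℝ (Fin 3)}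
    (hv : IsTypeIAncientMild M v) (hEn : LocalEnergyBound E v) (hsing : SingularAt v 0) :
    LocalRateFloor v := by
  obtain ⟨c₀, s₁, K, hc₀, hs₁, -, hcore⟩ := quietCoreL2_all M E
  by_contra hfl
  have hquiet : ∃ s ∈ Set.Ico s₁ 0,
      ∀ x ∈ Metric.ball (0 : EuclideanSpace ℝ (Fin 3)) 1, ‖v s x‖ ≤ c₀ / Real.sqrt (-s) := by
    by_contra hne
    push Not at hne
    exact hfl ⟨c₀, s₁, hc₀, hs₁, fun s hs => by
      obtain ⟨x, hx, hlt⟩ := hne s hs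
      exact ⟨x, hx, hlt.le⟩⟩
  obtain ⟨s, hs, hq⟩ := hquiet
  exact not_singularAt_of_bound hs.2 (hcore v hv hEn s hs hq) hsing

/-- **THIN OBJECTS DO NOT FLICKER**: every thin singular object of the tree (`ThinCascade.ThinObject M q W g`: Type-I
ancient mild in the KNSS gauge, uniform unit-scale energy, `SingularAt W 0`, thin annular trace budget) carries a
unit-ball rate floor `c/√(−s) ≤ ‖W(s, x_s)‖`, `‖x_s‖ < 1`, at all late times.  Unconditional. -/
theorem localRateFloor_of_thinObject {M q : ℝ} {W : ℝ → EuclideanSpace ℝ (Fin 3) → EuclideanSpace ℝ (Fin 3)}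
    {g : EuclideanSpace ℝ (Fin 3) → EuclideanSpace ℝ (Fin 3)} (h : ThinObject M q W g) : LocalRateFloor W := by
  obtain ⟨E, -, hE⟩ := localEnergyBound_of_thinObject h
  exact localRateFloor_of_singularAt_L2 h.1 hE h.2.2.1

/-- A thin object with ONE late quiet unit-core slice does not exist (contrapositive reading of the de-flickering). -/
theorem not_thinObject_of_quiet_slice {M q : ℝ} {W : ℝ → EuclideanSpace ℝ (Fin 3) → EuclideanSpace ℝ (Fin 3)}
    {g : EuclideanSpace ℝ (Fin 3) → EuclideanSpace ℝ (Fin 3)} (h : ThinObject M q W g) :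
    ∃ c₀ s₁ : ℝ, 0 < c₀ ∧ s₁ < 0 ∧ ∀ s ∈ Set.Ico s₁ 0,
      ∃ x ∈ Metric.ball (0 : EuclideanSpace ℝ (Fin 3)) 1, c₀ / Real.sqrt (-s) ≤ ‖W s x‖ :=
  localRateFloor_of_thinObject h

/-! #### The de-flickered LEFT edge -/

/-- **THIN-FLOOR-TOWER LIOUVILLE** (the weakened left hypothesis): every KNSS limit which is a THIN OBJECT and an A–B
TOWER and carries a UNIT-BALL RATE FLOOR is regular at the origin.  Weaker than the tree's `AbRoot.ThinTowerLiouville`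
(one more hypothesis on the object), and — by `localRateFloor_of_thinObject` — EQUIVALENT to it. -/
def ThinFloorTowerLiouville : Prop :=
  ∀ (M q : ℝ), 0 < q →
    ∀ (W : ℝ → EuclideanSpace ℝ (Fin 3) → EuclideanSpace ℝ (Fin 3))
      (g : EuclideanSpace ℝ (Fin 3) → EuclideanSpace ℝ (Fin 3))
      (P : ℝ → EuclideanSpace ℝ (Fin 3) → ℝ)
      (H : ℝ → EuclideanSpace ℝ (Fin 3) → EuclideanSpace ℝ (Fin 3) →L[ℝ] EuclideanSpace ℝ (Fin 3)),
      ThinObject M q W g → ABTower M W P H → LocalRateFloor W → RegPt W 0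

theorem thinFloorTowerLiouville_of_thinTowerLiouville (h : ThinTowerLiouville) : ThinFloorTowerLiouville :=
  fun M q hq W g P H hthin hAB _ => h M q hq W g P H hthin hAB

/-- The floor hypothesis costs nothing: thin objects carry it. -/
theorem thinTowerLiouville_of_thinFloorTowerLiouville (h : ThinFloorTowerLiouville) : ThinTowerLiouville :=
  fun M q hq W g P H hthin hAB => h M q hq W g P H hthin hAB (localRateFloor_of_thinObject hthin)

theorem thinFloorTowerLiouville_iff : ThinFloorTowerLiouville ↔ ThinTowerLiouville :=
  ⟨thinTowerLiouville_of_thinFloorTowerLiouville, thinFloorTowerLiouville_of_thinTowerLiouville⟩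

/-- **THE DE-FLICKERED LEFT EDGE** (crux BY NAME, no stub): `ThinFloorTowerLiouville → TypeIQuantSubcubicExp`.
READING FOR THE LEAD of 24077: the deciding Liouville statement may ASSUME, besides the A–B tower structure
(tree, `AbRoot`), that its thin singular object does NOT flicker — `c/√(−s) ≤ sup_{B(0,1)}‖W(s,·)‖` for all late `s`. -/
theorem typeIQuantSubcubicExp_of_thinFloorTowerLiouville (h : ThinFloorTowerLiouville) :
    Summit.NavierStokesRegularity.NavierStokesRegularity.Theses.QuarterLogPincer.TypeIQuantSubcubicExp :=
  typeIQuantSubcubicExp_of_thinTowerLiouville (thinTowerLiouville_of_thinFloorTowerLiouville h)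

/-- **OBJECT FORM (instrument row, sharpened)**: if 24077 fails there is a KNSS limit which is a thin object AND an A–B
tower, NOT regular at the origin, AND NON-FLICKERING (unit-ball rate floor). -/
theorem exists_thin_singular_floor_abTower_of_not_typeIQuantSubcubicExp
    (h : ¬ Summit.NavierStokesRegularity.NavierStokesRegularity.Theses.QuarterLogPincer.TypeIQuantSubcubicExp) :
    ∃ (M q : ℝ), 0 < q ∧ ∃ (W : ℝ → EuclideanSpace ℝ (Fin 3) → EuclideanSpace ℝ (Fin 3))
      (g : EuclideanSpace ℝ (Fin 3) → EuclideanSpace ℝ (Fin 3))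
      (P : ℝ → EuclideanSpace ℝ (Fin 3) → ℝ)
      (H : ℝ → EuclideanSpace ℝ (Fin 3) → EuclideanSpace ℝ (Fin 3) →L[ℝ] EuclideanSpace ℝ (Fin 3)),
      ThinObject M q W g ∧ ABTower M W P H ∧ ¬ RegPt W 0 ∧ LocalRateFloor W := by
  obtain ⟨M, q, hq, W, g, P, H, hthin, hAB, hreg⟩ := exists_thin_singular_abTower_of_not_typeIQuantSubcubicExp h
  exact ⟨M, q, hq, W, g, P, H, hthin, hAB, hreg, localRateFloor_of_thinObject hthin⟩

end LocalEnergy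

/-! ## §7 (v1.8; v1.9 UNIFORM ONSET) floor level `c₀(M)`, onset `s₀(M,E)` / `s₀(M,B)` independent of the solution.
Consumed by `Lines/quiet_core_concentration.lean` §E (by statement, weaker v1.8 forms) and cubic_rung C2a (b). -/

/-- Uniform floor level AND onset, energy class (`c = c(M)`, `s₀ = s₀(M,E)`, every `v`). -/
theorem uniformFloor_L2 (M : ℝ) : ∃ c : ℝ, 0 < c ∧ ∀ E : ℝ, ∃ s₀ : ℝ, s₀ < 0 ∧
    ∀ v : ℝ → EuclideanSpace ℝ (Fin 3) → EuclideanSpace ℝ (Fin 3),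
      IsTypeIAncientMild M v → LocalEnergyBound E v → SingularAt v 0 →
      ∀ s ∈ Set.Ico s₀ 0,
        ∃ x ∈ Metric.ball (0 : EuclideanSpace ℝ (Fin 3)) 1, c / Real.sqrt (-s) ≤ ‖v s x‖ := by
  obtain ⟨c₀, s₁, hc₀, hs₁, hup⟩ := subcriticalUpgrade_all M
  refine ⟨c₀, hc₀, fun E => ?_⟩
  obtain ⟨s₂, K, hs₂, -, hpass⟩ := energyPass M E c₀ hc₀
  refine ⟨max s₁ s₂, max_lt hs₁ hs₂, fun v hv hEn hsing s hs => ?_⟩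
  by_contra hq
  push Not at hq
  have hs1 : s ∈ Set.Ico s₁ 0 := ⟨(le_max_left _ _).trans hs.1, hs.2⟩
  have hs2 : s ∈ Set.Ico s₂ 0 := ⟨(le_max_right _ _).trans hs.1, hs.2⟩
  exact not_singularAt_of_bound hs.2
    (hpass v hv hEn s hs2 (hup v hv s hs1 fun x hx => (hq x hx).le)) hsing

/-- Uniform floor level AND onset, log-cube class (`s₀ = s₀(M,B)`). -/
theorem uniformFloor_logCube (M : ℝ) : ∃ c : ℝ, 0 < c ∧ ∀ B : ℝ, ∃ s₀ : ℝ, s₀ < 0 ∧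
    ∀ v : ℝ → EuclideanSpace ℝ (Fin 3) → EuclideanSpace ℝ (Fin 3),
      IsTypeIAncientMild M v → CubeBudgetWith B v → SingularAt v 0 →
      ∀ s ∈ Set.Ico s₀ 0,
        ∃ x ∈ Metric.ball (0 : EuclideanSpace ℝ (Fin 3)) 1, c / Real.sqrt (-s) ≤ ‖v s x‖ := by
  obtain ⟨c₀, s₁, hc₀, hs₁, hup⟩ := subcriticalUpgrade_all M
  refine ⟨c₀, hc₀, fun B => ?_⟩
  obtain ⟨s₂, K, hs₂, -, hpass⟩ := budgetPass M B c₀ hc₀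
  refine ⟨max s₁ s₂, max_lt hs₁ hs₂, fun v hv hBv hsing s hs => ?_⟩
  by_contra hq
  push Not at hq
  have hs1 : s ∈ Set.Ico s₁ 0 := ⟨(le_max_left _ _).trans hs.1, hs.2⟩
  have hs2 : s ∈ Set.Ico s₂ 0 := ⟨(le_max_right _ _).trans hs.1, hs.2⟩
  exact not_singularAt_of_bound hs.2
    (hpass v hv hBv s hs2 (hup v hv s hs1 fun x hx => (hq x hx).le)) hsing

end Summit.NavierStokesRegularity.NavierStokesRegularity.Cruxes.TypeIQuantSubcubicExp.QuietCore
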